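/-
Copyright: statement-level skeleton of a published paper (lit-balaban cell, Phase-2 proof seat p26 gen 43). No claims beyond
what the kernel checks below.
-/
import Mathlib
import Literature.MathematicalPhysics.QuantumFieldTheory.Balaban1983to89.B3GraphAmplitudeMajorant
import Literature.MathematicalPhysics.QuantumFieldTheory.Balaban1983to89.B3Ineq213Amplitude

/-!
# B3 — T. Bałaban, *(Higgs)₂,₃ quantum fields in a finite volume. III. Renormalization*, CMP **88** (1983) 411–445
[Balaban1983Higgs3] — p. 426 [PDF 16]: **THE FIRST ESTIMATE OF A GRAPH EXPRESSION, FROM THE INDEX FORM TO THE POSITION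
FORM** — the evaluator `amp` of FILE 1 (`B3GraphAmplitude`: the sum over assignments of indices to the legs) is dominated in
absolute value by a sum over the POSITIONS OF THE VERTICES of a product of non-negative vertex functions and of one
non-negative kernel per line between the positions of its two endpoints — the shape in which print writes and estimates
E(G(j), {□(v)}, Φ′_ext, A_ext) ((2.13)–(2.15) pp. 426–427) and in which p19's `B3Ineq213Amplitude.Amp.E` takes the
localized amplitudes as given (FILE 12 of the evaluator lineage; item 5 / 7b of `HOME/lit-balaban-p26/DESIGN-B3-evaluator.md`)

statement-level skeleton of published theorems with citation tags; proofs where landed; nothing here is a claim about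
the Yang–Mills mass gap

PDF held: `paper:balaban1983-higgs-2-3-quantum-fields-finite-volume` (journal page = PDF page + 410); p. 426 [PDF 16] read by
this seat on the text layer `~/.lit/texts/paper-balaban1983-higgs-2-3-quantum-fields-finite-volume/p0016.txt` and on the ×2 render
`run/shared/lean/pub/pub-balaban/b2b-balaban-ref1/pages/1983-cmp88-higgs23-III/…-p016-x2.png` (2026-08-24).

CITATION HEADER (lean-in-tree rule).  lit-balaban TYPED SKELETON (HOME `run/shared/lean/pub/lit-balaban/`), PHASE 2, seat p26 gen 43
(unit `lit-balaban-p26`; free-target protocol G.5-34(d), own lane, TAKING announced HOME/STATUS.md 2026-08-24T02:28Z; the evaluator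
lineage FILE 1 `B3GraphAmplitude` p361338, FILE 2 `B3GraphAmplitudeRules` p362438, FILE 9 `B3GraphAmplitudeMajorant` p368098).  ROWS
**B3.Eq2.13-2.14** ((2.13) p. 426; head by p19 `B3Ineq213Proof`), **B3.Prop1** (p. 420; where E(G, ·) is consumed), **B3.Def@420**
(the expression E(G, {□(v)}, Φ_ext, A_ext)) of `HOME/lit-balaban-r15/ROWS-B3.md` (fold owner r15; cells only — this file is an OPTIONAL
located member, zero head weight).  CONSUMES BY NAME, nothing re-declared: FILE 1's `Pairing` (`other/symm/ne`, `mate`, `isLower`,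
`Line`, `Ext`, `isLower_iff`, `mate_eq`, `lower_xor`, `other_mate_of_isLower`, `trichotomy`), `SLeg/VLeg/OLeg`, `sPairing/vPairing`,
`sRank/vRank/oRank` + `…_injective`, `SLine/VLine/ExtSLeg/ExtVLeg`, `Rules`, `OutPairing`, `vertexFactor`, `sLineFactor`, `vLineFactor`,
`oLineFactor`, `amp`; FILE 2's `basisE`, `basisV`, `rule16`, `rule17`, `rule18`, `rule19`, `rule110`, `rule111`, `pleg18`, `pleg110`,
`vlegs`, `Model`, `Loc`, `ruleOfKind`, `rulesOf`, `graphAmp`, `inner_basisE`; FILE 9's `abs_rule18_le`, `abs_rule110_le`, `abs_vlegs`,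
`norm_basisE_apply`, `norm_covDeriv_basisE_le`; the typer's `HiggsLattice.{Site, Site.shift, PBond, PBond.tgt, ScalarField, VecField,
ChargeData, covDeriv, mesh_pos}`, `B3Eq18VertexExpansion.{Op, remTensor}`, r15's `B3Prop1.VertexKind` (+ `scalarLegs`, `vectorLegs`,
`diffCount`) and `B3VertexTensorBounds.norm_qpow_mul_remOp_le_one`; p19's `B3Ineq213.{Amp, Amp.E, Amp.η, pts, boxPositions,
mem_boxPositions, supDist, LinesConnect, pts, mem_pts_iff, pt}` and `B3Ineq215.{Model, Model.sc, Model.L_pos_real, Cube, Cube.desc}`;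
p35's `B1Eq214Concrete.val_blockOf`; `HiggsAveraging.{blockIter, blockK, mem_blockK}`; FILE 2's `graphAmp_loc_sum`, `Loc.sum`.

THE PRINTED TEXT (verbatim, p. 426 [PDF 16]).  *"In the next step we make a first estimate of the expression. We estimate it
taking absolute values of all factors. The external fields are estimated further by the Hölder norms and for the operators δG_k
and (1.16) we apply the inequality (2.5). For the propagators G^η_{(j)} we apply the inequality
|G^η_{(j)}(Ω, B̃; x, x′)| ≦ O(1)(L^jη)^{−d+2}e^{−δ₁(L^jη)^{−1}|x−x′|}, (2.10) and if the propagator is differentiated, then for each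
differentiation, there is an additional factor (L^jη)^{−1} on the right side. … Finally in vertices we apply the inequalities |q| ≦ 1,
|R_{n̄+1}(·)| ≦ 1. In the obtained expression we make some partial summations."*  The *"obtained expression"* is a sum over the
positions of the vertices (p. 427 (2.14): *"Σ_{x_v ∈ Δ(v)} …"*; p19's `Amp.E j = Σ_{x_v ∈ □(v)} Π_v η^d u_v(x_v) · Π_l K_l(j_l; x_{v_l},
x_{v′_l})`).

READING (declared).  FILE 1 types E(G, ·) in INDEX FORM (every leg carries an index — a (site, internal index) pair, a bond, an
output index — the vertex rules are evaluated on basis fields and every line contributes the entry of its kernel between the indices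
of its two legs), because p18's graphs record lines as a pairing of legs and not as paths; print's estimate is in POSITION FORM
(one position per VERTEX).  The passage between the two is the content of this file: (A) for an ARBITRARY graph, ARBITRARY
rules and kernels (§§1–2): if every vertex rule evaluated on basis fields is dominated by a position sum
`Σ_x ū_v(x) · Π_{legs j of v} ρ_j(x, index of j)` of a non-negative VERTEX FUNCTION times non-negative ATTACHMENT WEIGHTS of its legs
to the position (for the printed vertices: Kronecker deltas putting the leg's site at the vertex's site or at a neighbour, §3), if
every line kernel contracted against the attachment weights of its two legs is dominated by a POSITION KERNEL `K̄_l(x, x′)`, and the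
external-field components likewise by per-leg non-negative data, then
**|E(G; V, K, Φ)| ≤ Σ_{x : vertices → X} Π_v ū_v(x_v) · Π_{external legs} n(x) · Π_{lines l} K̄_l(x_{v_l}, x_{v′_l})** (`abs_amp_le_positionForm`)
— *"taking absolute values of all factors"* followed by the re-summation of the leg indices vertex by vertex and line by line; the
combinatorial heart is that an assignment of indices to the legs of one species IS an assignment to the external legs together
with an assignment of an index PAIR to every line (`legEquiv`, `sum_assign_split`, `sum_assign_factor`: FILE 1's
`Pairing.trichotomy` made into an equivalence `legs ≃ external ⊕ (lines ⊕ lines)`); (B) for the CONCRETE rules of FILE 2 (§3):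
the attachment lemmas of ALL NINE polarized vertices (1.6)–(1.15) on the coordinate bases, with positions = sites of `T_η` (for the
averaging vertices (1.13)–(1.15): the fine site `x ∈ B^k(y)` of their φ′-leg, the output being read at the block point `y = x^{(k)}`
and the A′-legs through the absolute contour functional `|δ_b(Γ^{(k)}_{y,x})|` of FILE 2's `Model.ctr`), the printed ingredients
`|q| ≦ 1`, `|R_{n̄+1}(·)| ≦ 1` (r15's `B3VertexTensorBounds`), `|U| = 1` and one factor `η⁻¹` per difference quotient (FILE 9) inside
the vertex functions, and the differentiated leg of (1.8)/(1.9) attached to BOTH endpoints of its bond; (C) the assembled bound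
for FILE 2's `graphAmp` on EVERY graph of p18's model (§4), the contraction identities meeting its hypotheses (§5), and the
regrouping into ONE vertex function per vertex and ONE kernel per line of a single line type (§6) — the shape of (2.13)/(2.14) and of
p19's `Amp.E`; (D) INTO p19's CLASS (§7): the chart lemma (a position sum over `T_η` whose vertex functions are supported in charted
unit cubes IS p19's sum over `boxPositions`), the packaging `ampOf` of position-form data as a `B3Ineq213.Amp` (the analytic inputs
`u_le`, `K_le`, connectivity as hypotheses, verbatim in p19's form), `E_ampOf`, and **`abs_graphAmp_le_ampE`**:
`|graphAmp G …| ≤ (ampOf …).E j` — FILE 2's expression of a graph IS dominated by a localized lattice graph amplitude of the class on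
which p19 PROVED (2.13) (`Amp.abs_E_le`, `Amp.ineq213`); (E) THE BLOCK CHART (§8): the coordinate chart `coordChart` of `T_η`, the
label boxes `boxOf y` of the block points, `B^k(y) = coordChart '' pts ⟨k, boxOf y⟩` (`mem_blockK_iff_exists_coordChart`,
`blockK_eq_image_coordChart`, injectivity `coordChart_injOn`), the SUPPORT of the localized vertex functions (`uOfKind_eq_zero_of_site
∕ _bond ∕ _point`, `uOfKind_cube_eq_zero`, `uOfKind_point_eq_zero`, `uOfKind_legProd_eq_zero`), and **`abs_graphAmp_le_ampE_blocks`**: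
the chart hypotheses of (D) discharged for block-localized graphs (p19's `L := L`, `d := d`, unit cubes = `k`-blocks); (F) BLOCK
REFINEMENT (§9): every localization is the sum of its block pieces (`locInBlock`, `sum_locInBlock`), so by FILE 2's
`graphAmp_loc_sum` every localized expression is the finite sum of block-localized ones (`graphAmp_eq_sum_inBlock`,
`abs_graphAmp_le_sum_inBlock`), each piece lives in its block (`uOfKind_inBlock_eq_zero`) with a vertex function at most the
original's (`uOfKind_inBlock_le`), whence **`abs_graphAmp_le_sum_ampE_blocks`**: `|graphAmp G …| ≤ Σ_{y : v ↦ T₁^{(k)}} E_j(piece_y)`,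
every summand in p19's class.

WHAT IS TYPED / PROVED (definitions with bodies + theorems; no `Prop` fact, no `sorry`; standard axioms `propext`, `Classical.choice`,
`Quot.sound`).  §1 on FILE 1's `Pairing` (a species of legs with its lines): `isLower_mate_eq_false`, `mate_mate_of_isLower`,
`other_ne_none_of_isLower`, `other_mate_ne_none_of_isLower`, `isLower_mate_of_upper`; `legFwd`/`legBwd` + `legFwd_ext/_line/_mate`,
**`legEquiv`** (`legs ≃ external legs ⊕ (lines ⊕ lines)`, `legEquiv_apply`, `legEquiv_symm_apply`), `assemble` + `assemble_ext/_line/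
_mate`, **`prod_legs_split`** (`Π_{legs} f = Π_{ext} f · Π_{lines} f(lower) f(upper)`), **`sum_assign_split`** (the sum over index
assignments to the legs = the triple sum over the external indices and the two indices of every line), **`sum_assign_factor`** (a
contracted sum over assignments FACTORIZES into the external sum times one double sum per line); §2 **`abs_amp_le_positionForm`**
(the theorem displayed above, for FILE 1's `amp` over arbitrary rules `V`, bases, kernels `Ks/Kv/Ko`, output pairing and external
data, an arbitrary finite position type `X`, vertex functions `u ≥ 0`, attachment weights `ρS/ρV/ρO ≥ 0`, position kernels
`KS/KV/KO` and per-leg data `nS/nV/nO` under the hypotheses (i)–(iii) of its docstring); §3 on the (Higgs)₂,₃ carriers at level 0: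
`attS` (`[p at x]`), `attD` (`[p at x] + Σ_μ [p at x + ηe_μ]`), `attB` (`[b₋ = x]`) + `…_nonneg`, `abs_inner_basisE_le`,
`norm_basisE_src_eq_attS`, **`norm_covDeriv_basisE_le_attD`** (`‖(D^η_B̃δ_p)(b)‖ ≤ η⁻¹ attD(b₋, p)`), `abs_basisV_le_attB`,
`prod_vlegs_basisV_le`, `bondData` (`Σ_μ [⟨x,μ⟩ ∈ S]|w||Ã|^{n′}`), the vertex functions `u16`, `u17`, `u18`, `u110`, `u19`, `u111` +
`…_nonneg`, the ATTACHMENT LEMMAS **`abs_rule16_basisE_le`**, **`abs_rule17_basisE_le`**, **`abs_rule18_basis_le`**,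
**`abs_rule110_basis_le`**, **`abs_rule19_basis_le`**, **`abs_rule111_basis_le`** (`|V_κ(basis fields at the indices a)| ≤ Σ_x u_κ(x) ·
Π_{legs} att(x, a_j)`), and for the R-vertices `abs_pleg18_op_le`, `abs_pleg110_op_le` (brackets with any tensor of norm `≦ 1`),
**`norm_qpow_mul_remTensor_le_one`** (`|q^m R_{n̄+1}(−ηeÃ_b q)| ≦ 1`, r15's `norm_qpow_mul_remOp_le_one` at the typer's `remTensor`),
the majorant rules **`abs_rule19_le`**, **`abs_rule111_le`** (FILE 9's `abs_rule18_le`/`abs_rule110_le` for the R-vertices); for the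
averaging vertices `attO` (`[r at x^{(k)}]`), `attC` (`|ctr(δ_b)(x)|`) + `…_nonneg`, `norm_basisE_apply'` (any level),
`norm_sum_blockK_basisE_le` (a block sum on a basis field localizes at the leg's site), `abs_sum_inner_basisE_le` (the output pairing
on a basis co-field localizes at the block point), `sum_mul_attS`, `avg_position_bridge`, the vertex functions `u113`, `u114`, `u115`
+ `…_nonneg` and **`abs_rule113_basis_le`**, **`abs_rule114_basis_le`**, **`abs_rule115_basis_le`**; §4 `attSK` (the
attachment of the `j`-th φ′-leg of a kind: `attD` for the differentiated leg, `attS` otherwise), `attVK` (of an A′-leg: `attB` for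
the bond vertices, `attC` for the averaging vertices) + `…_nonneg`, `uOfKind` (the vertex function of a kind for FILE 2's `Model`/`Loc`
data) + `uOfKind_nonneg`, **`abs_ruleOfKind_basis_le`** (dispatch, all nine kinds), and **`abs_graphAmp_le_positionForm`**: for EVERY
graph `G` of p18's model, every `Model`, counterterms, localizations, output pairing, kernels and external data,
`|graphAmp G M dm2 loc Po Ks Kv Ko Φ A Ψ| ≤ Σ_{x : Fin G.nV → T_η} Π_i uOfKind(x_i) · (Π_{ext φ′} nS · Π_{scalar lines} KS(x_{v_l}, x_{v′_l}))
· (Π_{ext A′} nV · Π_{vector lines} KV) · (Π_{unpaired outputs} nO · Π_{output pairs} KO)` whenever `KS/KV/KO` dominate the line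
kernels contracted against the attachments of their endpoints and `nS/nV/nO` the external components; §5 the CONTRACTION identities through which an instantiating seat meets these hypotheses from pointwise data:
`sum_attS_mul` (`Σ_p [p at x] f(p) = Σ_a f(x,a)`), `sum_attD_mul` (`+ Σ_μ Σ_a f(x+ηe_μ, a)`), `sum_attB_mul` (`Σ_μ f(⟨x,μ⟩)`), the line
contractions **`sum2_attS_attS`**, **`sum2_attD_attS`**, `sum2_attS_attD`, `sum2_attD_attD` (a scalar line contracted against the
attachments of its endpoints = the `N × N` blocks of its kernel at `(x, x′)` and at the forward neighbours of the differentiated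
endpoints — where (2.10) and *"for each differentiation … an additional factor (L^jη)^{−1}"* are to be fed in), **`sum2_attB_attB`**
(the `d × d` block of the vector covariance), `sum_attO_mul`, **`sum2_attO_attO`** (an output pair = the `N × N` block of the (1.18)
kernel at the block points), and for product external fields **`sum_att_abs_extS`** / `sum_att_abs_prodExtV`
(`Σ_γ Π_e ρ_e(γ_e)|Π_e φ_e(γ_e)| = Π_e Σ_p ρ_e(p)|φ_e(p)|` — hypothesis (iii) as an equality), and the SUFFICIENT CONDITIONS from
entry bounds of the kernels (where (2.10)/(2.12)/(1.18) are fed in): `attS_le_attD`, `attSK_le_attD`, `nbSum` (a site kernel summed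
over `x`, `x′` and their forward neighbours), **`sum2_attSK_le_of_entry_bound`** (`|K((y,a),(y′,a′))| ≤ κ(y,y′)` ⇒ any scalar line
contracted ≤ `N²·nbSum κ (x,x′)`, for every pair of endpoint kinds), `sum2_attB_le_of_entry_bound` (`≤ d²κ(x,x′)`),
`sum2_attO_le_of_entry_bound` (`≤ N²κ(x^{(k)},x′^{(k)})`); §6 `Lines G Po` (`SLine ⊕ VLine ⊕
output pairs`), `lineSrc`/`lineTgt` (the vertices `v_l`, `v′_l` of the two endpoints), `lineKer`, `extAt` (the external data sitting at
a vertex), **`positionForm_eq_lines`** (the bound's summand = `Π_i (ū_i · extAt_i)(x_i) · Π_{l : Lines} K̄_l(x_{v_l}, x_{v′_l})`) and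
**`abs_graphAmp_le_lines`** (`|graphAmp …| ≤ Σ_x Π_i U_i(x_i) · Π_{l : Lines G Po} K̄_l(x_{lineSrc l}, x_{lineTgt l})`); §7 `chartTuple`,
`chartTuple_injOn`, **`sum_positions_eq_boxSum`** (chart lemma), **`ampOf`** (a `B3Ineq213.Amp M` from charts `c_v`, vertex functions
`U_v` — stored as `u_v = η^{−d}·U_v∘c_v` — kernels per line and scale index, and p19's hypotheses `u_le`/`K_le`/`conn` supplied by the
caller), **`E_ampOf`** (`(ampOf …).E j = Σ_{ξ ∈ boxPositions} Π_v U_v(c_v ξ_v) · Π_l K_l(j_l; c ξ_{v_l}, c ξ_{v′_l})`), `modelOfGraph` (the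
(2.14) generalized graph of p18's `G` + `Po`: lines `Lines G Po` enumerated by `eL : Fin m ≃ Lines G Po`), and **`abs_graphAmp_le_ampE`**;
§8 `sitesPerDir_zero_eq`, `val_blockIter`, **`coordChart`**, **`boxOf`**, `mem_pts_boxOf`, `lt_sitesPerDir_of_mem_pts`, `val_coordChart`,
`coordChart_injOn`, **`mem_blockK_iff_exists_coordChart`**, `blockK_eq_image_coordChart`, `uOfKind_eq_zero_of_site ∕ _of_bond ∕ _of_point`,
`uOfKind_cube_eq_zero`, `uOfKind_point_eq_zero`, `uOfKind_legProd_eq_zero`, **`abs_graphAmp_le_ampE_blocks`**; §9 **`locInBlock`**,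
`sum_locInBlock`, `graphAmp_eq_sum_inBlock`, `abs_graphAmp_le_sum_inBlock`, `uOfKind_inBlock_eq_zero`, `uOfKind_inBlock_le`,
**`abs_graphAmp_le_sum_ampE_blocks`**.
HONEST SCOPE.  (a) Bookkeeping (triangle inequality, re-summation of finite sums) and the printed vertex ingredients; NO kernel
bound ((2.5), (2.10)–(2.12) are hypotheses `hKs/hKv/hKo` here, exactly as `K_le` is a hypothesis of p19's `Amp`), no tree-length
extraction, no summation over positions — those are p19's `B3Ineq213Amplitude`/`B3Ineq213Proof`.  (b) §7 packages the
position form into p19's `Amp M` with the ANALYTIC INPUTS AS HYPOTHESES, verbatim in p19's form: the vertex bounds `u_le` (couplings,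
`η`-powers `e_v`, norms of the external fields), the line bounds `K_le` ((2.10)–(2.12) with the dimensions `a_l`), connectivity, and
the chart data (injective charts `c_v` of the cubes `□(v)` into `T_η` on whose images the vertex functions are supported); deriving
these for the tree's propagators (Propositions I.2.1/I.2.3, rows B3.Eq2.10–2.12) and from the catalogue's counts (`e_v`, `a_l` of
(2.14), `B3Ineq215.Counts`) is NOT done here. §8 discharges the CHART hypotheses for graphs whose vertex functions live in blocks
`B^k(y_v)` (the unit-cube and point localizations of p. 420); for the SMOOTH leg localizations of the vector-leg vertices p. 420
only gives *"a support of each function is contained in a cube with sides of length 2"*; §9 refines ANY localization into its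
block pieces and bounds `|graphAmp|` by the SUM over block assignments of packaged amplitudes (`abs_graphAmp_le_sum_ampE_blocks`) —
the number of non-vanishing assignments (boundedly many blocks meet a side-2 support) and the comparison of the tree lengths of
the refined cubes with `d({□(v)})` of the supports, which the user of (2.13) needs to re-sum, are NOT estimated here
(`uOfKind_legProd_eq_zero` records the support statement). p19 reads the positions of (2.13) on `ηℤ^d_{≥0}`
with sup-norm LABEL distances (its header: *"Reading choices … positions on ηℤ^d_{≥0} in η-units, sup-norm distances"*); through
the coordinate chart the hypothesis `K_le` therefore asks the kernels of `T_η`, read at the points of the cubes, to decay in the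
label distance — for periodic kernels this is the torus distance only away from the seam of the chart; the periodic
identification is outside p19's class and is NOT repaired here (the packaged kernels are set to zero off the cubes, where p19's `E_j`
never reads them).  (c) All nine kinds are covered, so §4 holds for every graph of p18's model; for the averaging
vertices the A′-leg attachment is the absolute contour functional `|ctr(δ_b)(x)|` of FILE 2's `Model` with NO property of `ctr` used —
the (2.12) bookkeeping of averaged legs (*"an additional factor L^jη"*) is the content of the hypothesis `hKv` there, to be discharged
by the instantiating seat from the tree's contours; likewise `[x^{(k)} ∈ T₁^{(k)} ∩ Ω]` and the averaging weight sit inside `u113`–`u115`.  (d) Print never displays this passage as a formula; the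
position form is OUR reading of *"the obtained expression"*, fixed so that it is the input shape of (2.13)/(2.14).  Unit
`lit-balaban-p26` gen 43 (literature-prover-lit-balaban-p26-g43-0), HOME `run/shared/lean/pub/lit-balaban/`, 2026-08-24.
-/

open Finset
open scoped BigOperators

namespace Literature.MathematicalPhysics.QuantumFieldTheory.Balaban1983to89.B3GraphAmplitudePositionForm

open Literature.MathematicalPhysics.QuantumFieldTheory.Balaban1983to89.B3Cor23Concrete (Graph)
open Literature.MathematicalPhysics.QuantumFieldTheory.Balaban1983to89.B3GraphAmplitude
open Literature.MathematicalPhysics.QuantumFieldTheory.Balaban1983to89.B3GraphAmplitudeRules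
open Literature.MathematicalPhysics.QuantumFieldTheory.Balaban1983to89.B3GraphAmplitudeMajorant

noncomputable section

/-! ## §1 The legs of a species ≃ external legs ⊕ (lines ⊕ lines); factorization of the sum over index assignments -/

section PairingSplit

variable {L : Type*} (Pr : Pairing L) (rank : L → ℕ)

/-- The mate of a lower endpoint is NOT a lower endpoint (each line has exactly one lower endpoint, FILE 1's `lower_xor`).
[cite: Balaban1983Higgs3, p.415] -/
theorem isLower_mate_eq_false (hr : Function.Injective rank) {x : L} (hx : Pr.isLower rank x = true) :
    Pr.isLower rank (Pr.mate x) = false := by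
  have h := Pr.other_mate_of_isLower rank hx
  rcases Pr.lower_xor rank hr h with ⟨-, h2⟩ | ⟨h1, -⟩
  · rw [hx] at h2
    cases h2
  · exact h1

/-- The mate of the mate of a lower endpoint is the endpoint. [cite: Balaban1983Higgs3, p.415] -/
theorem mate_mate_of_isLower {x : L} (hx : Pr.isLower rank x = true) : Pr.mate (Pr.mate x) = x :=
  Pr.mate_eq (Pr.other_mate_of_isLower rank hx)

/-- A lower endpoint is an internal leg. [cite: Balaban1983Higgs3, p.415] -/
theorem other_ne_none_of_isLower {x : L} (hx : Pr.isLower rank x = true) : Pr.other x ≠ none := by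
  obtain ⟨y, hy, -⟩ := (Pr.isLower_iff rank x).1 hx
  rw [hy]
  exact Option.some_ne_none y

/-- The mate of a lower endpoint is an internal leg. [cite: Balaban1983Higgs3, p.415] -/
theorem other_mate_ne_none_of_isLower {x : L} (hx : Pr.isLower rank x = true) : Pr.other (Pr.mate x) ≠ none := by
  rw [Pr.other_mate_of_isLower rank hx]
  exact Option.some_ne_none x

/-- An internal leg which is not a lower endpoint is the UPPER endpoint of its line: its mate is the lower endpoint, whose
mate it is (FILE 1's `trichotomy`). [cite: Balaban1983Higgs3, p.415] -/
theorem isLower_mate_of_upper (hr : Function.Injective rank) {x : L} (h1 : Pr.other x ≠ none)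
    (h2 : ¬Pr.isLower rank x = true) : Pr.isLower rank (Pr.mate x) = true ∧ Pr.mate (Pr.mate x) = x := by
  rcases Pr.trichotomy rank hr x with h | h | ⟨-, hm, hmm⟩
  · exact absurd h h1
  · exact absurd h h2
  · exact ⟨hm, hmm⟩

/-- The forward map of the leg equivalence: an external leg goes to itself, a lower endpoint to its line (left copy), an
upper endpoint to its line (right copy). [cite: Balaban1983Higgs3, p.415] -/
def legFwd (hr : Function.Injective rank) (x : L) : Pr.Ext ⊕ (Pr.Line rank ⊕ Pr.Line rank) :=
  if h : Pr.other x = none then Sum.inl ⟨x, h⟩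
  else if h' : Pr.isLower rank x = true then Sum.inr (Sum.inl ⟨x, h'⟩)
  else Sum.inr (Sum.inr ⟨Pr.mate x, (isLower_mate_of_upper Pr rank hr h h').1⟩)

/-- The backward map: an external leg, the lower endpoint of a line, the upper endpoint (= the mate of the lower endpoint)
of a line. [cite: Balaban1983Higgs3, p.415] -/
def legBwd : Pr.Ext ⊕ (Pr.Line rank ⊕ Pr.Line rank) → L
  | Sum.inl e => e.1
  | Sum.inr (Sum.inl l) => l.1
  | Sum.inr (Sum.inr l) => Pr.mate l.1

/-- `legFwd` on an external leg. [cite: Balaban1983Higgs3, p.415] -/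
theorem legFwd_ext (hr : Function.Injective rank) (e : Pr.Ext) : legFwd Pr rank hr e.1 = Sum.inl e := by
  unfold legFwd
  rw [dif_pos e.2]

/-- `legFwd` on a lower endpoint. [cite: Balaban1983Higgs3, p.415] -/
theorem legFwd_line (hr : Function.Injective rank) (l : Pr.Line rank) : legFwd Pr rank hr l.1 = Sum.inr (Sum.inl l) := by
  unfold legFwd
  rw [dif_neg (other_ne_none_of_isLower Pr rank l.2), dif_pos l.2]

/-- `legFwd` on an upper endpoint. [cite: Balaban1983Higgs3, p.415] -/
theorem legFwd_mate (hr : Function.Injective rank) (l : Pr.Line rank) :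
    legFwd Pr rank hr (Pr.mate l.1) = Sum.inr (Sum.inr l) := by
  unfold legFwd
  have h2 : ¬Pr.isLower rank (Pr.mate l.1) = true := by
    rw [isLower_mate_eq_false Pr rank hr l.2]
    exact Bool.false_ne_true
  rw [dif_neg (other_mate_ne_none_of_isLower Pr rank l.2), dif_neg h2]
  congr 2
  exact Subtype.ext (mate_mate_of_isLower Pr rank l.2)

/-- **The legs of a species ≃ its external legs ⊕ (its lines ⊕ its lines)**: every leg is exactly one of — external, the lower
endpoint of its line, the upper endpoint of its line (FILE 1's `Pairing.trichotomy`, as an equivalence of finite types).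
[cite: Balaban1983Higgs3, p.415] -/
def legEquiv (hr : Function.Injective rank) : L ≃ Pr.Ext ⊕ (Pr.Line rank ⊕ Pr.Line rank) where
  toFun := legFwd Pr rank hr
  invFun := legBwd Pr rank
  left_inv x := by
    show legBwd Pr rank (legFwd Pr rank hr x) = x
    unfold legFwd
    by_cases h : Pr.other x = none
    · rw [dif_pos h]
      rfl
    · rw [dif_neg h]
      by_cases h' : Pr.isLower rank x = true
      · rw [dif_pos h']
        rfl
      · rw [dif_neg h']
        exact (isLower_mate_of_upper Pr rank hr h h').2
  right_inv y := by
    show legFwd Pr rank hr (legBwd Pr rank y) = y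
    rcases y with e | l | l
    · exact legFwd_ext Pr rank hr e
    · exact legFwd_line Pr rank hr l
    · exact legFwd_mate Pr rank hr l

/-- `legEquiv` is `legFwd`. [cite: Balaban1983Higgs3, p.415] -/
theorem legEquiv_apply (hr : Function.Injective rank) (x : L) : legEquiv Pr rank hr x = legFwd Pr rank hr x := rfl

/-- `legEquiv.symm` is `legBwd`. [cite: Balaban1983Higgs3, p.415] -/
theorem legEquiv_symm_apply (hr : Function.Injective rank) (y : Pr.Ext ⊕ (Pr.Line rank ⊕ Pr.Line rank)) :
    (legEquiv Pr rank hr).symm y = legBwd Pr rank y := rfl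

variable {I : Type*}

/-- ASSEMBLING an assignment of indices to the legs of a species from its three parts: the indices of the external legs, of
the lower endpoints and of the upper endpoints of the lines. [cite: Balaban1983Higgs3, p.415] -/
def assemble (hr : Function.Injective rank) (γ : Pr.Ext → I) (π₁ π₂ : Pr.Line rank → I) : L → I :=
  fun x => Sum.elim γ (Sum.elim π₁ π₂) (legEquiv Pr rank hr x)

/-- the assembled assignment on an external leg. [cite: Balaban1983Higgs3, p.415] -/
theorem assemble_ext (hr : Function.Injective rank) (γ : Pr.Ext → I) (π₁ π₂ : Pr.Line rank → I) (e : Pr.Ext) :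
    assemble Pr rank hr γ π₁ π₂ e.1 = γ e := by
  unfold assemble
  rw [legEquiv_apply, legFwd_ext]
  rfl

/-- the assembled assignment on a lower endpoint. [cite: Balaban1983Higgs3, p.415] -/
theorem assemble_line (hr : Function.Injective rank) (γ : Pr.Ext → I) (π₁ π₂ : Pr.Line rank → I) (l : Pr.Line rank) :
    assemble Pr rank hr γ π₁ π₂ l.1 = π₁ l := by
  unfold assemble
  rw [legEquiv_apply, legFwd_line]
  rfl

/-- the assembled assignment on an upper endpoint. [cite: Balaban1983Higgs3, p.415] -/
theorem assemble_mate (hr : Function.Injective rank) (γ : Pr.Ext → I) (π₁ π₂ : Pr.Line rank → I) (l : Pr.Line rank) :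
    assemble Pr rank hr γ π₁ π₂ (Pr.mate l.1) = π₂ l := by
  unfold assemble
  rw [legEquiv_apply, legFwd_mate]
  rfl

variable [Fintype L]

/-- **A product over the legs of a species splits into the product over the external legs times, for every line, the product
of the factors of its two endpoints.** [cite: Balaban1983Higgs3, p.415] -/
theorem prod_legs_split (hr : Function.Injective rank) (f : L → ℝ) :
    ∏ x, f x = (∏ e : Pr.Ext, f e.1) * ∏ l : Pr.Line rank, f l.1 * f (Pr.mate l.1) := by
  have h := Fintype.prod_equiv (legEquiv Pr rank hr).symm
    (Sum.elim (fun e : Pr.Ext => f e.1) (Sum.elim (fun l : Pr.Line rank => f l.1) (fun l => f (Pr.mate l.1)))) f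
    (fun y => by rcases y with e | l | l <;> rfl)
  rw [← h, Fintype.prod_sum_type, Fintype.prod_sum_type, Finset.prod_mul_distrib]
  rfl

/-- kernel: a sum over the functions on a sum type is the double sum over the pairs of functions. [folklore] -/
private theorem sum_arrow_sum {A B J : Type*} [Fintype A] [Fintype B] [Fintype J] [DecidableEq A] [DecidableEq B]
    (Ψ : (A ⊕ B → J) → ℝ) : ∑ f, Ψ f = ∑ g : A → J, ∑ h : B → J, Ψ (Sum.elim g h) := by
  rw [← Fintype.sum_prod_type']
  refine Fintype.sum_equiv (Equiv.sumArrowEquivProdArrow A B J) _ _ fun f => ?_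
  congr 1
  funext x
  rcases x with a | b <;> rfl

variable [DecidableEq L] [Fintype I]

/-- **The sum over the assignments of indices to the legs of a species is the triple sum over the assignments to the external
legs, to the lower endpoints and to the upper endpoints of the lines.** [cite: Balaban1983Higgs3, p.415] -/
theorem sum_assign_split (hr : Function.Injective rank) (Φ : (L → I) → ℝ) :
    ∑ α : L → I, Φ α =
      ∑ γ : Pr.Ext → I, ∑ π₁ : Pr.Line rank → I, ∑ π₂ : Pr.Line rank → I, Φ (assemble Pr rank hr γ π₁ π₂) := by
  have h1 : ∑ α : L → I, Φ α =
      ∑ αh : Pr.Ext ⊕ (Pr.Line rank ⊕ Pr.Line rank) → I, Φ (αh ∘ legEquiv Pr rank hr) := by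
    refine Fintype.sum_equiv ((legEquiv Pr rank hr).arrowCongr (Equiv.refl I)) _ _ fun α => ?_
    congr 1
    funext x
    simp [Equiv.arrowCongr_apply]
  rw [h1, sum_arrow_sum]
  refine Finset.sum_congr rfl fun γ _ => ?_
  rw [sum_arrow_sum]
  rfl

/-- **FACTORIZATION of a contracted sum over index assignments**: if the summand is (a function of the external indices) ×
(one attachment weight per leg) × (one kernel per line between the indices of its two endpoints), the sum over all
assignments is (the sum over the external indices) × Π_{lines} (the double sum over the index pair of the line) — the
re-summation *"line by line"* behind the position form. [cite: Balaban1983Higgs3, (2.13) p.426] -/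
theorem sum_assign_factor (hr : Function.Injective rank) (F : (Pr.Ext → I) → ℝ) (ρ : L → I → ℝ)
    (g : Pr.Line rank → I → I → ℝ) :
    ∑ α : L → I, (∏ x, ρ x (α x)) * F (fun e => α e.1) * ∏ l : Pr.Line rank, g l (α l.1) (α (Pr.mate l.1)) =
      (∑ γ : Pr.Ext → I, (∏ e : Pr.Ext, ρ e.1 (γ e)) * F γ) *
        ∏ l : Pr.Line rank, ∑ p, ∑ p', ρ l.1 p * ρ (Pr.mate l.1) p' * g l p p' := by
  rw [sum_assign_split Pr rank hr]
  have hsummand : ∀ (γ : Pr.Ext → I) (π₁ π₂ : Pr.Line rank → I),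
      (∏ x, ρ x (assemble Pr rank hr γ π₁ π₂ x)) * F (fun e => assemble Pr rank hr γ π₁ π₂ e.1) *
          ∏ l : Pr.Line rank, g l (assemble Pr rank hr γ π₁ π₂ l.1) (assemble Pr rank hr γ π₁ π₂ (Pr.mate l.1)) =
        ((∏ e : Pr.Ext, ρ e.1 (γ e)) * F γ) * ∏ l : Pr.Line rank, ρ l.1 (π₁ l) * ρ (Pr.mate l.1) (π₂ l) * g l (π₁ l) (π₂ l) := by
    intro γ π₁ π₂
    rw [prod_legs_split Pr rank hr]
    simp only [assemble_ext, assemble_line, assemble_mate]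
    rw [Finset.prod_mul_distrib (f := fun l : Pr.Line rank => ρ l.1 (π₁ l) * ρ (Pr.mate l.1) (π₂ l))]
    ring
  simp only [hsummand]
  have hinner : ∀ γ : Pr.Ext → I,
      ∑ π₁ : Pr.Line rank → I, ∑ π₂ : Pr.Line rank → I,
          ((∏ e : Pr.Ext, ρ e.1 (γ e)) * F γ) * ∏ l : Pr.Line rank, ρ l.1 (π₁ l) * ρ (Pr.mate l.1) (π₂ l) * g l (π₁ l) (π₂ l) =
        ((∏ e : Pr.Ext, ρ e.1 (γ e)) * F γ) * ∏ l : Pr.Line rank, ∑ p, ∑ p', ρ l.1 p * ρ (Pr.mate l.1) p' * g l p p' := by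
    intro γ
    have h2 : ∀ π₁ : Pr.Line rank → I,
        ∑ π₂ : Pr.Line rank → I, ∏ l : Pr.Line rank, ρ l.1 (π₁ l) * ρ (Pr.mate l.1) (π₂ l) * g l (π₁ l) (π₂ l) =
          ∏ l : Pr.Line rank, ∑ p', ρ l.1 (π₁ l) * ρ (Pr.mate l.1) p' * g l (π₁ l) p' := fun π₁ =>
      (Fintype.prod_sum fun (l : Pr.Line rank) (p' : I) => ρ l.1 (π₁ l) * ρ (Pr.mate l.1) p' * g l (π₁ l) p').symm
    have h3 : ∑ π₁ : Pr.Line rank → I, ∏ l : Pr.Line rank, ∑ p', ρ l.1 (π₁ l) * ρ (Pr.mate l.1) p' * g l (π₁ l) p' =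
        ∏ l : Pr.Line rank, ∑ p, ∑ p', ρ l.1 p * ρ (Pr.mate l.1) p' * g l p p' :=
      (Fintype.prod_sum fun (l : Pr.Line rank) (p : I) => ∑ p', ρ l.1 p * ρ (Pr.mate l.1) p' * g l p p').symm
    rw [← h3]
    simp only [← h2]
    simp only [Finset.mul_sum]
  simp only [hinner]
  rw [Finset.sum_mul]

end PairingSplit

/-! ## §2 The position form: `|E(G; V, K, Φ)| ≤ Σ_{x : vertices → X} Π_v ū_v(x_v) · Π_{ext} n(x) · Π_{lines} K̄(x, x′)` -/

section PositionForm

variable {nbar : ℕ} {G : Graph nbar} {SF VF OF : Type*} {IS IV IO X : Type*} [Fintype IS] [Fintype IV] [Fintype IO] [Fintype X]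

/-- kernel: a product over the legs of a family of vertices is the iterated product vertex by vertex. [folklore] -/
private theorem prod_sigma_univ {ι : Type*} [Fintype ι] {κ : ι → Type*} [∀ i, Fintype (κ i)] (f : (Σ i, κ i) → ℝ) :
    ∏ x, f x = ∏ i, ∏ j, f ⟨i, j⟩ := by
  rw [← Finset.univ_sigma_univ, Finset.prod_sigma]

/-- kernel: a quadruple sum with the fourth index moved outermost. [folklore] -/
private theorem sum3_sum_comm {A B C D : Type*} [Fintype A] [Fintype B] [Fintype C] [Fintype D]
    (f : A → B → C → D → ℝ) : ∑ a, ∑ b, ∑ c, ∑ d, f a b c d = ∑ d, ∑ a, ∑ b, ∑ c, f a b c d := by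
  have h1 : ∀ a b, ∑ c, ∑ d, f a b c d = ∑ d, ∑ c, f a b c d := fun a b => Finset.sum_comm
  simp only [h1]
  have h2 : ∀ a, ∑ b, ∑ d, ∑ c, f a b c d = ∑ d, ∑ b, ∑ c, f a b c d := fun a => Finset.sum_comm
  simp only [h2]
  exact Finset.sum_comm

/-- kernel: a constant factor leaves a triple sum. [folklore] -/
private theorem sum3_const_mul {A B C : Type*} [Fintype A] [Fintype B] [Fintype C] (P : ℝ) (f : A → B → C → ℝ) :
    ∑ a, ∑ b, ∑ c, P * f a b c = P * ∑ a, ∑ b, ∑ c, f a b c := by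
  simp only [Finset.mul_sum]

/-- kernel: a triple sum of products of one-variable factors is the product of the three sums. [folklore] -/
private theorem sum3_mul {A B C : Type*} [Fintype A] [Fintype B] [Fintype C] (a : A → ℝ) (b : B → ℝ) (c : C → ℝ) :
    ∑ α, ∑ β, ∑ ο, a α * b β * c ο = (∑ α, a α) * (∑ β, b β) * ∑ ο, c ο := by
  symm
  rw [Finset.sum_mul_sum, Finset.sum_mul]
  refine Finset.sum_congr rfl fun α _ => ?_
  rw [Finset.sum_mul]
  refine Finset.sum_congr rfl fun β _ => ?_
  rw [Finset.mul_sum]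

/-- **THE FIRST ESTIMATE IN POSITION FORM** (p. 426: *"We estimate it taking absolute values of all factors … in vertices we
apply the inequalities |q| ≦ 1, |R_{n̄+1}(·)| ≦ 1. In the obtained expression we make some partial summations"*): let `X` be a
finite type of POSITIONS and suppose (i) every vertex rule on basis fields is dominated by a position sum of a non-negative vertex
function `ū_i` times non-negative ATTACHMENT WEIGHTS of its legs, `|V_i(b∘a)| ≤ Σ_x ū_i(x) Π_j ρ_{ij}(x, a_j)`; (ii) every line
kernel contracted against the attachment weights of its two endpoints is dominated by a POSITION KERNEL,
`Σ_{p,p′} ρ_ℓ(x,p) ρ_{ℓ′}(x′,p′) |K_l(p,p′)| ≤ K̄_l(x,x′)`; (iii) the external components contracted against the attachment weights of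
the external legs are dominated by a product of per-leg data, `Σ_γ Π_e ρ_e(ξ_e, γ_e) |Φ(γ)| ≤ Π_e n_e(ξ_e)`.  Then the expression of
the graph is dominated by THE SUM OVER THE POSITIONS OF THE VERTICES of the product of the vertex functions, the external data
and one position kernel per line between the positions of its endpoints:
`|E(G; V, K, Φ, A, Ψ)| ≤ Σ_{x : V(G) → X} Π_i ū_i(x_i) · Π_{e} n_e(x_{v(e)}) · Π_{l} K̄_l(x_{v_l}, x_{v′_l})` (species by species).
[cite: Balaban1983Higgs3, (2.13) p.426] [cite: Balaban1983Higgs3, (2.14) p.427] -/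
theorem abs_amp_le_positionForm (V : Rules G SF VF OF) (bS : IS → SF) (bV : IV → VF) (bO : IO → OF) (Po : OutPairing G)
    (Ks : SLine G → IS → IS → ℝ) (Kv : VLine G → IV → IV → ℝ) (Ko : Po.Line oRank → IO → IO → ℝ)
    (Φ : (ExtSLeg G → IS) → ℝ) (A : (ExtVLeg G → IV) → ℝ) (Ψ : (Po.Ext → IO) → ℝ)
    (u : Fin G.nV → X → ℝ) (hu : ∀ i x, 0 ≤ u i x)
    (ρS : SLeg G.kind → X → IS → ℝ) (hρS : ∀ ℓ x p, 0 ≤ ρS ℓ x p)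
    (ρV : VLeg G.kind → X → IV → ℝ) (hρV : ∀ ℓ x b, 0 ≤ ρV ℓ x b)
    (ρO : OLeg G.kind → X → IO → ℝ) (hρO : ∀ ℓ x r, 0 ≤ ρO ℓ x r)
    (hV : ∀ (i : Fin G.nV) (aS : Fin (G.kind i).scalarLegs → IS) (aV : Fin (G.kind i).vectorLegs → IV)
      (aO : Fin (outSlots (G.kind i)) → IO),
      |V i (fun j => bS (aS j)) (fun j => bV (aV j)) (fun j => bO (aO j))| ≤
        ∑ x, u i x * ((∏ j, ρS ⟨i, j⟩ x (aS j)) * (∏ j, ρV ⟨i, j⟩ x (aV j)) * ∏ j, ρO ⟨i, j⟩ x (aO j)))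
    (KS : SLine G → X → X → ℝ)
    (hKs : ∀ (l : SLine G) (x x' : X),
      ∑ p, ∑ p', ρS l.1 x p * ρS ((sPairing G).mate l.1) x' p' * |Ks l p p'| ≤ KS l x x')
    (KV : VLine G → X → X → ℝ)
    (hKv : ∀ (l : VLine G) (x x' : X),
      ∑ b, ∑ b', ρV l.1 x b * ρV ((vPairing G).mate l.1) x' b' * |Kv l b b'| ≤ KV l x x')
    (KO : Po.Line oRank → X → X → ℝ)
    (hKo : ∀ (l : Po.Line oRank) (x x' : X),
      ∑ r, ∑ r', ρO l.1 x r * ρO (Po.mate l.1) x' r' * |Ko l r r'| ≤ KO l x x')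
    (nS : ExtSLeg G → X → ℝ)
    (hΦ : ∀ ξ : ExtSLeg G → X, ∑ γ : ExtSLeg G → IS, (∏ e, ρS e.1 (ξ e) (γ e)) * |Φ γ| ≤ ∏ e, nS e (ξ e))
    (nV : ExtVLeg G → X → ℝ)
    (hA : ∀ ξ : ExtVLeg G → X, ∑ ζ : ExtVLeg G → IV, (∏ e, ρV e.1 (ξ e) (ζ e)) * |A ζ| ≤ ∏ e, nV e (ξ e))
    (nO : Po.Ext → X → ℝ)
    (hΨ : ∀ ξ : Po.Ext → X, ∑ ο : Po.Ext → IO, (∏ e, ρO e.1 (ξ e) (ο e)) * |Ψ ο| ≤ ∏ e, nO e (ξ e)) :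
    |amp V bS bV bO Po Ks Kv Ko Φ A Ψ| ≤
      ∑ x : Fin G.nV → X, (∏ i, u i (x i)) *
        (((∏ e : ExtSLeg G, nS e (x e.1.1)) * ∏ l : SLine G, KS l (x l.1.1) (x ((sPairing G).mate l.1).1)) *
          ((∏ e : ExtVLeg G, nV e (x e.1.1)) * ∏ l : VLine G, KV l (x l.1.1) (x ((vPairing G).mate l.1).1)) *
          ((∏ e : Po.Ext, nO e (x e.1.1)) * ∏ l : Po.Line oRank, KO l (x l.1.1) (x (Po.mate l.1).1))) := by
  classical
  /- the vertex factor at an assignment is dominated by the position sum of Π ū · Π (attachment weights) -/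
  have hvf : ∀ (α : SLeg G.kind → IS) (β : VLeg G.kind → IV) (ο : OLeg G.kind → IO),
      |vertexFactor V bS bV bO α β ο| ≤ ∑ x : Fin G.nV → X, (∏ i, u i (x i)) *
        ((∏ ℓ : SLeg G.kind, ρS ℓ (x ℓ.1) (α ℓ)) * (∏ ℓ : VLeg G.kind, ρV ℓ (x ℓ.1) (β ℓ)) *
          ∏ ℓ : OLeg G.kind, ρO ℓ (x ℓ.1) (ο ℓ)) := by
    intro α β ο
    unfold vertexFactor
    rw [Finset.abs_prod]
    refine (Finset.prod_le_prod (fun i _ => abs_nonneg _) fun i _ =>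
      hV i (fun j => α ⟨i, j⟩) (fun j => β ⟨i, j⟩) (fun j => ο ⟨i, j⟩)).trans (le_of_eq ?_)
    rw [Fintype.prod_sum (fun i x => u i x * ((∏ j, ρS ⟨i, j⟩ x (α ⟨i, j⟩)) * (∏ j, ρV ⟨i, j⟩ x (β ⟨i, j⟩)) *
      ∏ j, ρO ⟨i, j⟩ x (ο ⟨i, j⟩)))]
    refine Finset.sum_congr rfl fun x _ => ?_
    rw [Finset.prod_mul_distrib, Finset.prod_mul_distrib, Finset.prod_mul_distrib,
      prod_sigma_univ (fun ℓ : SLeg G.kind => ρS ℓ (x ℓ.1) (α ℓ)),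
      prod_sigma_univ (fun ℓ : VLeg G.kind => ρV ℓ (x ℓ.1) (β ℓ)),
      prod_sigma_univ (fun ℓ : OLeg G.kind => ρO ℓ (x ℓ.1) (ο ℓ))]
  /- one summand of `amp` after "taking absolute values of all factors" -/
  have hterm : ∀ (α : SLeg G.kind → IS) (β : VLeg G.kind → IV) (ο : OLeg G.kind → IO),
      |vertexFactor V bS bV bO α β ο * (Φ (fun ℓ => α ℓ.1) * A (fun ℓ => β ℓ.1) * Ψ (fun ℓ => ο ℓ.1)) *
          (sLineFactor Ks α * vLineFactor Kv β * oLineFactor Po Ko ο)| ≤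
        ∑ x : Fin G.nV → X, (∏ i, u i (x i)) *
          (((∏ ℓ : SLeg G.kind, ρS ℓ (x ℓ.1) (α ℓ)) * |Φ (fun e => α e.1)| *
              ∏ l : SLine G, |Ks l (α l.1) (α ((sPairing G).mate l.1))|) *
            ((∏ ℓ : VLeg G.kind, ρV ℓ (x ℓ.1) (β ℓ)) * |A (fun e => β e.1)| *
              ∏ l : VLine G, |Kv l (β l.1) (β ((vPairing G).mate l.1))|) *
            ((∏ ℓ : OLeg G.kind, ρO ℓ (x ℓ.1) (ο ℓ)) * |Ψ (fun e => ο e.1)| *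
              ∏ l : Po.Line oRank, |Ko l (ο l.1) (ο (Po.mate l.1))|)) := by
    intro α β ο
    have h0 : 0 ≤ |Φ (fun ℓ => α ℓ.1)| * |A (fun ℓ => β ℓ.1)| * |Ψ (fun ℓ => ο ℓ.1)| := by positivity
    have h1 : 0 ≤ |sLineFactor Ks α| * |vLineFactor Kv β| * |oLineFactor Po Ko ο| := by positivity
    rw [abs_mul, abs_mul, abs_mul (Φ _ * A _), abs_mul (Φ _), abs_mul (sLineFactor Ks α * _), abs_mul (sLineFactor Ks α)]
    refine (mul_le_mul_of_nonneg_right (mul_le_mul_of_nonneg_right (hvf α β ο) h0) h1).trans (le_of_eq ?_)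
    rw [Finset.sum_mul, Finset.sum_mul]
    refine Finset.sum_congr rfl fun x _ => ?_
    simp only [sLineFactor, vLineFactor, oLineFactor, Finset.abs_prod]
    ring
  /- summing: |amp| ≤ Σ_x Π ū · (Σ_α S-part)(Σ_β V-part)(Σ_ο O-part) -/
  have hsum : |amp V bS bV bO Po Ks Kv Ko Φ A Ψ| ≤
      ∑ α : SLeg G.kind → IS, ∑ β : VLeg G.kind → IV, ∑ ο : OLeg G.kind → IO, ∑ x : Fin G.nV → X, (∏ i, u i (x i)) *
          (((∏ ℓ : SLeg G.kind, ρS ℓ (x ℓ.1) (α ℓ)) * |Φ (fun e => α e.1)| *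
              ∏ l : SLine G, |Ks l (α l.1) (α ((sPairing G).mate l.1))|) *
            ((∏ ℓ : VLeg G.kind, ρV ℓ (x ℓ.1) (β ℓ)) * |A (fun e => β e.1)| *
              ∏ l : VLine G, |Kv l (β l.1) (β ((vPairing G).mate l.1))|) *
            ((∏ ℓ : OLeg G.kind, ρO ℓ (x ℓ.1) (ο ℓ)) * |Ψ (fun e => ο e.1)| *
              ∏ l : Po.Line oRank, |Ko l (ο l.1) (ο (Po.mate l.1))|)) := by
    unfold amp
    refine (Finset.abs_sum_le_sum_abs _ _).trans (Finset.sum_le_sum fun α _ => ?_)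
    refine (Finset.abs_sum_le_sum_abs _ _).trans (Finset.sum_le_sum fun β _ => ?_)
    refine (Finset.abs_sum_le_sum_abs _ _).trans (Finset.sum_le_sum fun ο _ => ?_)
    exact hterm α β ο
  rw [sum3_sum_comm] at hsum
  refine hsum.trans (Finset.sum_le_sum fun x _ => ?_)
  rw [sum3_const_mul, sum3_mul]
  refine mul_le_mul_of_nonneg_left ?_ (Finset.prod_nonneg fun i _ => hu i (x i))
  /- the three species factors, line by line and external leg by external leg -/
  have hS : ∑ α : SLeg G.kind → IS, (∏ ℓ : SLeg G.kind, ρS ℓ (x ℓ.1) (α ℓ)) * |Φ (fun e => α e.1)| *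
        ∏ l : SLine G, |Ks l (α l.1) (α ((sPairing G).mate l.1))| ≤
      (∏ e : ExtSLeg G, nS e (x e.1.1)) * ∏ l : SLine G, KS l (x l.1.1) (x ((sPairing G).mate l.1).1) := by
    rw [sum_assign_factor (sPairing G) sRank sRank_injective (fun γ => |Φ γ|) (fun ℓ p => ρS ℓ (x ℓ.1) p)
      (fun l p p' => |Ks l p p'|)]
    have hb : 0 ≤ ∏ e : ExtSLeg G, nS e (x e.1.1) :=
      (Finset.sum_nonneg fun γ _ => mul_nonneg (Finset.prod_nonneg fun e _ => hρS _ _ _) (abs_nonneg _)).trans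
        (hΦ fun e => x e.1.1)
    refine mul_le_mul (hΦ fun e => x e.1.1) (Finset.prod_le_prod (fun l _ => ?_) fun l _ => hKs l _ _) ?_ hb
    · exact Finset.sum_nonneg fun p _ => Finset.sum_nonneg fun p' _ =>
        mul_nonneg (mul_nonneg (hρS _ _ _) (hρS _ _ _)) (abs_nonneg _)
    · exact Finset.prod_nonneg fun l _ => Finset.sum_nonneg fun p _ => Finset.sum_nonneg fun p' _ =>
        mul_nonneg (mul_nonneg (hρS _ _ _) (hρS _ _ _)) (abs_nonneg _)
  have hVv : ∑ β : VLeg G.kind → IV, (∏ ℓ : VLeg G.kind, ρV ℓ (x ℓ.1) (β ℓ)) * |A (fun e => β e.1)| *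
        ∏ l : VLine G, |Kv l (β l.1) (β ((vPairing G).mate l.1))| ≤
      (∏ e : ExtVLeg G, nV e (x e.1.1)) * ∏ l : VLine G, KV l (x l.1.1) (x ((vPairing G).mate l.1).1) := by
    rw [sum_assign_factor (vPairing G) vRank vRank_injective (fun ζ => |A ζ|) (fun ℓ b => ρV ℓ (x ℓ.1) b)
      (fun l b b' => |Kv l b b'|)]
    have hb : 0 ≤ ∏ e : ExtVLeg G, nV e (x e.1.1) :=
      (Finset.sum_nonneg fun ζ _ => mul_nonneg (Finset.prod_nonneg fun e _ => hρV _ _ _) (abs_nonneg _)).trans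
        (hA fun e => x e.1.1)
    refine mul_le_mul (hA fun e => x e.1.1) (Finset.prod_le_prod (fun l _ => ?_) fun l _ => hKv l _ _) ?_ hb
    · exact Finset.sum_nonneg fun b _ => Finset.sum_nonneg fun b' _ =>
        mul_nonneg (mul_nonneg (hρV _ _ _) (hρV _ _ _)) (abs_nonneg _)
    · exact Finset.prod_nonneg fun l _ => Finset.sum_nonneg fun b _ => Finset.sum_nonneg fun b' _ =>
        mul_nonneg (mul_nonneg (hρV _ _ _) (hρV _ _ _)) (abs_nonneg _)
  have hO : ∑ ο : OLeg G.kind → IO, (∏ ℓ : OLeg G.kind, ρO ℓ (x ℓ.1) (ο ℓ)) * |Ψ (fun e => ο e.1)| *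
        ∏ l : Po.Line oRank, |Ko l (ο l.1) (ο (Po.mate l.1))| ≤
      (∏ e : Po.Ext, nO e (x e.1.1)) * ∏ l : Po.Line oRank, KO l (x l.1.1) (x (Po.mate l.1).1) := by
    rw [sum_assign_factor Po oRank oRank_injective (fun ο => |Ψ ο|) (fun ℓ r => ρO ℓ (x ℓ.1) r)
      (fun l r r' => |Ko l r r'|)]
    have hb : 0 ≤ ∏ e : Po.Ext, nO e (x e.1.1) :=
      (Finset.sum_nonneg fun ο _ => mul_nonneg (Finset.prod_nonneg fun e _ => hρO _ _ _) (abs_nonneg _)).trans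
        (hΨ fun e => x e.1.1)
    refine mul_le_mul (hΨ fun e => x e.1.1) (Finset.prod_le_prod (fun l _ => ?_) fun l _ => hKo l _ _) ?_ hb
    · exact Finset.sum_nonneg fun r _ => Finset.sum_nonneg fun r' _ =>
        mul_nonneg (mul_nonneg (hρO _ _ _) (hρO _ _ _)) (abs_nonneg _)
    · exact Finset.prod_nonneg fun l _ => Finset.sum_nonneg fun r _ => Finset.sum_nonneg fun r' _ =>
        mul_nonneg (mul_nonneg (hρO _ _ _) (hρO _ _ _)) (abs_nonneg _)
  have hS0 : 0 ≤ ∑ α : SLeg G.kind → IS, (∏ ℓ : SLeg G.kind, ρS ℓ (x ℓ.1) (α ℓ)) * |Φ (fun e => α e.1)| *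
      ∏ l : SLine G, |Ks l (α l.1) (α ((sPairing G).mate l.1))| :=
    Finset.sum_nonneg fun α _ => mul_nonneg (mul_nonneg (Finset.prod_nonneg fun ℓ _ => hρS _ _ _) (abs_nonneg _))
      (Finset.prod_nonneg fun l _ => abs_nonneg _)
  have hV0 : 0 ≤ ∑ β : VLeg G.kind → IV, (∏ ℓ : VLeg G.kind, ρV ℓ (x ℓ.1) (β ℓ)) * |A (fun e => β e.1)| *
      ∏ l : VLine G, |Kv l (β l.1) (β ((vPairing G).mate l.1))| :=
    Finset.sum_nonneg fun β _ => mul_nonneg (mul_nonneg (Finset.prod_nonneg fun ℓ _ => hρV _ _ _) (abs_nonneg _))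
      (Finset.prod_nonneg fun l _ => abs_nonneg _)
  have hO0 : 0 ≤ ∑ ο : OLeg G.kind → IO, (∏ ℓ : OLeg G.kind, ρO ℓ (x ℓ.1) (ο ℓ)) * |Ψ (fun e => ο e.1)| *
      ∏ l : Po.Line oRank, |Ko l (ο l.1) (ο (Po.mate l.1))| :=
    Finset.sum_nonneg fun ο _ => mul_nonneg (mul_nonneg (Finset.prod_nonneg fun ℓ _ => hρO _ _ _) (abs_nonneg _))
      (Finset.prod_nonneg fun l _ => abs_nonneg _)
  exact mul_le_mul (mul_le_mul hS hVv hV0 (hS0.trans hS)) hO hO0 (mul_nonneg (hS0.trans hS) (hV0.trans hVv))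

end PositionForm

/-! ## §3 The printed vertices on the coordinate bases: attachment at the vertex's site (Kronecker deltas, `η⁻¹`, `|q| ≦ 1`) -/

section Concrete

variable {P : HiggsLattice.Params} {N k : ℕ}

open Literature.MathematicalPhysics.QuantumFieldTheory.Balaban1983to89.HiggsLattice (ChargeData covDeriv)
open Literature.MathematicalPhysics.QuantumFieldTheory.Balaban1983to89.B3Prop1 (VertexKind)

/-- ATTACHMENT WEIGHT of a φ′-leg AT the site `x`: the Kronecker delta `[site of the leg's index = x]` (a polarized vertex on
basis fields reads every undifferentiated φ′-leg at its own point, p. 413 (1.6)–(1.11)). [cite: Balaban1983Higgs3, (1.6) p.413] -/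
def attS (x : HiggsLattice.Site P 0) (p : HiggsLattice.Site P 0 × Fin N) : ℝ := if p.1 = x then 1 else 0

/-- ATTACHMENT WEIGHT of a DIFFERENTIATED φ′-leg at the site `x`: the difference quotient `(D^η_B̃ ·)(b)`, `b₋ = x`, reads the leg
at `x` and at the forward neighbour `b₊ = x + ηe_μ` — `[p = x] + Σ_μ [p = x + ηe_μ]`. [cite: Balaban1983Higgs3, (1.8) p.413]
[cite: Balaban1982Higgs1, (1.7) p.605] -/
def attD (x : HiggsLattice.Site P 0) (p : HiggsLattice.Site P 0 × Fin N) : ℝ :=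
  (if p.1 = x then 1 else 0) + ∑ μ : Fin P.d, if p.1 = x.shift μ then 1 else 0

/-- ATTACHMENT WEIGHT of an A′-leg at the site `x`: the leg's bond starts at `x` (`(g_kA′)_b`, `b₋ = x`).
[cite: Balaban1983Higgs3, (1.8) p.413] -/
def attB (x : HiggsLattice.Site P 0) (b : HiggsLattice.PBond P 0) : ℝ := if b.src = x then 1 else 0

/-- `attS ≥ 0`. [cite: Balaban1983Higgs3, (1.6) p.413] -/
theorem attS_nonneg (x : HiggsLattice.Site P 0) (p : HiggsLattice.Site P 0 × Fin N) : 0 ≤ attS x p := by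
  unfold attS; split_ifs <;> norm_num

/-- `attD ≥ 0`. [cite: Balaban1983Higgs3, (1.8) p.413] -/
theorem attD_nonneg (x : HiggsLattice.Site P 0) (p : HiggsLattice.Site P 0 × Fin N) : 0 ≤ attD x p := by
  unfold attD
  refine add_nonneg (by split_ifs <;> norm_num) (Finset.sum_nonneg fun μ _ => ?_)
  split_ifs <;> norm_num

/-- `attB ≥ 0`. [cite: Balaban1983Higgs3, (1.8) p.413] -/
theorem attB_nonneg (x : HiggsLattice.Site P 0) (b : HiggsLattice.PBond P 0) : 0 ≤ attB x b := by
  unfold attB; split_ifs <;> norm_num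

/-- The scalar product of two basis fields at a site is dominated by the attachment of both indices at that site
(`|(δ_p·δ_q)(x)| = [x = p][x = q][a = b] ≤ [p at x][q at x]`). [cite: Balaban1983Higgs3, (1.6) p.413] -/
theorem abs_inner_basisE_le (p q : HiggsLattice.Site P 0 × Fin N) (x : HiggsLattice.Site P 0) :
    |inner ℝ (basisE p x) (basisE q x)| ≤ attS x p * attS x q := by
  rw [inner_basisE]
  unfold attS
  by_cases h1 : p.1 = x
  · by_cases h2 : q.1 = x
    · by_cases h3 : p.2 = q.2
      · simp [h1, h2, h3]
      · simp [h1, h2, h3]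
    · have h2' : ¬x = q.1 := fun h => h2 h.symm
      simp [h2, h2']
  · have h1' : ¬x = p.1 := fun h => h1 h.symm
    simp [h1, h1']

/-- kernel: a sum over a finite set of sites as a sum over all sites against the indicator. [folklore] -/
private theorem sum_mem_eq_sum_ite {Y : Type*} [Fintype Y] [DecidableEq Y] (s : Finset Y) (f : Y → ℝ) :
    ∑ x ∈ s, f x = ∑ x, f x * (if x ∈ s then 1 else 0) := by
  simp only [mul_ite, mul_one, mul_zero]
  rw [Finset.sum_ite_mem, Finset.univ_inter]

/-- The VERTEX FUNCTION of (1.6) in position form: `|λ(L^kε)| η^d |w(x)| [x ∈ Ω₁]`. [cite: Balaban1983Higgs3, (1.6) p.413] -/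
def u16 (lamRun : ℝ) (Ω₁ : Finset (HiggsLattice.Site P 0)) (w : HiggsLattice.Site P 0 → ℝ) (x : HiggsLattice.Site P 0) : ℝ :=
  |lamRun| * (P.mesh 0 ^ P.d * |w x|) * (if x ∈ Ω₁ then 1 else 0)

/-- `u16 ≥ 0`. [cite: Balaban1983Higgs3, (1.6) p.413] -/
theorem u16_nonneg (lamRun : ℝ) (Ω₁ : Finset (HiggsLattice.Site P 0)) (w : HiggsLattice.Site P 0 → ℝ) (x : HiggsLattice.Site P 0) :
    0 ≤ u16 lamRun Ω₁ w x := by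
  unfold u16
  have := P.mesh_pos 0
  split_ifs <;> positivity

/-- **ATTACHMENT LEMMA for (1.6)**: on basis fields the polarized φ⁴-vertex is dominated by the position sum of its vertex function
times the attachment of its four φ′-legs at the position: `|V_(1.6)(δ_{p₀}, …, δ_{p₃})| ≤ Σ_x |λ|η^d|w(x)|[x ∈ Ω₁] Π_j [p_j at x]`.
[cite: Balaban1983Higgs3, (1.6) p.413] [cite: Balaban1983Higgs3, (2.13) p.426] -/
theorem abs_rule16_basisE_le (lamRun : ℝ) (Ω₁ : Finset (HiggsLattice.Site P 0)) (w : HiggsLattice.Site P 0 → ℝ)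
    (aS : Fin 4 → HiggsLattice.Site P 0 × Fin N) :
    |rule16 lamRun Ω₁ w (fun j => basisE (aS j))| ≤ ∑ x, u16 lamRun Ω₁ w x * ∏ j : Fin 4, attS x (aS j) := by
  unfold rule16
  rw [abs_neg, abs_mul]
  have hη : 0 < P.mesh 0 ^ P.d := pow_pos (P.mesh_pos 0) _
  have hterm : ∀ x, |w x * (P.mesh 0 ^ P.d *
      (inner ℝ (basisE (aS 0) x) (basisE (aS 1) x) * inner ℝ (basisE (aS 2) x) (basisE (aS 3) x)))| ≤
        (P.mesh 0 ^ P.d * |w x|) * ∏ j : Fin 4, attS x (aS j) := by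
    intro x
    rw [abs_mul, abs_mul, abs_mul, abs_of_pos hη, Fin.prod_univ_four]
    have h01 := abs_inner_basisE_le (aS 0) (aS 1) x
    have h23 := abs_inner_basisE_le (aS 2) (aS 3) x
    have h0 := attS_nonneg x (aS 0)
    have h1 := attS_nonneg x (aS 1)
    calc |w x| * (P.mesh 0 ^ P.d * (|inner ℝ (basisE (aS 0) x) (basisE (aS 1) x)| *
          |inner ℝ (basisE (aS 2) x) (basisE (aS 3) x)|))
        ≤ |w x| * (P.mesh 0 ^ P.d * ((attS x (aS 0) * attS x (aS 1)) * (attS x (aS 2) * attS x (aS 3)))) :=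
          mul_le_mul_of_nonneg_left (mul_le_mul_of_nonneg_left
            (mul_le_mul h01 h23 (abs_nonneg _) (mul_nonneg h0 h1)) hη.le) (abs_nonneg _)
      _ = _ := by ring
  calc |lamRun| * |∑ x ∈ Ω₁, w x * (P.mesh 0 ^ P.d *
        (inner ℝ (basisE (aS 0) x) (basisE (aS 1) x) * inner ℝ (basisE (aS 2) x) (basisE (aS 3) x)))|
      ≤ |lamRun| * ∑ x ∈ Ω₁, (P.mesh 0 ^ P.d * |w x|) * ∏ j : Fin 4, attS x (aS j) :=
        mul_le_mul_of_nonneg_left ((Finset.abs_sum_le_sum_abs _ _).trans (Finset.sum_le_sum fun x _ => hterm x))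
          (abs_nonneg _)
    _ = ∑ x, u16 lamRun Ω₁ w x * ∏ j : Fin 4, attS x (aS j) := by
        rw [sum_mem_eq_sum_ite, Finset.mul_sum]
        refine Finset.sum_congr rfl fun x _ => ?_
        unfold u16
        ring

/-- The VERTEX FUNCTION of (1.7) in position form: `½ η^d |δm_i²(x)| (L^kε)² |w(x)| [x ∈ Ω₁]`. [cite: Balaban1983Higgs3, (1.7) p.413] -/
def u17 (dm2 : HiggsLattice.Site P 0 → ℝ) (ell : ℝ) (Ω₁ : Finset (HiggsLattice.Site P 0)) (w : HiggsLattice.Site P 0 → ℝ)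
    (x : HiggsLattice.Site P 0) : ℝ :=
  (1 / 2 : ℝ) * (P.mesh 0 ^ P.d * |dm2 x| * ell ^ 2 * |w x|) * (if x ∈ Ω₁ then 1 else 0)

/-- `u17 ≥ 0`. [cite: Balaban1983Higgs3, (1.7) p.413] -/
theorem u17_nonneg (dm2 : HiggsLattice.Site P 0 → ℝ) (ell : ℝ) (Ω₁ : Finset (HiggsLattice.Site P 0)) (w : HiggsLattice.Site P 0 → ℝ)
    (x : HiggsLattice.Site P 0) : 0 ≤ u17 dm2 ell Ω₁ w x := by
  unfold u17
  have := P.mesh_pos 0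
  split_ifs <;> positivity

/-- **ATTACHMENT LEMMA for (1.7)**: `|V_(1.7)(δ_{p₀}, δ_{p₁})| ≤ Σ_x ½η^d|δm_i²(x)|(L^kε)²|w(x)|[x ∈ Ω₁] [p₀ at x][p₁ at x]`.
[cite: Balaban1983Higgs3, (1.7) p.413] [cite: Balaban1983Higgs3, (2.13) p.426] -/
theorem abs_rule17_basisE_le (dm2 : HiggsLattice.Site P 0 → ℝ) (ell : ℝ) (Ω₁ : Finset (HiggsLattice.Site P 0))
    (w : HiggsLattice.Site P 0 → ℝ) (aS : Fin 2 → HiggsLattice.Site P 0 × Fin N) :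
    |rule17 dm2 ell Ω₁ w (fun j => basisE (aS j))| ≤ ∑ x, u17 dm2 ell Ω₁ w x * ∏ j : Fin 2, attS x (aS j) := by
  unfold rule17
  rw [abs_mul, show |(-(1 / 2 : ℝ))| = 1 / 2 by norm_num]
  have hη : 0 < P.mesh 0 ^ P.d := pow_pos (P.mesh_pos 0) _
  have hterm : ∀ x, |w x * (P.mesh 0 ^ P.d * dm2 x * ell ^ 2 * inner ℝ (basisE (aS 0) x) (basisE (aS 1) x))| ≤
      (P.mesh 0 ^ P.d * |dm2 x| * ell ^ 2 * |w x|) * ∏ j : Fin 2, attS x (aS j) := by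
    intro x
    rw [abs_mul, abs_mul, abs_mul, abs_mul, abs_of_pos hη, abs_of_nonneg (sq_nonneg ell), Fin.prod_univ_two]
    have h01 := abs_inner_basisE_le (aS 0) (aS 1) x
    have hc : 0 ≤ |w x| * (P.mesh 0 ^ P.d * |dm2 x| * ell ^ 2) := by positivity
    calc |w x| * (P.mesh 0 ^ P.d * |dm2 x| * ell ^ 2 * |inner ℝ (basisE (aS 0) x) (basisE (aS 1) x)|)
        = |w x| * (P.mesh 0 ^ P.d * |dm2 x| * ell ^ 2) * |inner ℝ (basisE (aS 0) x) (basisE (aS 1) x)| := by ring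
      _ ≤ |w x| * (P.mesh 0 ^ P.d * |dm2 x| * ell ^ 2) * (attS x (aS 0) * attS x (aS 1)) :=
          mul_le_mul_of_nonneg_left h01 hc
      _ = _ := by ring
  calc 1 / 2 * |∑ x ∈ Ω₁, w x * (P.mesh 0 ^ P.d * dm2 x * ell ^ 2 * inner ℝ (basisE (aS 0) x) (basisE (aS 1) x))|
      ≤ 1 / 2 * ∑ x ∈ Ω₁, (P.mesh 0 ^ P.d * |dm2 x| * ell ^ 2 * |w x|) * ∏ j : Fin 2, attS x (aS j) :=
        mul_le_mul_of_nonneg_left ((Finset.abs_sum_le_sum_abs _ _).trans (Finset.sum_le_sum fun x _ => hterm x))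
          (by norm_num)
    _ = ∑ x, u17 dm2 ell Ω₁ w x * ∏ j : Fin 2, attS x (aS j) := by
        rw [sum_mem_eq_sum_ite, Finset.mul_sum]
        refine Finset.sum_congr rfl fun x _ => ?_
        unfold u17
        ring

/-- kernel: a sum over the bonds as a sum over their initial points and directions. [folklore] -/
private theorem sum_bond (f : HiggsLattice.PBond P 0 → ℝ) :
    ∑ b, f b = ∑ x : HiggsLattice.Site P 0, ∑ μ : Fin P.d, f ⟨x, μ⟩ := by
  rw [← Fintype.sum_prod_type' (f := fun x μ => f ⟨x, μ⟩)]
  exact (Fintype.sum_equiv ⟨fun p => ⟨p.1, p.2⟩, fun b => (b.src, b.dir), fun _ => rfl, fun _ => rfl⟩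
    (fun p => f ⟨p.1, p.2⟩) f fun _ => rfl).symm

/-- The undifferentiated φ′-leg of a bond vertex on a basis field: `‖δ_p(b₋)‖ = [p at b₋]`. [cite: Balaban1983Higgs3, (1.8) p.413] -/
theorem norm_basisE_src_eq_attS (p : HiggsLattice.Site P 0 × Fin N) (b : HiggsLattice.PBond P 0) :
    ‖basisE p b.src‖ = attS b.src p := by
  rw [norm_basisE_apply]
  unfold attS
  by_cases h : b.src = p.1
  · rw [if_pos h, if_pos h.symm]
  · rw [if_neg h, if_neg fun h' => h h'.symm]

/-- **The differentiated φ′-leg of (1.8) on a basis field costs `η⁻¹` and attaches the leg to `b₋` OR to `b₊`**: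
`‖(D^η_B̃ δ_p)(b)‖ ≤ η⁻¹ · attD(b₋, p)` (FILE 9's `norm_covDeriv_basisE_le`: `|U(B̃_b)| = 1`). [cite: Balaban1983Higgs3, (2.10) p.426]
[cite: Balaban1982Higgs1, (1.7) p.605] -/
theorem norm_covDeriv_basisE_le_attD (C : ChargeData N) (B : HiggsLattice.VecField P 0) (p : HiggsLattice.Site P 0 × Fin N)
    (b : HiggsLattice.PBond P 0) : ‖covDeriv C B (basisE p) b‖ ≤ (P.mesh 0)⁻¹ * attD b.src p := by
  refine (norm_covDeriv_basisE_le C B p b).trans (mul_le_mul_of_nonneg_left ?_ (inv_nonneg.2 (P.mesh_pos 0).le))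
  unfold attD
  rw [add_comm]
  refine add_le_add ?_ ?_
  · by_cases h : b.src = p.1
    · rw [if_pos h, if_pos h.symm]
    · rw [if_neg h, if_neg fun h' => h h'.symm]
  · by_cases h : b.tgt = p.1
    · rw [if_pos h]
      have h' : p.1 = b.src.shift b.dir := h.symm
      refine (le_of_eq (if_pos h').symm).trans (Finset.single_le_sum (f := fun μ : Fin P.d =>
        if p.1 = b.src.shift μ then (1 : ℝ) else 0) (fun μ _ => ?_) (Finset.mem_univ b.dir))
      split_ifs <;> norm_num
    · rw [if_neg h]
      exact Finset.sum_nonneg fun μ _ => by split_ifs <;> norm_num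

variable [DecidableEq (HiggsLattice.PBond P 0)]

/-- An A′-leg on a basis bond field: `|δ_{b′}(b)| ≤ [b′ starts at b₋]`. [cite: Balaban1983Higgs3, (1.8) p.413] -/
theorem abs_basisV_le_attB (b' b : HiggsLattice.PBond P 0) :
    |basisV b' b| ≤ attB b.src b' := by
  unfold basisV attB
  by_cases h : b = b'
  · subst h
    rw [if_pos rfl, if_pos rfl, abs_one]
  · rw [if_neg h, abs_zero]
    split_ifs <;> norm_num

/-- The polarized A′-legs `Π_j (g_k a_j)_b` on basis bond fields: `≤ |g_k(b₋)|^n Π_j [a_j's bond starts at b₋]`.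
[cite: Balaban1983Higgs3, (1.8) p.413] -/
theorem prod_vlegs_basisV_le (g : HiggsLattice.Site P 0 → ℝ) {n : ℕ}
    (aV : Fin n → HiggsLattice.PBond P 0) (b : HiggsLattice.PBond P 0) :
    ∏ j : Fin n, |g b.src| * |basisV (aV j) b| ≤ |g b.src| ^ n * ∏ j : Fin n, attB b.src (aV j) := by
  calc ∏ j : Fin n, |g b.src| * |basisV (aV j) b| ≤ ∏ j : Fin n, |g b.src| * attB b.src (aV j) :=
        Finset.prod_le_prod (fun j _ => by positivity) fun j _ =>
          mul_le_mul_of_nonneg_left (abs_basisV_le_attB (aV j) b) (abs_nonneg _)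
    _ = |g b.src| ^ n * ∏ j : Fin n, attB b.src (aV j) := by
        rw [Finset.prod_mul_distrib, Fin.prod_const]

/-- The bond data of a bond vertex collected at the initial point: `Σ_μ [⟨x,μ⟩ ∈ S] |w(⟨x,μ⟩)| |Ã(⟨x,μ⟩)|^{n′}` (the localization
weight and the external vector field `Ã` of the `d` bonds starting at `x`). [cite: Balaban1983Higgs3, (1.8) p.413] -/
def bondData (At : HiggsLattice.VecField P 0) (n' : ℕ) (S : Finset (HiggsLattice.PBond P 0)) (w : HiggsLattice.PBond P 0 → ℝ)
    (x : HiggsLattice.Site P 0) : ℝ :=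
  ∑ μ : Fin P.d, (if (⟨x, μ⟩ : HiggsLattice.PBond P 0) ∈ S then (1 : ℝ) else 0) * (|w ⟨x, μ⟩| * |At ⟨x, μ⟩| ^ n')

/-- `bondData ≥ 0`. [cite: Balaban1983Higgs3, (1.8) p.413] -/
theorem bondData_nonneg (At : HiggsLattice.VecField P 0) (n' : ℕ) (S : Finset (HiggsLattice.PBond P 0))
    (w : HiggsLattice.PBond P 0 → ℝ) (x : HiggsLattice.Site P 0) : 0 ≤ bondData At n' S w x :=
  Finset.sum_nonneg fun μ _ => mul_nonneg (by split_ifs <;> norm_num) (by positivity)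

/-- The VERTEX FUNCTION of (1.8)_{n,n′} in position form at the site `x = b₋`:
`|e|^{n+n′} η^{n+n′−1}/(n!n′!) · η^d η⁻¹ |g_k(x)|^n · Σ_μ [⟨x,μ⟩ ∈ S] |w(⟨x,μ⟩)| |Ã(⟨x,μ⟩)|^{n′}` — `|q| ≦ 1` used `n+n′` times, one
`η⁻¹` for the difference quotient. [cite: Balaban1983Higgs3, (1.8) p.413] [cite: Balaban1983Higgs3, (2.13) p.426] -/
def u18 (C : ChargeData N) (g : HiggsLattice.Site P 0 → ℝ) (At : HiggsLattice.VecField P 0) (n n' : ℕ)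
    (S : Finset (HiggsLattice.PBond P 0)) (w : HiggsLattice.PBond P 0 → ℝ) (x : HiggsLattice.Site P 0) : ℝ :=
  |C.e| ^ (n + n') * (P.mesh 0 ^ ((n + n' : ℤ) - 1) / ((n.factorial : ℝ) * n'.factorial)) *
    ((P.mesh 0 ^ P.d * (P.mesh 0)⁻¹ * |g x| ^ n) * bondData At n' S w x)

/-- `u18 ≥ 0`. [cite: Balaban1983Higgs3, (1.8) p.413] -/
theorem u18_nonneg (C : ChargeData N) (g : HiggsLattice.Site P 0 → ℝ) (At : HiggsLattice.VecField P 0) (n n' : ℕ)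
    (S : Finset (HiggsLattice.PBond P 0)) (w : HiggsLattice.PBond P 0 → ℝ) (x : HiggsLattice.Site P 0) :
    0 ≤ u18 C g At n n' S w x := by
  unfold u18
  have := P.mesh_pos 0
  have := bondData_nonneg At n' S w x
  have : 0 ≤ P.mesh 0 ^ ((n + n' : ℤ) - 1) := zpow_nonneg (P.mesh_pos 0).le _
  positivity

/-- **ATTACHMENT LEMMA for (1.8)_{n,n′}**: on basis fields the polarized vertex is dominated by the position sum over the initial
points `x` of its bond of the vertex function `u18` times the attachments — the differentiated φ′-leg at `x` or a forward neighbour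
(`attD`), the other φ′-leg at `x` (`attS`), every A′-leg on a bond starting at `x` (`attB`).
[cite: Balaban1983Higgs3, (1.8) p.413] [cite: Balaban1983Higgs3, (2.13) p.426] -/
theorem abs_rule18_basis_le (C : ChargeData N) (g : HiggsLattice.Site P 0 → ℝ)
    (B At : HiggsLattice.VecField P 0) (n n' : ℕ) (S : Finset (HiggsLattice.PBond P 0)) (w : HiggsLattice.PBond P 0 → ℝ)
    (aS : Fin 2 → HiggsLattice.Site P 0 × Fin N) (aV : Fin n → HiggsLattice.PBond P 0) :
    |rule18 C g B At n n' S w (fun j => basisE (aS j)) (fun j => basisV (aV j))| ≤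
      ∑ x, u18 C g At n n' S w x * ((attD x (aS 0) * attS x (aS 1)) * ∏ j : Fin n, attB x (aV j)) := by
  refine (abs_rule18_le C g B At n n' S w (fun j => basisE (aS j)) (fun j => basisV (aV j))).trans ?_
  have hη : 0 < P.mesh 0 := P.mesh_pos 0
  have hcoef : 0 ≤ |C.e| ^ (n + n') * (P.mesh 0 ^ ((n + n' : ℤ) - 1) / ((n.factorial : ℝ) * n'.factorial)) :=
    mul_nonneg (pow_nonneg (abs_nonneg _) _) (div_nonneg (zpow_nonneg hη.le _) (by positivity))
  have hbond : ∀ b : HiggsLattice.PBond P 0,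
      |w b| * (P.mesh 0 ^ P.d * (‖covDeriv C B (basisE (aS 0)) b‖ * ‖basisE (aS 1) b.src‖) *
          (∏ j : Fin n, |g b.src| * |basisV (aV j) b|) * |At b| ^ n') ≤
        (|w b| * |At b| ^ n') * (P.mesh 0 ^ P.d * (P.mesh 0)⁻¹ * |g b.src| ^ n) *
          ((attD b.src (aS 0) * attS b.src (aS 1)) * ∏ j : Fin n, attB b.src (aV j)) := by
    intro b
    have h1 : ‖covDeriv C B (basisE (aS 0)) b‖ * ‖basisE (aS 1) b.src‖ ≤
        ((P.mesh 0)⁻¹ * attD b.src (aS 0)) * attS b.src (aS 1) := by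
      rw [norm_basisE_src_eq_attS]
      exact mul_le_mul_of_nonneg_right (norm_covDeriv_basisE_le_attD C B (aS 0) b) (attS_nonneg _ _)
    have h2 := prod_vlegs_basisV_le g aV b
    have hY1 : 0 ≤ P.mesh 0 ^ P.d * (((P.mesh 0)⁻¹ * attD b.src (aS 0)) * attS b.src (aS 1)) :=
      mul_nonneg (pow_nonneg hη.le _) (mul_nonneg (mul_nonneg (inv_nonneg.2 hη.le) (attD_nonneg _ _)) (attS_nonneg _ _))
    have hX2 : 0 ≤ ∏ j : Fin n, |g b.src| * |basisV (aV j) b| := Finset.prod_nonneg fun j _ => by positivity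
    calc |w b| * (P.mesh 0 ^ P.d * (‖covDeriv C B (basisE (aS 0)) b‖ * ‖basisE (aS 1) b.src‖) *
          (∏ j : Fin n, |g b.src| * |basisV (aV j) b|) * |At b| ^ n')
        ≤ |w b| * (P.mesh 0 ^ P.d * (((P.mesh 0)⁻¹ * attD b.src (aS 0)) * attS b.src (aS 1)) *
          (|g b.src| ^ n * ∏ j : Fin n, attB b.src (aV j)) * |At b| ^ n') :=
          mul_le_mul_of_nonneg_left (mul_le_mul_of_nonneg_right
            (mul_le_mul (mul_le_mul_of_nonneg_left h1 (pow_nonneg hη.le _)) h2 hX2 hY1) (by positivity)) (abs_nonneg _)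
      _ = _ := by ring
  calc |C.e| ^ (n + n') * (P.mesh 0 ^ ((n + n' : ℤ) - 1) / ((n.factorial : ℝ) * n'.factorial)) *
        ∑ b ∈ S, |w b| * (P.mesh 0 ^ P.d * (‖covDeriv C B (basisE (aS 0)) b‖ * ‖basisE (aS 1) b.src‖) *
          (∏ j : Fin n, |g b.src| * |basisV (aV j) b|) * |At b| ^ n')
      ≤ |C.e| ^ (n + n') * (P.mesh 0 ^ ((n + n' : ℤ) - 1) / ((n.factorial : ℝ) * n'.factorial)) *
        ∑ b ∈ S, (|w b| * |At b| ^ n') * (P.mesh 0 ^ P.d * (P.mesh 0)⁻¹ * |g b.src| ^ n) *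
          ((attD b.src (aS 0) * attS b.src (aS 1)) * ∏ j : Fin n, attB b.src (aV j)) :=
        mul_le_mul_of_nonneg_left (Finset.sum_le_sum fun b _ => hbond b) hcoef
    _ = ∑ x, u18 C g At n n' S w x * ((attD x (aS 0) * attS x (aS 1)) * ∏ j : Fin n, attB x (aV j)) := by
        rw [sum_mem_eq_sum_ite, sum_bond, Finset.mul_sum]
        refine Finset.sum_congr rfl fun x _ => ?_
        unfold u18 bondData
        simp only [Finset.mul_sum, Finset.sum_mul]
        refine Finset.sum_congr rfl fun μ _ => ?_
        ring

/-- The VERTEX FUNCTION of (1.10)_{n,n′} in position form at `x = b₋`: `|e|^{n+n′} η^{n+n′−2}/(n!n′!) · η^d |g_k(x)|^n ·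
Σ_μ [⟨x,μ⟩ ∈ S] |w(⟨x,μ⟩)| |Ã(⟨x,μ⟩)|^{n′}`. [cite: Balaban1983Higgs3, (1.10) p.413] [cite: Balaban1983Higgs3, (2.13) p.426] -/
def u110 (C : ChargeData N) (g : HiggsLattice.Site P 0 → ℝ) (At : HiggsLattice.VecField P 0) (n n' : ℕ)
    (S : Finset (HiggsLattice.PBond P 0)) (w : HiggsLattice.PBond P 0 → ℝ) (x : HiggsLattice.Site P 0) : ℝ :=
  |C.e| ^ (n + n') * (P.mesh 0 ^ ((n + n' : ℤ) - 2) / ((n.factorial : ℝ) * n'.factorial)) *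
    ((P.mesh 0 ^ P.d * |g x| ^ n) * bondData At n' S w x)

/-- `u110 ≥ 0`. [cite: Balaban1983Higgs3, (1.10) p.413] -/
theorem u110_nonneg (C : ChargeData N) (g : HiggsLattice.Site P 0 → ℝ) (At : HiggsLattice.VecField P 0) (n n' : ℕ)
    (S : Finset (HiggsLattice.PBond P 0)) (w : HiggsLattice.PBond P 0 → ℝ) (x : HiggsLattice.Site P 0) :
    0 ≤ u110 C g At n n' S w x := by
  unfold u110
  have := P.mesh_pos 0
  have := bondData_nonneg At n' S w x
  have : 0 ≤ P.mesh 0 ^ ((n + n' : ℤ) - 2) := zpow_nonneg (P.mesh_pos 0).le _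
  positivity

/-- **ATTACHMENT LEMMA for (1.10)_{n,n′}**: both φ′-legs at `x = b₋` (`attS`), every A′-leg on a bond starting at `x` (`attB`).
[cite: Balaban1983Higgs3, (1.10) p.413] [cite: Balaban1983Higgs3, (2.13) p.426] -/
theorem abs_rule110_basis_le (C : ChargeData N) (g : HiggsLattice.Site P 0 → ℝ)
    (At : HiggsLattice.VecField P 0) (n n' : ℕ) (S : Finset (HiggsLattice.PBond P 0)) (w : HiggsLattice.PBond P 0 → ℝ)
    (aS : Fin 2 → HiggsLattice.Site P 0 × Fin N) (aV : Fin n → HiggsLattice.PBond P 0) :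
    |rule110 C g At n n' S w (fun j => basisE (aS j)) (fun j => basisV (aV j))| ≤
      ∑ x, u110 C g At n n' S w x * ((attS x (aS 0) * attS x (aS 1)) * ∏ j : Fin n, attB x (aV j)) := by
  refine (abs_rule110_le C g At n n' S w (fun j => basisE (aS j)) (fun j => basisV (aV j))).trans ?_
  have hη : 0 < P.mesh 0 := P.mesh_pos 0
  have hcoef : 0 ≤ |C.e| ^ (n + n') * (P.mesh 0 ^ ((n + n' : ℤ) - 2) / ((n.factorial : ℝ) * n'.factorial)) :=
    mul_nonneg (pow_nonneg (abs_nonneg _) _) (div_nonneg (zpow_nonneg hη.le _) (by positivity))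
  have hbond : ∀ b : HiggsLattice.PBond P 0,
      |w b| * (P.mesh 0 ^ P.d * (‖basisE (aS 0) b.src‖ * ‖basisE (aS 1) b.src‖) *
          (∏ j : Fin n, |g b.src| * |basisV (aV j) b|) * |At b| ^ n') ≤
        (|w b| * |At b| ^ n') * (P.mesh 0 ^ P.d * |g b.src| ^ n) *
          ((attS b.src (aS 0) * attS b.src (aS 1)) * ∏ j : Fin n, attB b.src (aV j)) := by
    intro b
    rw [norm_basisE_src_eq_attS, norm_basisE_src_eq_attS]
    have h2 := prod_vlegs_basisV_le g aV b
    have hY1 : 0 ≤ P.mesh 0 ^ P.d * (attS b.src (aS 0) * attS b.src (aS 1)) :=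
      mul_nonneg (pow_nonneg hη.le _) (mul_nonneg (attS_nonneg _ _) (attS_nonneg _ _))
    calc |w b| * (P.mesh 0 ^ P.d * (attS b.src (aS 0) * attS b.src (aS 1)) *
          (∏ j : Fin n, |g b.src| * |basisV (aV j) b|) * |At b| ^ n')
        ≤ |w b| * (P.mesh 0 ^ P.d * (attS b.src (aS 0) * attS b.src (aS 1)) *
          (|g b.src| ^ n * ∏ j : Fin n, attB b.src (aV j)) * |At b| ^ n') :=
          mul_le_mul_of_nonneg_left (mul_le_mul_of_nonneg_right (mul_le_mul_of_nonneg_left h2 hY1) (by positivity))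
            (abs_nonneg _)
      _ = _ := by ring
  calc |C.e| ^ (n + n') * (P.mesh 0 ^ ((n + n' : ℤ) - 2) / ((n.factorial : ℝ) * n'.factorial)) *
        ∑ b ∈ S, |w b| * (P.mesh 0 ^ P.d * (‖basisE (aS 0) b.src‖ * ‖basisE (aS 1) b.src‖) *
          (∏ j : Fin n, |g b.src| * |basisV (aV j) b|) * |At b| ^ n')
      ≤ |C.e| ^ (n + n') * (P.mesh 0 ^ ((n + n' : ℤ) - 2) / ((n.factorial : ℝ) * n'.factorial)) *
        ∑ b ∈ S, (|w b| * |At b| ^ n') * (P.mesh 0 ^ P.d * |g b.src| ^ n) *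
          ((attS b.src (aS 0) * attS b.src (aS 1)) * ∏ j : Fin n, attB b.src (aV j)) :=
        mul_le_mul_of_nonneg_left (Finset.sum_le_sum fun b _ => hbond b) hcoef
    _ = ∑ x, u110 C g At n n' S w x * ((attS x (aS 0) * attS x (aS 1)) * ∏ j : Fin n, attB x (aV j)) := by
        rw [sum_mem_eq_sum_ite, sum_bond, Finset.mul_sum]
        refine Finset.sum_congr rfl fun x _ => ?_
        unfold u110 bondData
        simp only [Finset.mul_sum, Finset.sum_mul]
        refine Finset.sum_congr rfl fun μ _ => ?_
        ring

/-! ### The R-vertices (1.9), (1.11): `|q^m R_{n̄+1}(·)| ≦ 1` (r15's `norm_qpow_mul_remOp_le_one`) -/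

omit [DecidableEq (HiggsLattice.PBond P 0)] in
/-- The polarized bracket of (1.8)/(1.9) with ANY tensor of norm `≦ 1` between the legs is bounded by the norms of its two legs.
[cite: Balaban1983Higgs3, (1.9) p.413] [cite: Balaban1983Higgs3, p.426] -/
theorem abs_pleg18_op_le {j : ℕ} (C : ChargeData N) (B : HiggsLattice.VecField P j) (f₀ f₁ : HiggsLattice.ScalarField P j N)
    (T : B3Eq18VertexExpansion.Op N) (hT : ‖T‖ ≤ 1) (b : HiggsLattice.PBond P j) :
    |pleg18 C B f₀ f₁ T b| ≤ ‖covDeriv C B f₀ b‖ * ‖f₁ b.src‖ :=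
  (abs_real_inner_le_norm _ _).trans (mul_le_mul_of_nonneg_left
    ((T.le_opNorm _).trans (mul_le_of_le_one_left (norm_nonneg _) hT)) (norm_nonneg _))

omit [DecidableEq (HiggsLattice.PBond P 0)] in
/-- The polarized bracket of (1.10)/(1.11) with any tensor of norm `≦ 1`. [cite: Balaban1983Higgs3, (1.11) p.413]
[cite: Balaban1983Higgs3, p.426] -/
theorem abs_pleg110_op_le {j : ℕ} (f₀ f₁ : HiggsLattice.ScalarField P j N) (T : B3Eq18VertexExpansion.Op N) (hT : ‖T‖ ≤ 1)
    (b : HiggsLattice.PBond P j) : |pleg110 f₀ f₁ T b| ≤ ‖f₀ b.src‖ * ‖f₁ b.src‖ :=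
  (abs_real_inner_le_norm _ _).trans (mul_le_mul_of_nonneg_left
    ((T.le_opNorm _).trans (mul_le_of_le_one_left (norm_nonneg _) hT)) (norm_nonneg _))

omit [DecidableEq (HiggsLattice.PBond P 0)] in
/-- **`|q^{m} R_{n̄+1}(−ηeÃ_b q)| ≦ 1`**: the tensor of the R-vertices (the typer's `remTensor` = r15's `taylorRemOp` at `−ηeÃ_b·q`)
composed with any power of `q` has norm `≦ 1` (p. 426: *"in vertices we apply the inequalities |q| ≦ 1, |R_{n̄+1}(·)| ≦ 1"*).
[cite: Balaban1983Higgs3, p.426] [cite: Balaban1983Higgs3, (1.9) p.413] -/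
theorem norm_qpow_mul_remTensor_le_one {j : ℕ} (C : ChargeData N) (m nbar : ℕ) (At : HiggsLattice.VecField P j)
    (b : HiggsLattice.PBond P j) : ‖C.q ^ m * B3Eq18VertexExpansion.remTensor C nbar At b‖ ≤ 1 := by
  unfold B3Eq18VertexExpansion.remTensor
  exact B3VertexTensorBounds.norm_qpow_mul_remOp_le_one C m nbar _

omit [DecidableEq (HiggsLattice.PBond P 0)] in
/-- **THE MAJORANT RULE of (1.9)** (the R-vertex of (1.8)): `|V_(1.9)(f; a)| ≤ |e|^{n+n̄+1} η^{n+n̄}/(n!(n̄+1)!) Σ_{b∈S} |w(b)| η^d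
‖(D^η_B̃f₀)(b)‖ ‖f₁(b₋)‖ Π_j |g(b₋)||a_j(b)| |Ã(b)|^{n̄+1}`. [cite: Balaban1983Higgs3, (1.9) p.413] [cite: Balaban1983Higgs3, (2.13) p.426] -/
theorem abs_rule19_le {j : ℕ} (C : ChargeData N) (g : HiggsLattice.Site P j → ℝ) (B At : HiggsLattice.VecField P j) (nbar n : ℕ)
    (S : Finset (HiggsLattice.PBond P j)) (w : HiggsLattice.PBond P j → ℝ) (f : Fin 2 → HiggsLattice.ScalarField P j N)
    (a : Fin n → HiggsLattice.VecField P j) :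
    |rule19 C g B At nbar n S w f a| ≤
      |C.e| ^ (n + nbar + 1) * (P.mesh j ^ (n + nbar) / ((n.factorial : ℝ) * (nbar + 1).factorial)) *
        ∑ b ∈ S, |w b| * (P.mesh j ^ P.d * (‖covDeriv C B (f 0) b‖ * ‖f 1 b.src‖) * (∏ i : Fin n, |g b.src| * |a i b|) *
          |At b| ^ (nbar + 1)) := by
  unfold rule19
  have hc : |C.e ^ (n + nbar + 1) *
      ((-1 : ℝ) ^ (n + nbar + 1) * P.mesh j ^ (n + nbar) / ((n.factorial : ℝ) * (nbar + 1).factorial))| =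
      |C.e| ^ (n + nbar + 1) * (P.mesh j ^ (n + nbar) / ((n.factorial : ℝ) * (nbar + 1).factorial)) := by
    rw [abs_mul, abs_pow, abs_div, abs_mul, abs_pow, abs_pow, abs_neg, abs_one, one_pow, one_mul,
      abs_of_pos (P.mesh_pos j), abs_of_pos (by positivity : (0 : ℝ) < (n.factorial : ℝ) * (nbar + 1).factorial)]
  rw [abs_mul, hc]
  refine mul_le_mul_of_nonneg_left ((Finset.abs_sum_le_sum_abs _ _).trans (Finset.sum_le_sum fun b _ => ?_))
    (mul_nonneg (pow_nonneg (abs_nonneg _) _) (div_nonneg (pow_nonneg (P.mesh_pos j).le _) (by positivity)))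
  rw [abs_mul, abs_mul, abs_mul, abs_mul, abs_pow, abs_pow, abs_vlegs, abs_of_pos (P.mesh_pos j)]
  have h1 := abs_pleg18_op_le C B (f 0) (f 1) _ (norm_qpow_mul_remTensor_le_one C (n + nbar + 1) nbar At b) b
  have h2 : 0 ≤ ∏ i : Fin n, |g b.src| * |a i b| := Finset.prod_nonneg fun i _ => mul_nonneg (abs_nonneg _) (abs_nonneg _)
  refine mul_le_mul_of_nonneg_left ?_ (abs_nonneg _)
  exact mul_le_mul_of_nonneg_right (mul_le_mul_of_nonneg_right
    (mul_le_mul_of_nonneg_left h1 (pow_pos (P.mesh_pos j) _).le) h2) (pow_nonneg (abs_nonneg _) _)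

omit [DecidableEq (HiggsLattice.PBond P 0)] in
/-- **THE MAJORANT RULE of (1.11)** (the R-vertex of (1.10)). [cite: Balaban1983Higgs3, (1.11) p.413] [cite: Balaban1983Higgs3, (2.13) p.426] -/
theorem abs_rule111_le {j : ℕ} (C : ChargeData N) (g : HiggsLattice.Site P j → ℝ) (At : HiggsLattice.VecField P j) (nbar n : ℕ)
    (S : Finset (HiggsLattice.PBond P j)) (w : HiggsLattice.PBond P j → ℝ) (f : Fin 2 → HiggsLattice.ScalarField P j N)
    (a : Fin n → HiggsLattice.VecField P j) :
    |rule111 C g At nbar n S w f a| ≤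
      |C.e| ^ (n + nbar + 1) * (P.mesh j ^ ((n + nbar : ℤ) - 1) / ((n.factorial : ℝ) * (nbar + 1).factorial)) *
        ∑ b ∈ S, |w b| * (P.mesh j ^ P.d * (‖f 0 b.src‖ * ‖f 1 b.src‖) * (∏ i : Fin n, |g b.src| * |a i b|) *
          |At b| ^ (nbar + 1)) := by
  unfold rule111
  have hc : |C.e ^ (n + nbar + 1) *
      ((-1 : ℝ) ^ (n + nbar + 1) * P.mesh j ^ ((n + nbar : ℤ) - 1) / ((n.factorial : ℝ) * (nbar + 1).factorial))| =
      |C.e| ^ (n + nbar + 1) * (P.mesh j ^ ((n + nbar : ℤ) - 1) / ((n.factorial : ℝ) * (nbar + 1).factorial)) := by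
    rw [abs_mul, abs_pow, abs_div, abs_mul, abs_pow, abs_neg, abs_one, one_pow, one_mul,
      abs_of_pos (zpow_pos (P.mesh_pos j) _), abs_of_pos (by positivity : (0 : ℝ) < (n.factorial : ℝ) * (nbar + 1).factorial)]
  rw [abs_mul, hc]
  refine mul_le_mul_of_nonneg_left ((Finset.abs_sum_le_sum_abs _ _).trans (Finset.sum_le_sum fun b _ => ?_))
    (mul_nonneg (pow_nonneg (abs_nonneg _) _) (div_nonneg (zpow_nonneg (P.mesh_pos j).le _) (by positivity)))
  rw [abs_mul, abs_mul, abs_mul, abs_mul, abs_pow, abs_pow, abs_vlegs, abs_of_pos (P.mesh_pos j)]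
  have h1 := abs_pleg110_op_le (f 0) (f 1) _ (norm_qpow_mul_remTensor_le_one C (n + nbar + 1) nbar At b) b
  have h2 : 0 ≤ ∏ i : Fin n, |g b.src| * |a i b| := Finset.prod_nonneg fun i _ => mul_nonneg (abs_nonneg _) (abs_nonneg _)
  refine mul_le_mul_of_nonneg_left ?_ (abs_nonneg _)
  exact mul_le_mul_of_nonneg_right (mul_le_mul_of_nonneg_right
    (mul_le_mul_of_nonneg_left h1 (pow_pos (P.mesh_pos j) _).le) h2) (pow_nonneg (abs_nonneg _) _)

/-- kernel: the re-summation shared by the bond vertices — a bond sum of (bond data at `b`) × (functions of `b₋`) is the position sum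
against `bondData`. [folklore] -/
private theorem sum_bond_resum (At : HiggsLattice.VecField P 0) (n' : ℕ) (S : Finset (HiggsLattice.PBond P 0))
    (w : HiggsLattice.PBond P 0 → ℝ) (c A : HiggsLattice.Site P 0 → ℝ) :
    ∑ b ∈ S, (|w b| * |At b| ^ n') * c b.src * A b.src = ∑ x, (c x * bondData At n' S w x) * A x := by
  rw [sum_mem_eq_sum_ite, sum_bond]
  refine Finset.sum_congr rfl fun x _ => ?_
  unfold bondData
  simp only [Finset.mul_sum, Finset.sum_mul]
  refine Finset.sum_congr rfl fun μ _ => ?_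
  ring

/-- The VERTEX FUNCTION of (1.9) in position form at `x = b₋`: `|e|^{n+n̄+1} η^{n+n̄}/(n!(n̄+1)!) · η^d η⁻¹ |g_k(x)|^n ·
Σ_μ [⟨x,μ⟩ ∈ S] |w| |Ã|^{n̄+1}`. [cite: Balaban1983Higgs3, (1.9) p.413] [cite: Balaban1983Higgs3, (2.13) p.426] -/
def u19 (C : ChargeData N) (g : HiggsLattice.Site P 0 → ℝ) (At : HiggsLattice.VecField P 0) (nbar n : ℕ)
    (S : Finset (HiggsLattice.PBond P 0)) (w : HiggsLattice.PBond P 0 → ℝ) (x : HiggsLattice.Site P 0) : ℝ :=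
  |C.e| ^ (n + nbar + 1) * (P.mesh 0 ^ (n + nbar) / ((n.factorial : ℝ) * (nbar + 1).factorial)) *
    ((P.mesh 0 ^ P.d * (P.mesh 0)⁻¹ * |g x| ^ n) * bondData At (nbar + 1) S w x)

/-- `u19 ≥ 0`. [cite: Balaban1983Higgs3, (1.9) p.413] -/
theorem u19_nonneg (C : ChargeData N) (g : HiggsLattice.Site P 0 → ℝ) (At : HiggsLattice.VecField P 0) (nbar n : ℕ)
    (S : Finset (HiggsLattice.PBond P 0)) (w : HiggsLattice.PBond P 0 → ℝ) (x : HiggsLattice.Site P 0) :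
    0 ≤ u19 C g At nbar n S w x := by
  unfold u19
  have := P.mesh_pos 0
  have := bondData_nonneg At (nbar + 1) S w x
  positivity

/-- **ATTACHMENT LEMMA for (1.9)** (as (1.8): differentiated leg by `attD`, the other φ′-leg by `attS`, A′-legs by `attB`).
[cite: Balaban1983Higgs3, (1.9) p.413] [cite: Balaban1983Higgs3, (2.13) p.426] -/
theorem abs_rule19_basis_le (C : ChargeData N) (g : HiggsLattice.Site P 0 → ℝ) (B At : HiggsLattice.VecField P 0) (nbar n : ℕ)
    (S : Finset (HiggsLattice.PBond P 0)) (w : HiggsLattice.PBond P 0 → ℝ) (aS : Fin 2 → HiggsLattice.Site P 0 × Fin N)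
    (aV : Fin n → HiggsLattice.PBond P 0) :
    |rule19 C g B At nbar n S w (fun j => basisE (aS j)) (fun j => basisV (aV j))| ≤
      ∑ x, u19 C g At nbar n S w x * ((attD x (aS 0) * attS x (aS 1)) * ∏ j : Fin n, attB x (aV j)) := by
  refine (abs_rule19_le C g B At nbar n S w (fun j => basisE (aS j)) (fun j => basisV (aV j))).trans ?_
  have hη : 0 < P.mesh 0 := P.mesh_pos 0
  have hcoef : 0 ≤ |C.e| ^ (n + nbar + 1) * (P.mesh 0 ^ (n + nbar) / ((n.factorial : ℝ) * (nbar + 1).factorial)) :=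
    mul_nonneg (pow_nonneg (abs_nonneg _) _) (div_nonneg (pow_nonneg hη.le _) (by positivity))
  have hbond : ∀ b : HiggsLattice.PBond P 0,
      |w b| * (P.mesh 0 ^ P.d * (‖covDeriv C B (basisE (aS 0)) b‖ * ‖basisE (aS 1) b.src‖) *
          (∏ j : Fin n, |g b.src| * |basisV (aV j) b|) * |At b| ^ (nbar + 1)) ≤
        (|w b| * |At b| ^ (nbar + 1)) * (P.mesh 0 ^ P.d * (P.mesh 0)⁻¹ * |g b.src| ^ n) *
          ((attD b.src (aS 0) * attS b.src (aS 1)) * ∏ j : Fin n, attB b.src (aV j)) := by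
    intro b
    have h1 : ‖covDeriv C B (basisE (aS 0)) b‖ * ‖basisE (aS 1) b.src‖ ≤
        ((P.mesh 0)⁻¹ * attD b.src (aS 0)) * attS b.src (aS 1) := by
      rw [norm_basisE_src_eq_attS]
      exact mul_le_mul_of_nonneg_right (norm_covDeriv_basisE_le_attD C B (aS 0) b) (attS_nonneg _ _)
    have h2 := prod_vlegs_basisV_le g aV b
    have hY1 : 0 ≤ P.mesh 0 ^ P.d * (((P.mesh 0)⁻¹ * attD b.src (aS 0)) * attS b.src (aS 1)) :=
      mul_nonneg (pow_nonneg hη.le _) (mul_nonneg (mul_nonneg (inv_nonneg.2 hη.le) (attD_nonneg _ _)) (attS_nonneg _ _))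
    have hX2 : 0 ≤ ∏ j : Fin n, |g b.src| * |basisV (aV j) b| := Finset.prod_nonneg fun j _ => by positivity
    calc |w b| * (P.mesh 0 ^ P.d * (‖covDeriv C B (basisE (aS 0)) b‖ * ‖basisE (aS 1) b.src‖) *
          (∏ j : Fin n, |g b.src| * |basisV (aV j) b|) * |At b| ^ (nbar + 1))
        ≤ |w b| * (P.mesh 0 ^ P.d * (((P.mesh 0)⁻¹ * attD b.src (aS 0)) * attS b.src (aS 1)) *
          (|g b.src| ^ n * ∏ j : Fin n, attB b.src (aV j)) * |At b| ^ (nbar + 1)) :=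
          mul_le_mul_of_nonneg_left (mul_le_mul_of_nonneg_right
            (mul_le_mul (mul_le_mul_of_nonneg_left h1 (pow_nonneg hη.le _)) h2 hX2 hY1) (by positivity)) (abs_nonneg _)
      _ = _ := by ring
  refine (mul_le_mul_of_nonneg_left (Finset.sum_le_sum fun b _ => hbond b) hcoef).trans (le_of_eq ?_)
  rw [sum_bond_resum At (nbar + 1) S w (fun x => P.mesh 0 ^ P.d * (P.mesh 0)⁻¹ * |g x| ^ n)
    (fun x => (attD x (aS 0) * attS x (aS 1)) * ∏ j : Fin n, attB x (aV j)), Finset.mul_sum]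
  refine Finset.sum_congr rfl fun x _ => ?_
  unfold u19
  ring

/-- The VERTEX FUNCTION of (1.11) in position form at `x = b₋`: `|e|^{n+n̄+1} η^{n+n̄−1}/(n!(n̄+1)!) · η^d |g_k(x)|^n ·
Σ_μ [⟨x,μ⟩ ∈ S] |w| |Ã|^{n̄+1}`. [cite: Balaban1983Higgs3, (1.11) p.413] [cite: Balaban1983Higgs3, (2.13) p.426] -/
def u111 (C : ChargeData N) (g : HiggsLattice.Site P 0 → ℝ) (At : HiggsLattice.VecField P 0) (nbar n : ℕ)
    (S : Finset (HiggsLattice.PBond P 0)) (w : HiggsLattice.PBond P 0 → ℝ) (x : HiggsLattice.Site P 0) : ℝ :=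
  |C.e| ^ (n + nbar + 1) * (P.mesh 0 ^ ((n + nbar : ℤ) - 1) / ((n.factorial : ℝ) * (nbar + 1).factorial)) *
    ((P.mesh 0 ^ P.d * |g x| ^ n) * bondData At (nbar + 1) S w x)

/-- `u111 ≥ 0`. [cite: Balaban1983Higgs3, (1.11) p.413] -/
theorem u111_nonneg (C : ChargeData N) (g : HiggsLattice.Site P 0 → ℝ) (At : HiggsLattice.VecField P 0) (nbar n : ℕ)
    (S : Finset (HiggsLattice.PBond P 0)) (w : HiggsLattice.PBond P 0 → ℝ) (x : HiggsLattice.Site P 0) :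
    0 ≤ u111 C g At nbar n S w x := by
  unfold u111
  have := P.mesh_pos 0
  have := bondData_nonneg At (nbar + 1) S w x
  have : 0 ≤ P.mesh 0 ^ ((n + nbar : ℤ) - 1) := zpow_nonneg (P.mesh_pos 0).le _
  positivity

/-- **ATTACHMENT LEMMA for (1.11)** (as (1.10): both φ′-legs by `attS`, A′-legs by `attB`). [cite: Balaban1983Higgs3, (1.11) p.413]
[cite: Balaban1983Higgs3, (2.13) p.426] -/
theorem abs_rule111_basis_le (C : ChargeData N) (g : HiggsLattice.Site P 0 → ℝ) (At : HiggsLattice.VecField P 0) (nbar n : ℕ)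
    (S : Finset (HiggsLattice.PBond P 0)) (w : HiggsLattice.PBond P 0 → ℝ) (aS : Fin 2 → HiggsLattice.Site P 0 × Fin N)
    (aV : Fin n → HiggsLattice.PBond P 0) :
    |rule111 C g At nbar n S w (fun j => basisE (aS j)) (fun j => basisV (aV j))| ≤
      ∑ x, u111 C g At nbar n S w x * ((attS x (aS 0) * attS x (aS 1)) * ∏ j : Fin n, attB x (aV j)) := by
  refine (abs_rule111_le C g At nbar n S w (fun j => basisE (aS j)) (fun j => basisV (aV j))).trans ?_
  have hη : 0 < P.mesh 0 := P.mesh_pos 0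
  have hcoef : 0 ≤ |C.e| ^ (n + nbar + 1) * (P.mesh 0 ^ ((n + nbar : ℤ) - 1) / ((n.factorial : ℝ) * (nbar + 1).factorial)) :=
    mul_nonneg (pow_nonneg (abs_nonneg _) _) (div_nonneg (zpow_nonneg hη.le _) (by positivity))
  have hbond : ∀ b : HiggsLattice.PBond P 0,
      |w b| * (P.mesh 0 ^ P.d * (‖basisE (aS 0) b.src‖ * ‖basisE (aS 1) b.src‖) *
          (∏ j : Fin n, |g b.src| * |basisV (aV j) b|) * |At b| ^ (nbar + 1)) ≤
        (|w b| * |At b| ^ (nbar + 1)) * (P.mesh 0 ^ P.d * |g b.src| ^ n) *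
          ((attS b.src (aS 0) * attS b.src (aS 1)) * ∏ j : Fin n, attB b.src (aV j)) := by
    intro b
    rw [norm_basisE_src_eq_attS, norm_basisE_src_eq_attS]
    have h2 := prod_vlegs_basisV_le g aV b
    have hY1 : 0 ≤ P.mesh 0 ^ P.d * (attS b.src (aS 0) * attS b.src (aS 1)) :=
      mul_nonneg (pow_nonneg hη.le _) (mul_nonneg (attS_nonneg _ _) (attS_nonneg _ _))
    calc |w b| * (P.mesh 0 ^ P.d * (attS b.src (aS 0) * attS b.src (aS 1)) *
          (∏ j : Fin n, |g b.src| * |basisV (aV j) b|) * |At b| ^ (nbar + 1))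
        ≤ |w b| * (P.mesh 0 ^ P.d * (attS b.src (aS 0) * attS b.src (aS 1)) *
          (|g b.src| ^ n * ∏ j : Fin n, attB b.src (aV j)) * |At b| ^ (nbar + 1)) :=
          mul_le_mul_of_nonneg_left (mul_le_mul_of_nonneg_right (mul_le_mul_of_nonneg_left h2 hY1) (by positivity))
            (abs_nonneg _)
      _ = _ := by ring
  refine (mul_le_mul_of_nonneg_left (Finset.sum_le_sum fun b _ => hbond b) hcoef).trans (le_of_eq ?_)
  rw [sum_bond_resum At (nbar + 1) S w (fun x => P.mesh 0 ^ P.d * |g x| ^ n)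
    (fun x => (attS x (aS 0) * attS x (aS 1)) * ∏ j : Fin n, attB x (aV j)), Finset.mul_sum]
  refine Finset.sum_congr rfl fun x _ => ?_
  unfold u111
  ring

/-! ### The averaging vertices (1.13)–(1.15): the φ′-leg at a fine site `x ∈ B^k(y)`, the output read at the block point
`y = x^{(k)}`, the A′-legs through the contour functional of FILE 2's `Model` -/

omit [DecidableEq (HiggsLattice.PBond P 0)] in
/-- The norm of a basis field at a site, at any level: `‖(δ_x ⊗ e_a)(x′)‖ = [x′ = x]`. [cite: Balaban1983Higgs3, p.414] -/
theorem norm_basisE_apply' {j : ℕ} (p : HiggsLattice.Site P j × Fin N) (x : HiggsLattice.Site P j) :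
    ‖basisE p x‖ = if x = p.1 then 1 else 0 := by
  rw [B3Eq36TadpoleExpressions.basisE_eq]
  split_ifs
  · rw [PiLp.norm_single, norm_one]
  · exact norm_zero

/-- ATTACHMENT WEIGHT of an OUTPUT slot of an averaging vertex whose φ′-leg sits at the fine site `x`: the output (a vector of the
internal space at the block point, paired by (1.18)) is read at `x^{(k)}`, the `k`-block point of `x` — `[r at x^{(k)}]`.
[cite: Balaban1983Higgs3, (1.18) p.415] [cite: Balaban1983Higgs3, (1.13) p.413] -/
def attO (k : ℕ) (x : HiggsLattice.Site P 0) (r : HiggsLattice.Site P k × Fin N) : ℝ :=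
  if r.1 = HiggsAveraging.blockIter k x then 1 else 0

/-- ATTACHMENT WEIGHT of an A′-leg of an averaging vertex (1.14)/(1.15) whose φ′-leg sits at `x`: the absolute value of the
contour functional of FILE 2's `Model` on the basis bond field, `|δ_b(Γ^{(k)}_{y,x})|` (for the tree's contours `η·[b ∈ Γ^{(k)}_{y,x}]`;
NO property of `ctr` is used here — the (2.12) bookkeeping of the averaged leg is the instantiating seat's).
[cite: Balaban1983Higgs3, (1.14) p.413] [cite: Balaban1983Higgs3, (2.12) p.426] -/
def attC (ctr : HiggsLattice.VecField P 0 → HiggsLattice.Site P 0 → ℝ) (x : HiggsLattice.Site P 0) (b : HiggsLattice.PBond P 0) : ℝ :=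
  |ctr (basisV b) x|

omit [DecidableEq (HiggsLattice.PBond P 0)] in
/-- `attO ≥ 0`. [cite: Balaban1983Higgs3, (1.18) p.415] -/
theorem attO_nonneg (k : ℕ) (x : HiggsLattice.Site P 0) (r : HiggsLattice.Site P k × Fin N) : 0 ≤ attO k x r := by
  unfold attO; split_ifs <;> norm_num

/-- `attC ≥ 0`. [cite: Balaban1983Higgs3, (1.14) p.413] -/
theorem attC_nonneg (ctr : HiggsLattice.VecField P 0 → HiggsLattice.Site P 0 → ℝ) (x : HiggsLattice.Site P 0)
    (b : HiggsLattice.PBond P 0) : 0 ≤ attC ctr x b := abs_nonneg _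

omit [DecidableEq (HiggsLattice.PBond P 0)] in
/-- The block sum of an averaging vertex on a basis field localizes at the leg's site: if `‖F_x(v)‖ ≤ c(x)‖v‖` then
`‖Σ_{x∈B^k(y)} F_x(δ_p(x))‖ ≤ c(p) [p^{(k)} = y]`. [cite: Balaban1983Higgs3, (1.13) p.413] -/
theorem norm_sum_blockK_basisE_le (k : ℕ) (y : HiggsLattice.Site P k) (p : HiggsLattice.Site P 0 × Fin N)
    (F : HiggsLattice.Site P 0 → HiggsCovariance.E N → HiggsCovariance.E N) (c : HiggsLattice.Site P 0 → ℝ)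
    (hF : ∀ x v, ‖F x v‖ ≤ c x * ‖v‖) :
    ‖∑ x ∈ HiggsAveraging.blockK k y, F x (basisE p x)‖ ≤
      c p.1 * (if HiggsAveraging.blockIter k p.1 = y then 1 else 0) := by
  refine (norm_sum_le _ _).trans ((Finset.sum_le_sum fun x _ => hF x _).trans (le_of_eq ?_))
  simp only [norm_basisE_apply', mul_ite, mul_one, mul_zero]
  rw [Finset.sum_ite_eq' (HiggsAveraging.blockK k y) p.1]
  simp only [HiggsAveraging.mem_blockK]

omit [DecidableEq (HiggsLattice.PBond P 0)] in
/-- The output pairing of an averaging vertex on a basis co-field localizes at the output's block point: if `‖v(y)‖ ≤ c(y)` then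
`|Σ_{y∈Y} w_Y(y) (δ_r(y)·v(y))| ≤ [r ∈ Y] |w_Y(r)| c(r)`. [cite: Balaban1983Higgs3, (1.18) p.415] -/
theorem abs_sum_inner_basisE_le (Y : Finset (HiggsLattice.Site P k)) (wY : HiggsLattice.Site P k → ℝ)
    (r : HiggsLattice.Site P k × Fin N) (v : HiggsLattice.Site P k → HiggsCovariance.E N) (c : HiggsLattice.Site P k → ℝ)
    (hv : ∀ y, ‖v y‖ ≤ c y) :
    |∑ y ∈ Y, wY y * inner ℝ (basisE r y) (v y)| ≤ (if r.1 ∈ Y then 1 else 0) * (|wY r.1| * c r.1) := by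
  have h : ∀ y, |wY y * inner ℝ (basisE r y) (v y)| ≤ if r.1 = y then |wY y| * c y else 0 := by
    intro y
    rw [abs_mul]
    by_cases hy : r.1 = y
    · rw [if_pos hy]
      refine mul_le_mul_of_nonneg_left ((abs_real_inner_le_norm _ _).trans ?_) (abs_nonneg _)
      rw [norm_basisE_apply', if_pos hy.symm, one_mul]
      exact hv y
    · rw [if_neg hy]
      have h0 : basisE r y = 0 := by
        rw [← norm_eq_zero, norm_basisE_apply', if_neg fun h' => hy h'.symm]
      rw [h0, inner_zero_left, abs_zero, mul_zero]
  refine (Finset.abs_sum_le_sum_abs _ _).trans ((Finset.sum_le_sum fun y _ => h y).trans (le_of_eq ?_))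
  rw [Finset.sum_ite_eq]
  split_ifs <;> simp

omit [DecidableEq (HiggsLattice.PBond P 0)] in
/-- kernel: the position sum against the attachment at `x` of the φ′-leg picks the leg's site. [cite: Balaban1983Higgs3, (2.13) p.426] -/
theorem sum_mul_attS (p : HiggsLattice.Site P 0 × Fin N) (f g : HiggsLattice.Site P 0 → ℝ) :
    ∑ x, f x * (attS x p * g x) = f p.1 * g p.1 := by
  simp only [attS, ite_mul, one_mul, zero_mul, mul_ite, mul_zero]
  rw [Finset.sum_ite_eq]
  simp

omit [DecidableEq (HiggsLattice.PBond P 0)] in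
/-- kernel: the bridge from the localized bound of an averaging vertex (`[r ∈ Y]|w_Y(r)|·K(p)V(p)[p^{(k)} = r]`) to its position form
(`Σ_x (K(x)|w_Y(x^{(k)})|[x^{(k)} ∈ Y]) · [p at x] V(x) [r at x^{(k)}]`). [cite: Balaban1983Higgs3, (2.13) p.426] -/
theorem avg_position_bridge (k : ℕ) (Y : Finset (HiggsLattice.Site P k)) (wY : HiggsLattice.Site P k → ℝ)
    (p : HiggsLattice.Site P 0 × Fin N) (r : HiggsLattice.Site P k × Fin N) (K V : HiggsLattice.Site P 0 → ℝ)
    (hK : ∀ x, 0 ≤ K x) (hV : ∀ x, 0 ≤ V x) :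
    (if r.1 ∈ Y then (1 : ℝ) else 0) * (|wY r.1| * (K p.1 * V p.1 * (if HiggsAveraging.blockIter k p.1 = r.1 then 1 else 0))) ≤
      ∑ x, (K x * |wY (HiggsAveraging.blockIter k x)| * (if HiggsAveraging.blockIter k x ∈ Y then 1 else 0)) *
        (attS x p * V x * attO k x r) := by
  have hre : ∀ x, (K x * |wY (HiggsAveraging.blockIter k x)| * (if HiggsAveraging.blockIter k x ∈ Y then (1 : ℝ) else 0)) *
      (attS x p * V x * attO k x r) =
      (K x * |wY (HiggsAveraging.blockIter k x)| * (if HiggsAveraging.blockIter k x ∈ Y then (1 : ℝ) else 0)) *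
      (attS x p * (V x * attO k x r)) := fun x => by ring
  simp only [hre]
  rw [sum_mul_attS]
  by_cases h : HiggsAveraging.blockIter k p.1 = r.1
  · rw [if_pos h, h]
    unfold attO
    rw [if_pos h.symm]
    refine le_of_eq ?_
    ring
  · rw [if_neg h, mul_zero, mul_zero, mul_zero]
    have := hK p.1
    have := hV p.1
    have := attO_nonneg k p.1 r
    have : 0 ≤ (if HiggsAveraging.blockIter k p.1 ∈ Y then (1 : ℝ) else 0) := by split_ifs <;> norm_num
    positivity

/-- The VERTEX FUNCTION of (1.13) in position form at the fine site `x` of its φ′-leg: `|η^d| |w_Y(x^{(k)})| [x^{(k)} ∈ T₁^{(k)} ∩ Ω]`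
(`|U| = 1`). [cite: Balaban1983Higgs3, (1.13) p.413] [cite: Balaban1983Higgs3, (2.13) p.426] -/
def u113 (w : ℝ) (Y : Finset (HiggsLattice.Site P k)) (wY : HiggsLattice.Site P k → ℝ) (x : HiggsLattice.Site P 0) : ℝ :=
  |w| * |wY (HiggsAveraging.blockIter k x)| * (if HiggsAveraging.blockIter k x ∈ Y then 1 else 0)

omit [DecidableEq (HiggsLattice.PBond P 0)] in
/-- `u113 ≥ 0`. [cite: Balaban1983Higgs3, (1.13) p.413] -/
theorem u113_nonneg (w : ℝ) (Y : Finset (HiggsLattice.Site P k)) (wY : HiggsLattice.Site P k → ℝ) (x : HiggsLattice.Site P 0) :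
    0 ≤ u113 w Y wY x := by
  unfold u113; split_ifs <;> positivity

omit [DecidableEq (HiggsLattice.PBond P 0)] in
/-- **ATTACHMENT LEMMA for (1.13)**: `|V_(1.13)(δ_p; δ_r)| ≤ Σ_x u113(x) [p at x] [r at x^{(k)}]` — the averaged leg `−(Q_k(B̃)δ_p)(y)`
is `−η^d U(B̃(Γ_{y,p}))e_a [p ∈ B^k(y)]`, of norm `η^d [p^{(k)} = y]`. [cite: Balaban1983Higgs3, (1.13) p.413]
[cite: Balaban1983Higgs3, (2.13) p.426] -/
theorem abs_rule113_basis_le (C : ChargeData N) (w : ℝ) (β : HiggsLattice.Site P 0 → ℝ) (Y : Finset (HiggsLattice.Site P k))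
    (wY : HiggsLattice.Site P k → ℝ) (aS : Fin 1 → HiggsLattice.Site P 0 × Fin N) (aO : Fin 1 → HiggsLattice.Site P k × Fin N) :
    |rule113 C w β k Y wY (fun j => basisE (aS j)) (fun j => basisE (aO j))| ≤
      ∑ x, u113 w Y wY x * (attS x (aS 0) * 1 * attO k x (aO 0)) := by
  unfold rule113
  have hv : ∀ y, ‖B3Eq114AveragingVertices.vertex113 C w β (basisE (aS 0)) k y‖ ≤
      |w| * (1 * (if HiggsAveraging.blockIter k (aS 0).1 = y then 1 else 0)) := by
    intro y
    unfold B3Eq114AveragingVertices.vertex113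
    rw [norm_neg, norm_smul, Real.norm_eq_abs]
    refine mul_le_mul_of_nonneg_left (norm_sum_blockK_basisE_le k y (aS 0) (fun x v => C.U 1 (β x) v) (fun _ => 1)
      fun x v => by rw [norm_U_apply, one_mul]) (abs_nonneg _)
  refine (abs_sum_inner_basisE_le Y wY (aO 0) _ _ hv).trans ?_
  have h := avg_position_bridge k Y wY (aS 0) (aO 0) (fun _ => |w|) (fun _ => 1) (fun _ => abs_nonneg _) (fun _ => zero_le_one)
  refine (le_of_eq ?_).trans (h.trans (le_of_eq (Finset.sum_congr rfl fun x _ => ?_)))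
  · ring
  · unfold u113; ring

/-- The VERTEX FUNCTION of (1.14)_{n,n′} in position form at the fine site `x`: `|e|^{n+n′}/(n!n′!) · |η^d| |Ã(Γ_{·,x})|^{n′} ·
|w_Y(x^{(k)})| [x^{(k)} ∈ Y]` (`|q| ≦ 1`, `|U| = 1`). [cite: Balaban1983Higgs3, (1.14) p.413] [cite: Balaban1983Higgs3, (2.13) p.426] -/
def u114 (C : ChargeData N) (w : ℝ) (τ : HiggsLattice.Site P 0 → ℝ) (n n' : ℕ) (Y : Finset (HiggsLattice.Site P k))
    (wY : HiggsLattice.Site P k → ℝ) (x : HiggsLattice.Site P 0) : ℝ :=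
  (|C.e| ^ (n + n') * (1 / ((n.factorial : ℝ) * n'.factorial)) * (|w| * |τ x| ^ n')) *
    |wY (HiggsAveraging.blockIter k x)| * (if HiggsAveraging.blockIter k x ∈ Y then 1 else 0)

omit [DecidableEq (HiggsLattice.PBond P 0)] in
/-- `u114 ≥ 0`. [cite: Balaban1983Higgs3, (1.14) p.413] -/
theorem u114_nonneg (C : ChargeData N) (w : ℝ) (τ : HiggsLattice.Site P 0 → ℝ) (n n' : ℕ) (Y : Finset (HiggsLattice.Site P k))
    (wY : HiggsLattice.Site P k → ℝ) (x : HiggsLattice.Site P 0) : 0 ≤ u114 C w τ n n' Y wY x := by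
  unfold u114; split_ifs <;> positivity

/-- **ATTACHMENT LEMMA for (1.14)_{n,n′}**: `|V_(1.14)(δ_p; δ_{b₁..b_n}; δ_r)| ≤ Σ_x u114(x) [p at x] Π_j |δ_{b_j}(Γ_{·,x})| [r at x^{(k)}]`.
[cite: Balaban1983Higgs3, (1.14) p.413] [cite: Balaban1983Higgs3, (2.13) p.426] -/
theorem abs_rule114_basis_le (C : ChargeData N) (w : ℝ) (β τ : HiggsLattice.Site P 0 → ℝ)
    (ctr : HiggsLattice.VecField P 0 → HiggsLattice.Site P 0 → ℝ) (n n' : ℕ) (Y : Finset (HiggsLattice.Site P k))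
    (wY : HiggsLattice.Site P k → ℝ) (aS : Fin 1 → HiggsLattice.Site P 0 × Fin N) (aV : Fin n → HiggsLattice.PBond P 0)
    (aO : Fin 1 → HiggsLattice.Site P k × Fin N) :
    |rule114 C w β τ ctr k n n' Y wY (fun j => basisE (aS j)) (fun j => basisV (aV j)) (fun j => basisE (aO j))| ≤
      ∑ x, u114 C w τ n n' Y wY x * (attS x (aS 0) * (∏ j : Fin n, attC ctr x (aV j)) * attO k x (aO 0)) := by
  unfold rule114
  have hv : ∀ y, ‖avg114 C w β τ ctr k n n' y (basisE (aS 0)) (fun j => basisV (aV j))‖ ≤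
      (|C.e| ^ (n + n') * (1 / ((n.factorial : ℝ) * n'.factorial))) * (|w| *
        (((∏ j : Fin n, attC ctr (aS 0).1 (aV j)) * |τ (aS 0).1| ^ n') *
          (if HiggsAveraging.blockIter k (aS 0).1 = y then 1 else 0))) := by
    intro y
    unfold avg114
    rw [norm_neg, norm_smul, norm_smul, Real.norm_eq_abs, Real.norm_eq_abs, abs_mul, abs_pow,
      abs_of_pos (by positivity : (0 : ℝ) < 1 / ((n.factorial : ℝ) * n'.factorial))]
    refine mul_le_mul_of_nonneg_left (mul_le_mul_of_nonneg_left (norm_sum_blockK_basisE_le k y (aS 0)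
      (fun x v => ((∏ j : Fin n, ctr (basisV (aV j)) x) * τ x ^ n') • (C.q ^ (n + n')) (C.U 1 (β x) v))
      (fun x => (∏ j : Fin n, attC ctr x (aV j)) * |τ x| ^ n') fun x v => ?_) (abs_nonneg _)) (by positivity)
    rw [norm_smul, Real.norm_eq_abs, abs_mul, abs_pow, Finset.abs_prod]
    refine mul_le_mul_of_nonneg_left ((norm_qpow_apply_le C _ _).trans (le_of_eq (norm_U_apply C _ _ _))) ?_
    exact mul_nonneg (Finset.prod_nonneg fun j _ => abs_nonneg _) (pow_nonneg (abs_nonneg _) _)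
  refine (abs_sum_inner_basisE_le Y wY (aO 0) _ _ hv).trans ?_
  have h := avg_position_bridge k Y wY (aS 0) (aO 0)
    (fun x => (|C.e| ^ (n + n') * (1 / ((n.factorial : ℝ) * n'.factorial))) * (|w| * |τ x| ^ n'))
    (fun x => ∏ j : Fin n, attC ctr x (aV j)) (fun x => by positivity) (fun x => Finset.prod_nonneg fun j _ => attC_nonneg _ _ _)
  refine (le_of_eq ?_).trans (h.trans (le_of_eq (Finset.sum_congr rfl fun x _ => ?_)))
  · ring
  · unfold u114; ring

/-- The VERTEX FUNCTION of (1.15) in position form (the R-vertex of (1.14): `|q^m R_{n̄+1}(eÃ(Γ)q)| ≦ 1`).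
[cite: Balaban1983Higgs3, (1.15) p.414] [cite: Balaban1983Higgs3, (2.13) p.426] -/
def u115 (C : ChargeData N) (w : ℝ) (τ : HiggsLattice.Site P 0 → ℝ) (nbar n : ℕ) (Y : Finset (HiggsLattice.Site P k))
    (wY : HiggsLattice.Site P k → ℝ) (x : HiggsLattice.Site P 0) : ℝ :=
  (|C.e| ^ (n + nbar + 1) * (1 / ((n.factorial : ℝ) * (nbar + 1).factorial)) * (|w| * |τ x| ^ (nbar + 1))) *
    |wY (HiggsAveraging.blockIter k x)| * (if HiggsAveraging.blockIter k x ∈ Y then 1 else 0)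

omit [DecidableEq (HiggsLattice.PBond P 0)] in
/-- `u115 ≥ 0`. [cite: Balaban1983Higgs3, (1.15) p.414] -/
theorem u115_nonneg (C : ChargeData N) (w : ℝ) (τ : HiggsLattice.Site P 0 → ℝ) (nbar n : ℕ) (Y : Finset (HiggsLattice.Site P k))
    (wY : HiggsLattice.Site P k → ℝ) (x : HiggsLattice.Site P 0) : 0 ≤ u115 C w τ nbar n Y wY x := by
  unfold u115; split_ifs <;> positivity

/-- **ATTACHMENT LEMMA for (1.15)** (as (1.14), with r15's `|q^m R_{n̄+1}(sq)| ≦ 1`). [cite: Balaban1983Higgs3, (1.15) p.414]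
[cite: Balaban1983Higgs3, (2.13) p.426] -/
theorem abs_rule115_basis_le (C : ChargeData N) (w : ℝ) (β τ : HiggsLattice.Site P 0 → ℝ)
    (ctr : HiggsLattice.VecField P 0 → HiggsLattice.Site P 0 → ℝ) (nbar n : ℕ) (Y : Finset (HiggsLattice.Site P k))
    (wY : HiggsLattice.Site P k → ℝ) (aS : Fin 1 → HiggsLattice.Site P 0 × Fin N) (aV : Fin n → HiggsLattice.PBond P 0)
    (aO : Fin 1 → HiggsLattice.Site P k × Fin N) :
    |rule115 C w β τ ctr k nbar n Y wY (fun j => basisE (aS j)) (fun j => basisV (aV j)) (fun j => basisE (aO j))| ≤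
      ∑ x, u115 C w τ nbar n Y wY x * (attS x (aS 0) * (∏ j : Fin n, attC ctr x (aV j)) * attO k x (aO 0)) := by
  unfold rule115
  have hv : ∀ y, ‖avg115 C w β τ ctr k nbar n y (basisE (aS 0)) (fun j => basisV (aV j))‖ ≤
      (|C.e| ^ (n + nbar + 1) * (1 / ((n.factorial : ℝ) * (nbar + 1).factorial))) * (|w| *
        (((∏ j : Fin n, attC ctr (aS 0).1 (aV j)) * |τ (aS 0).1| ^ (nbar + 1)) *
          (if HiggsAveraging.blockIter k (aS 0).1 = y then 1 else 0))) := by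
    intro y
    unfold avg115
    rw [norm_neg, norm_smul, norm_smul, Real.norm_eq_abs, Real.norm_eq_abs, abs_mul, abs_pow,
      abs_of_pos (by positivity : (0 : ℝ) < 1 / ((n.factorial : ℝ) * (nbar + 1).factorial))]
    refine mul_le_mul_of_nonneg_left (mul_le_mul_of_nonneg_left (norm_sum_blockK_basisE_le k y (aS 0)
      (fun x v => ((∏ j : Fin n, ctr (basisV (aV j)) x) * τ x ^ (nbar + 1)) •
        (C.q ^ (n + nbar + 1) * B3VertexTensorBounds.taylorRemOp nbar ((C.e * τ x) • C.q)) (C.U 1 (β x) v))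
      (fun x => (∏ j : Fin n, attC ctr x (aV j)) * |τ x| ^ (nbar + 1)) fun x v => ?_) (abs_nonneg _)) (by positivity)
    rw [norm_smul, Real.norm_eq_abs, abs_mul, abs_pow, Finset.abs_prod]
    refine mul_le_mul_of_nonneg_left (((C.q ^ (n + nbar + 1) * B3VertexTensorBounds.taylorRemOp nbar
      ((C.e * τ x) • C.q)).le_opNorm _).trans ?_) ?_
    · exact (mul_le_of_le_one_left (norm_nonneg _) (B3VertexTensorBounds.norm_qpow_mul_remOp_le_one C _ _ _)).trans
        (le_of_eq (norm_U_apply C _ _ _))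
    · exact mul_nonneg (Finset.prod_nonneg fun j _ => abs_nonneg _) (pow_nonneg (abs_nonneg _) _)
  refine (abs_sum_inner_basisE_le Y wY (aO 0) _ _ hv).trans ?_
  have h := avg_position_bridge k Y wY (aS 0) (aO 0)
    (fun x => (|C.e| ^ (n + nbar + 1) * (1 / ((n.factorial : ℝ) * (nbar + 1).factorial))) * (|w| * |τ x| ^ (nbar + 1)))
    (fun x => ∏ j : Fin n, attC ctr x (aV j)) (fun x => by positivity) (fun x => Finset.prod_nonneg fun j _ => attC_nonneg _ _ _)
  refine (le_of_eq ?_).trans (h.trans (le_of_eq (Finset.sum_congr rfl fun x _ => ?_)))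
  · ring
  · unfold u115; ring

/-! ## §4 The position form for the concrete expression E(G, {□(v)}, Φ_ext, A_ext) of FILE 2 — every graph of p18's model -/

omit [DecidableEq (HiggsLattice.PBond P 0)] in
/-- The attachment weight of the `j`-th φ′-leg of a vertex of kind `κ` at the site `x`: the DIFFERENTIATED leg (leg `0` of
(1.8), (1.9): `diffCount κ = 1`) is attached by `attD` (at `x` or a forward neighbour), every other φ′-leg by `attS` (at `x`).
[cite: Balaban1983Higgs3, (1.8) p.413] -/
def attSK (κ : VertexKind) (j : Fin κ.scalarLegs) (x : HiggsLattice.Site P 0) (p : HiggsLattice.Site P 0 × Fin N) : ℝ :=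
  if κ.diffCount = 1 ∧ j.val = 0 then attD x p else attS x p

omit [DecidableEq (HiggsLattice.PBond P 0)] in
/-- `attSK ≥ 0`. [cite: Balaban1983Higgs3, (1.8) p.413] -/
theorem attSK_nonneg (κ : VertexKind) (j : Fin κ.scalarLegs) (x : HiggsLattice.Site P 0) (p : HiggsLattice.Site P 0 × Fin N) :
    0 ≤ attSK κ j x p := by
  unfold attSK
  split_ifs
  · exact attD_nonneg x p
  · exact attS_nonneg x p

/-- The attachment weight of an A′-leg of a vertex of kind `κ` whose position is the site `x`: for the bond vertices (1.8)–(1.11)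
the leg's bond starts at `x` (`attB`); for the averaging vertices (1.14), (1.15) the contour functional `|δ_b(Γ^{(k)}_{·,x})|`
(`attC`). [cite: Balaban1983Higgs3, (1.8) p.413] [cite: Balaban1983Higgs3, (1.14) p.413] -/
def attVK (ctr : HiggsLattice.VecField P 0 → HiggsLattice.Site P 0 → ℝ) (κ : VertexKind) (x : HiggsLattice.Site P 0)
    (b : HiggsLattice.PBond P 0) : ℝ :=
  if κ.isOfForm1315 then attC ctr x b else attB x b

/-- `attVK ≥ 0`. [cite: Balaban1983Higgs3, (1.8) p.413] -/
theorem attVK_nonneg (ctr : HiggsLattice.VecField P 0 → HiggsLattice.Site P 0 → ℝ) (κ : VertexKind) (x : HiggsLattice.Site P 0)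
    (b : HiggsLattice.PBond P 0) : 0 ≤ attVK ctr κ x b := by
  unfold attVK
  split_ifs
  · exact attC_nonneg ctr x b
  · exact attB_nonneg x b

/-- **The VERTEX FUNCTION of a vertex of kind `κ` in position form** for the model data `M`, the counterterm `δm_i²` and the
localization `l` (the weight of the vertex's species enters the vertex function): `u16`, `u17`, `u18`, `u19`, `u110`, `u111`,
`u113`, `u114`, `u115`. [cite: Balaban1983Higgs3, (1.6)–(1.15) pp.413–414] [cite: Balaban1983Higgs3, (2.13) p.426] -/
def uOfKind (M : Model P N k) (dm2 : HiggsLattice.Site P 0 → ℝ) (l : Loc P k) : VertexKind → HiggsLattice.Site P 0 → ℝ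
  | .v16 => u16 M.lamRun M.Ω₁ l.wS
  | .v17 => u17 dm2 M.ell M.Ω₁ l.wS
  | .v18 n n' => u18 M.C M.g M.At n n' M.S l.wB
  | .v19 n nb => u19 M.C M.g M.At nb n M.S l.wB
  | .v110 n n' => u110 M.C M.g M.At n n' M.S l.wB
  | .v111 n nb => u111 M.C M.g M.At nb n M.S l.wB
  | .v113 => u113 M.w M.Y l.wY
  | .v114 n n' => u114 M.C M.w M.τ n n' M.Y l.wY
  | .v115 n nb => u115 M.C M.w M.τ nb n M.Y l.wY

/-- `uOfKind ≥ 0`. [cite: Balaban1983Higgs3, (2.13) p.426] -/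
theorem uOfKind_nonneg (M : Model P N k) (dm2 : HiggsLattice.Site P 0 → ℝ) (l : Loc P k) (κ : VertexKind)
    (x : HiggsLattice.Site P 0) : 0 ≤ uOfKind M dm2 l κ x := by
  cases κ with
  | v16 => exact u16_nonneg _ _ _ _
  | v17 => exact u17_nonneg _ _ _ _ _
  | v18 n n' => exact u18_nonneg _ _ _ _ _ _ _ _
  | v110 n n' => exact u110_nonneg _ _ _ _ _ _ _ _
  | v19 n nb => exact u19_nonneg _ _ _ _ _ _ _ _
  | v111 n nb => exact u111_nonneg _ _ _ _ _ _ _ _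
  | v113 => exact u113_nonneg _ _ _ _
  | v114 n n' => exact u114_nonneg _ _ _ _ _ _ _ _
  | v115 n nb => exact u115_nonneg _ _ _ _ _ _ _ _

/-- **ATTACHMENT LEMMA for the rule of every kind** (dispatch to §3): the Feynman rule of FILE 2 of a vertex of kind `κ` on the
coordinate bases is dominated by `Σ_x uOfKind(x) · Π_{φ′-legs} attSK(x, ·) · Π_{A′-legs} attVK(x, ·) · Π_{outputs} attO(x, ·)`.
[cite: Balaban1983Higgs3, (1.6)–(1.15) pp.413–414] [cite: Balaban1983Higgs3, (2.13) p.426] -/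
theorem abs_ruleOfKind_basis_le (M : Model P N k) (dm2 : HiggsLattice.Site P 0 → ℝ) (l : Loc P k) (κ : VertexKind)
    (aS : Fin κ.scalarLegs → HiggsLattice.Site P 0 × Fin N) (aV : Fin κ.vectorLegs → HiggsLattice.PBond P 0)
    (aO : Fin (outSlots κ) → HiggsLattice.Site P k × Fin N) :
    |ruleOfKind k M dm2 l κ (fun j => basisE (aS j)) (fun j => basisV (aV j)) (fun j => basisE (aO j))| ≤
      ∑ x, uOfKind M dm2 l κ x *
        ((∏ j, attSK κ j x (aS j)) * (∏ j, attVK M.ctr κ x (aV j)) * ∏ j, attO k x (aO j)) := by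
  cases κ with
  | v16 =>
    simp only [ruleOfKind, uOfKind]
    refine (abs_rule16_basisE_le M.lamRun M.Ω₁ l.wS aS).trans (le_of_eq (Finset.sum_congr rfl fun x _ => ?_))
    congr 1
    show ∏ j : Fin 4, attS x (aS j) = (∏ j : Fin 4, attSK VertexKind.v16 j x (aS j)) *
      (∏ j : Fin 0, attVK M.ctr VertexKind.v16 x (aV j)) * ∏ j : Fin 0, attO k x (aO j)
    rw [Fin.prod_univ_zero, Fin.prod_univ_zero, mul_one, mul_one]
    simp [attSK, VertexKind.diffCount]
  | v17 =>
    simp only [ruleOfKind, uOfKind]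
    refine (abs_rule17_basisE_le dm2 M.ell M.Ω₁ l.wS aS).trans (le_of_eq (Finset.sum_congr rfl fun x _ => ?_))
    congr 1
    show ∏ j : Fin 2, attS x (aS j) = (∏ j : Fin 2, attSK VertexKind.v17 j x (aS j)) *
      (∏ j : Fin 0, attVK M.ctr VertexKind.v17 x (aV j)) * ∏ j : Fin 0, attO k x (aO j)
    rw [Fin.prod_univ_zero, Fin.prod_univ_zero, mul_one, mul_one]
    simp [attSK, VertexKind.diffCount]
  | v18 n n' =>
    simp only [ruleOfKind, uOfKind]
    refine (abs_rule18_basis_le M.C M.g M.B M.At n n' M.S l.wB aS aV).trans (le_of_eq (Finset.sum_congr rfl fun x _ => ?_))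
    congr 1
    show attD x (aS (0 : Fin 2)) * attS x (aS (1 : Fin 2)) * ∏ j : Fin n, attB x (aV j) =
      (∏ j : Fin 2, attSK (VertexKind.v18 n n') j x (aS j)) * (∏ j : Fin n, attVK M.ctr (VertexKind.v18 n n') x (aV j)) *
        ∏ j : Fin 0, attO k x (aO j)
    rw [Fin.prod_univ_zero, mul_one, Fin.prod_univ_two]
    simp [attSK, attVK, VertexKind.diffCount, VertexKind.isOfForm1315]
  | v19 n nb =>
    simp only [ruleOfKind, uOfKind]
    refine (abs_rule19_basis_le M.C M.g M.B M.At nb n M.S l.wB aS aV).trans (le_of_eq (Finset.sum_congr rfl fun x _ => ?_))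
    congr 1
    show attD x (aS (0 : Fin 2)) * attS x (aS (1 : Fin 2)) * ∏ j : Fin n, attB x (aV j) =
      (∏ j : Fin 2, attSK (VertexKind.v19 n nb) j x (aS j)) * (∏ j : Fin n, attVK M.ctr (VertexKind.v19 n nb) x (aV j)) *
        ∏ j : Fin 0, attO k x (aO j)
    rw [Fin.prod_univ_zero, mul_one, Fin.prod_univ_two]
    simp [attSK, attVK, VertexKind.diffCount, VertexKind.isOfForm1315]
  | v110 n n' =>
    simp only [ruleOfKind, uOfKind]
    refine (abs_rule110_basis_le M.C M.g M.At n n' M.S l.wB aS aV).trans (le_of_eq (Finset.sum_congr rfl fun x _ => ?_))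
    congr 1
    show attS x (aS (0 : Fin 2)) * attS x (aS (1 : Fin 2)) * ∏ j : Fin n, attB x (aV j) =
      (∏ j : Fin 2, attSK (VertexKind.v110 n n') j x (aS j)) * (∏ j : Fin n, attVK M.ctr (VertexKind.v110 n n') x (aV j)) *
        ∏ j : Fin 0, attO k x (aO j)
    rw [Fin.prod_univ_zero, mul_one, Fin.prod_univ_two]
    simp [attSK, attVK, VertexKind.diffCount, VertexKind.isOfForm1315]
  | v111 n nb =>
    simp only [ruleOfKind, uOfKind]
    refine (abs_rule111_basis_le M.C M.g M.At nb n M.S l.wB aS aV).trans (le_of_eq (Finset.sum_congr rfl fun x _ => ?_))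
    congr 1
    show attS x (aS (0 : Fin 2)) * attS x (aS (1 : Fin 2)) * ∏ j : Fin n, attB x (aV j) =
      (∏ j : Fin 2, attSK (VertexKind.v111 n nb) j x (aS j)) * (∏ j : Fin n, attVK M.ctr (VertexKind.v111 n nb) x (aV j)) *
        ∏ j : Fin 0, attO k x (aO j)
    rw [Fin.prod_univ_zero, mul_one, Fin.prod_univ_two]
    simp [attSK, attVK, VertexKind.diffCount, VertexKind.isOfForm1315]
  | v113 =>
    simp only [ruleOfKind, uOfKind]
    refine (abs_rule113_basis_le M.C M.w M.β M.Y l.wY aS aO).trans (le_of_eq (Finset.sum_congr rfl fun x _ => ?_))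
    congr 1
    show attS x (aS (0 : Fin 1)) * 1 * attO k x (aO (0 : Fin 1)) =
      (∏ j : Fin 1, attSK VertexKind.v113 j x (aS j)) * (∏ j : Fin 0, attVK M.ctr VertexKind.v113 x (aV j)) *
        ∏ j : Fin 1, attO k x (aO j)
    rw [Fin.prod_univ_zero, Fin.prod_univ_one, Fin.prod_univ_one]
    simp [attSK, VertexKind.diffCount]
  | v114 n n' =>
    simp only [ruleOfKind, uOfKind]
    refine (abs_rule114_basis_le M.C M.w M.β M.τ M.ctr n n' M.Y l.wY aS aV aO).trans
      (le_of_eq (Finset.sum_congr rfl fun x _ => ?_))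
    congr 1
    show attS x (aS (0 : Fin 1)) * (∏ j : Fin n, attC M.ctr x (aV j)) * attO k x (aO (0 : Fin 1)) =
      (∏ j : Fin 1, attSK (VertexKind.v114 n n') j x (aS j)) * (∏ j : Fin n, attVK M.ctr (VertexKind.v114 n n') x (aV j)) *
        ∏ j : Fin 1, attO k x (aO j)
    rw [Fin.prod_univ_one, Fin.prod_univ_one]
    simp [attSK, attVK, VertexKind.diffCount, VertexKind.isOfForm1315]
  | v115 n nb =>
    simp only [ruleOfKind, uOfKind]
    refine (abs_rule115_basis_le M.C M.w M.β M.τ M.ctr nb n M.Y l.wY aS aV aO).trans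
      (le_of_eq (Finset.sum_congr rfl fun x _ => ?_))
    congr 1
    show attS x (aS (0 : Fin 1)) * (∏ j : Fin n, attC M.ctr x (aV j)) * attO k x (aO (0 : Fin 1)) =
      (∏ j : Fin 1, attSK (VertexKind.v115 n nb) j x (aS j)) * (∏ j : Fin n, attVK M.ctr (VertexKind.v115 n nb) x (aV j)) *
        ∏ j : Fin 1, attO k x (aO j)
    rw [Fin.prod_univ_one, Fin.prod_univ_one]
    simp [attSK, attVK, VertexKind.diffCount, VertexKind.isOfForm1315]

variable {nbar : ℕ}

/-- **THE FIRST ESTIMATE OF E(G, {□(v)}, Φ_ext, A_ext) IN POSITION FORM, for EVERY graph of p18's model** (p. 426 *"We estimate it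
taking absolute values of all factors … in vertices we apply the inequalities |q| ≦ 1, |R_{n̄+1}(·)| ≦ 1"*): with ONE SITE OF `T_η`
PER VERTEX (for the averaging vertices (1.13)–(1.15): the fine site of their φ′-leg, the output being read at its `k`-block point),
the concrete expression of FILE 2 is dominated by `Σ_{x : V(G) → T_η} Π_v ū_v(x_v) · Π_{ext} n(x) · Π_{lines l} K̄_l(x_{v_l}, x_{v′_l})`,
for any position kernels `K̄` dominating the line kernels contracted against the attachments of their endpoints (scalar lines: the
`N × N` entries at the two sites, a differentiated endpoint also at the forward neighbours — where (2.10) and *"for each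
differentiation, there is an additional factor (L^jη)^{−1}"* enter, as hypotheses; vector lines: the bonds starting at the two sites,
or the contour functionals of averaging endpoints — where (2.12) enters; output pairs: the block points) and any per-leg data `n`
dominating the external components contracted against the attachments (*"The external fields are estimated further by the Hölder
norms"*).  The vertex functions `ū_v = uOfKind` carry the couplings, `η`-powers, `η⁻¹` per difference quotient, cut-off, `Ã`-powers
and the localization weight of the vertex. [cite: Balaban1983Higgs3, (2.13) p.426] [cite: Balaban1983Higgs3, (2.14) p.427]
[cite: Balaban1983Higgs3, p.420] -/
theorem abs_graphAmp_le_positionForm (G : Graph nbar) (M : Model P N k) (dm2 : Fin G.nV → HiggsLattice.Site P 0 → ℝ)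
    (loc : Fin G.nV → Loc P k) (Po : OutPairing G)
    (Ks : SLine G → HiggsLattice.Site P 0 × Fin N → HiggsLattice.Site P 0 × Fin N → ℝ)
    (Kv : VLine G → HiggsLattice.PBond P 0 → HiggsLattice.PBond P 0 → ℝ)
    (Ko : Po.Line oRank → HiggsLattice.Site P k × Fin N → HiggsLattice.Site P k × Fin N → ℝ)
    (Φ : (ExtSLeg G → HiggsLattice.Site P 0 × Fin N) → ℝ) (A : (ExtVLeg G → HiggsLattice.PBond P 0) → ℝ)
    (Ψ : (Po.Ext → HiggsLattice.Site P k × Fin N) → ℝ)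
    (KS : SLine G → HiggsLattice.Site P 0 → HiggsLattice.Site P 0 → ℝ)
    (hKs : ∀ (l : SLine G) (x x' : HiggsLattice.Site P 0),
      ∑ p, ∑ p', attSK (G.kind l.1.1) l.1.2 x p * attSK (G.kind ((sPairing G).mate l.1).1) ((sPairing G).mate l.1).2 x' p' *
        |Ks l p p'| ≤ KS l x x')
    (KV : VLine G → HiggsLattice.Site P 0 → HiggsLattice.Site P 0 → ℝ)
    (hKv : ∀ (l : VLine G) (x x' : HiggsLattice.Site P 0),
      ∑ b, ∑ b', attVK M.ctr (G.kind l.1.1) x b * attVK M.ctr (G.kind ((vPairing G).mate l.1).1) x' b' * |Kv l b b'| ≤ KV l x x')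
    (KO : Po.Line oRank → HiggsLattice.Site P 0 → HiggsLattice.Site P 0 → ℝ)
    (hKo : ∀ (l : Po.Line oRank) (x x' : HiggsLattice.Site P 0),
      ∑ r, ∑ r', attO k x r * attO k x' r' * |Ko l r r'| ≤ KO l x x')
    (nS : ExtSLeg G → HiggsLattice.Site P 0 → ℝ)
    (hΦ : ∀ ξ : ExtSLeg G → HiggsLattice.Site P 0,
      ∑ γ : ExtSLeg G → HiggsLattice.Site P 0 × Fin N, (∏ e, attSK (G.kind e.1.1) e.1.2 (ξ e) (γ e)) * |Φ γ| ≤ ∏ e, nS e (ξ e))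
    (nV : ExtVLeg G → HiggsLattice.Site P 0 → ℝ)
    (hA : ∀ ξ : ExtVLeg G → HiggsLattice.Site P 0,
      ∑ ζ : ExtVLeg G → HiggsLattice.PBond P 0, (∏ e, attVK M.ctr (G.kind e.1.1) (ξ e) (ζ e)) * |A ζ| ≤ ∏ e, nV e (ξ e))
    (nO : Po.Ext → HiggsLattice.Site P 0 → ℝ)
    (hΨ : ∀ ξ : Po.Ext → HiggsLattice.Site P 0,
      ∑ ο : Po.Ext → HiggsLattice.Site P k × Fin N, (∏ e, attO k (ξ e) (ο e)) * |Ψ ο| ≤ ∏ e, nO e (ξ e)) :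
    |graphAmp G M dm2 loc Po Ks Kv Ko Φ A Ψ| ≤
      ∑ x : Fin G.nV → HiggsLattice.Site P 0, (∏ i, uOfKind M (dm2 i) (loc i) (G.kind i) (x i)) *
        (((∏ e : ExtSLeg G, nS e (x e.1.1)) * ∏ l : SLine G, KS l (x l.1.1) (x ((sPairing G).mate l.1).1)) *
          ((∏ e : ExtVLeg G, nV e (x e.1.1)) * ∏ l : VLine G, KV l (x l.1.1) (x ((vPairing G).mate l.1).1)) *
          ((∏ e : Po.Ext, nO e (x e.1.1)) * ∏ l : Po.Line oRank, KO l (x l.1.1) (x (Po.mate l.1).1))) := by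
  unfold graphAmp
  exact abs_amp_le_positionForm (rulesOf G M dm2 loc) basisE basisV basisE Po Ks Kv Ko Φ A Ψ
    (fun i => uOfKind M (dm2 i) (loc i) (G.kind i)) (fun i x => uOfKind_nonneg M (dm2 i) (loc i) (G.kind i) x)
    (fun ℓ x p => attSK (G.kind ℓ.1) ℓ.2 x p) (fun ℓ x p => attSK_nonneg (G.kind ℓ.1) ℓ.2 x p)
    (fun ℓ x b => attVK M.ctr (G.kind ℓ.1) x b) (fun ℓ x b => attVK_nonneg M.ctr (G.kind ℓ.1) x b)
    (fun _ x r => attO k x r) (fun _ x r => attO_nonneg k x r)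
    (fun i aS aV aO => abs_ruleOfKind_basis_le M (dm2 i) (loc i) (G.kind i) aS aV aO)
    KS hKs KV hKv KO hKo nS hΦ nV hA nO hΨ

/-! ## §5 Contracting the attachments: how the hypotheses of `abs_graphAmp_le_positionForm` are met (index bookkeeping) -/

omit [DecidableEq (HiggsLattice.PBond P 0)] in
/-- Contracting a function of a scalar-leg index against the attachment AT `x`: the sum over the `N` internal indices at the site
`x` (`Σ_p [p at x] f(p) = Σ_a f(x, a)`). [cite: Balaban1983Higgs3, (2.13) p.426] -/
theorem sum_attS_mul (x : HiggsLattice.Site P 0) (f : HiggsLattice.Site P 0 × Fin N → ℝ) :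
    ∑ p, attS x p * f p = ∑ a : Fin N, f (x, a) := by
  rw [Fintype.sum_prod_type]
  simp only [attS, ite_mul, one_mul, zero_mul]
  rw [Finset.sum_comm]
  simp

omit [DecidableEq (HiggsLattice.PBond P 0)] in
/-- Contracting against the attachment of a DIFFERENTIATED leg at `x`: the internal indices at `x` and at each forward neighbour
`x + ηe_μ`. [cite: Balaban1983Higgs3, (2.13) p.426] -/
theorem sum_attD_mul (x : HiggsLattice.Site P 0) (f : HiggsLattice.Site P 0 × Fin N → ℝ) :
    ∑ p, attD x p * f p = ∑ a : Fin N, f (x, a) + ∑ μ : Fin P.d, ∑ a : Fin N, f (x.shift μ, a) := by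
  have h : ∀ p : HiggsLattice.Site P 0 × Fin N,
      attD x p * f p = attS x p * f p + ∑ μ : Fin P.d, attS (x.shift μ) p * f p := by
    intro p
    unfold attD attS
    rw [add_mul, Finset.sum_mul]
  simp only [h]
  rw [Finset.sum_add_distrib, sum_attS_mul, Finset.sum_comm]
  simp only [sum_attS_mul]

omit [DecidableEq (HiggsLattice.PBond P 0)] in
/-- Contracting a function of a vector-leg index against the attachment at `x`: the sum over the `d` bonds starting at `x`.
[cite: Balaban1983Higgs3, (2.13) p.426] -/
theorem sum_attB_mul (x : HiggsLattice.Site P 0) (f : HiggsLattice.PBond P 0 → ℝ) :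
    ∑ b, attB x b * f b = ∑ μ : Fin P.d, f ⟨x, μ⟩ := by
  rw [sum_bond]
  simp only [attB, ite_mul, one_mul, zero_mul]
  rw [Finset.sum_comm]
  simp

omit [DecidableEq (HiggsLattice.PBond P 0)] in
/-- **A scalar line between two undifferentiated legs** contracted against the attachments of its endpoints at `x`, `x′`: the
double sum over the internal indices of the kernel's `N × N` block at `(x, x′)` — so a pointwise bound `|K((y,a),(y′,a′))| ≤ κ(y,y′)`
((2.10) for the entries of `G_k(Ω,B̃)`) gives the position kernel `N²κ(x,x′)`. [cite: Balaban1983Higgs3, (2.10) p.426]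
[cite: Balaban1983Higgs3, (2.13) p.426] -/
theorem sum2_attS_attS (x x' : HiggsLattice.Site P 0) (g : HiggsLattice.Site P 0 × Fin N → HiggsLattice.Site P 0 × Fin N → ℝ) :
    ∑ p, ∑ p', attS x p * attS x' p' * g p p' = ∑ a : Fin N, ∑ a' : Fin N, g (x, a) (x', a') := by
  have h : ∀ p, ∑ p', attS x p * attS x' p' * g p p' = attS x p * ∑ a' : Fin N, g p (x', a') := by
    intro p
    rw [← sum_attS_mul x' (g p), Finset.mul_sum]
    refine Finset.sum_congr rfl fun p' _ => ?_
    ring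
  simp only [h]
  rw [sum_attS_mul]

omit [DecidableEq (HiggsLattice.PBond P 0)] in
/-- **A scalar line whose first leg is differentiated** (the lower endpoint is the `D`-leg of a (1.8)/(1.9) vertex at `x`): the
`N × N` blocks at `(x, x′)` and at `(x + ηe_μ, x′)` — where *"for each differentiation, there is an additional factor (L^jη)^{−1}"* is
fed in by the instantiating seat. [cite: Balaban1983Higgs3, (2.10) p.426] [cite: Balaban1983Higgs3, (2.13) p.426] -/
theorem sum2_attD_attS (x x' : HiggsLattice.Site P 0) (g : HiggsLattice.Site P 0 × Fin N → HiggsLattice.Site P 0 × Fin N → ℝ) :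
    ∑ p, ∑ p', attD x p * attS x' p' * g p p' =
      ∑ a : Fin N, ∑ a' : Fin N, g (x, a) (x', a') + ∑ μ : Fin P.d, ∑ a : Fin N, ∑ a' : Fin N, g (x.shift μ, a) (x', a') := by
  have h : ∀ p, ∑ p', attD x p * attS x' p' * g p p' = attD x p * ∑ a' : Fin N, g p (x', a') := by
    intro p
    rw [← sum_attS_mul x' (g p), Finset.mul_sum]
    refine Finset.sum_congr rfl fun p' _ => ?_
    ring
  simp only [h]
  rw [sum_attD_mul]

omit [DecidableEq (HiggsLattice.PBond P 0)] in
/-- A scalar line whose SECOND (upper) leg is differentiated. [cite: Balaban1983Higgs3, (2.10) p.426] [cite: Balaban1983Higgs3, (2.13) p.426] -/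
theorem sum2_attS_attD (x x' : HiggsLattice.Site P 0) (g : HiggsLattice.Site P 0 × Fin N → HiggsLattice.Site P 0 × Fin N → ℝ) :
    ∑ p, ∑ p', attS x p * attD x' p' * g p p' =
      ∑ a : Fin N, (∑ a' : Fin N, g (x, a) (x', a') + ∑ μ : Fin P.d, ∑ a' : Fin N, g (x, a) (x'.shift μ, a')) := by
  have h : ∀ p, ∑ p', attS x p * attD x' p' * g p p' =
      attS x p * (∑ a' : Fin N, g p (x', a') + ∑ μ : Fin P.d, ∑ a' : Fin N, g p (x'.shift μ, a')) := by
    intro p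
    rw [← sum_attD_mul x' (g p), Finset.mul_sum]
    refine Finset.sum_congr rfl fun p' _ => ?_
    ring
  simp only [h]
  rw [sum_attS_mul]

omit [DecidableEq (HiggsLattice.PBond P 0)] in
/-- A scalar line between two differentiated legs (both endpoints are `D`-legs of bond vertices).
[cite: Balaban1983Higgs3, (2.11) p.426] [cite: Balaban1983Higgs3, (2.13) p.426] -/
theorem sum2_attD_attD (x x' : HiggsLattice.Site P 0) (g : HiggsLattice.Site P 0 × Fin N → HiggsLattice.Site P 0 × Fin N → ℝ) :
    ∑ p, ∑ p', attD x p * attD x' p' * g p p' =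
      ∑ a : Fin N, (∑ a' : Fin N, g (x, a) (x', a') + ∑ μ : Fin P.d, ∑ a' : Fin N, g (x, a) (x'.shift μ, a')) +
        ∑ ν : Fin P.d, ∑ a : Fin N,
          (∑ a' : Fin N, g (x.shift ν, a) (x', a') + ∑ μ : Fin P.d, ∑ a' : Fin N, g (x.shift ν, a) (x'.shift μ, a')) := by
  have h : ∀ p, ∑ p', attD x p * attD x' p' * g p p' =
      attD x p * (∑ a' : Fin N, g p (x', a') + ∑ μ : Fin P.d, ∑ a' : Fin N, g p (x'.shift μ, a')) := by
    intro p
    rw [← sum_attD_mul x' (g p), Finset.mul_sum]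
    refine Finset.sum_congr rfl fun p' _ => ?_
    ring
  simp only [h]
  rw [sum_attD_mul]

omit [DecidableEq (HiggsLattice.PBond P 0)] in
/-- **A vector line** contracted against the attachments of its two A′-legs at `x`, `x′`: the `d × d` block of the vector
covariance between the bonds starting at `x` and at `x′`. [cite: Balaban1983Higgs3, (2.10) p.426] [cite: Balaban1983Higgs3, (2.13) p.426] -/
theorem sum2_attB_attB (x x' : HiggsLattice.Site P 0) (g : HiggsLattice.PBond P 0 → HiggsLattice.PBond P 0 → ℝ) :
    ∑ b, ∑ b', attB x b * attB x' b' * g b b' = ∑ μ : Fin P.d, ∑ μ' : Fin P.d, g ⟨x, μ⟩ ⟨x', μ'⟩ := by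
  have h : ∀ b, ∑ b', attB x b * attB x' b' * g b b' = attB x b * ∑ μ' : Fin P.d, g b ⟨x', μ'⟩ := by
    intro b
    rw [← sum_attB_mul x' (g b), Finset.mul_sum]
    refine Finset.sum_congr rfl fun b' _ => ?_
    ring
  simp only [h]
  rw [sum_attB_mul]

omit [DecidableEq (HiggsLattice.PBond P 0)] in
/-- Contracting a function of an output index against the attachment of an output slot whose vertex sits at `x`: the internal
indices at the block point `x^{(k)}`. [cite: Balaban1983Higgs3, (1.18) p.415] -/
theorem sum_attO_mul (x : HiggsLattice.Site P 0) (f : HiggsLattice.Site P k × Fin N → ℝ) :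
    ∑ r, attO k x r * f r = ∑ a : Fin N, f (HiggsAveraging.blockIter k x, a) := by
  rw [Fintype.sum_prod_type]
  simp only [attO, ite_mul, one_mul, zero_mul]
  rw [Finset.sum_comm]
  simp

omit [DecidableEq (HiggsLattice.PBond P 0)] in
/-- **An output pair of (1.18)** contracted against the attachments of its two slots (vertices at `x`, `x′`): the `N × N` block of
the pairing kernel at the block points `(x^{(k)}, x′^{(k)})` (for FILE 2's `pairKernel κ`: `N|κ|[x^{(k)} = x′^{(k)}]`).
[cite: Balaban1983Higgs3, (1.18) p.415] [cite: Balaban1983Higgs3, (2.13) p.426] -/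
theorem sum2_attO_attO (x x' : HiggsLattice.Site P 0) (g : HiggsLattice.Site P k × Fin N → HiggsLattice.Site P k × Fin N → ℝ) :
    ∑ r, ∑ r', attO k x r * attO k x' r' * g r r' =
      ∑ a : Fin N, ∑ a' : Fin N, g (HiggsAveraging.blockIter k x, a) (HiggsAveraging.blockIter k x', a') := by
  have h : ∀ r, ∑ r', attO k x r * attO k x' r' * g r r' = attO k x r * ∑ a' : Fin N, g r (HiggsAveraging.blockIter k x', a') := by
    intro r
    rw [← sum_attO_mul x' (g r), Finset.mul_sum]
    refine Finset.sum_congr rfl fun r' _ => ?_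
    ring
  simp only [h]
  rw [sum_attO_mul]


/-! ### Sufficient conditions: position kernels from ENTRY BOUNDS of the line kernels (where (2.10)/(2.12)/(1.18) are fed in) -/

omit [DecidableEq (HiggsLattice.PBond P 0)] in
/-- `attS ≤ attD`: attaching at `x` only is dominated by attaching at `x` or a forward neighbour. [cite: Balaban1983Higgs3, (1.8) p.413] -/
theorem attS_le_attD (x : HiggsLattice.Site P 0) (p : HiggsLattice.Site P 0 × Fin N) : attS x p ≤ attD x p := by
  unfold attD
  exact le_add_of_nonneg_right (Finset.sum_nonneg fun μ _ => by split_ifs <;> norm_num)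

omit [DecidableEq (HiggsLattice.PBond P 0)] in
/-- Every φ′-leg attachment of every kind is dominated by `attD` (so ONE neighbourhood-summed kernel bound serves all scalar lines).
[cite: Balaban1983Higgs3, (1.8) p.413] -/
theorem attSK_le_attD (κ : VertexKind) (j : Fin κ.scalarLegs) (x : HiggsLattice.Site P 0) (p : HiggsLattice.Site P 0 × Fin N) :
    attSK κ j x p ≤ attD x p := by
  unfold attSK
  split_ifs
  · exact le_rfl
  · exact attS_le_attD x p

/-- The NEIGHBOURHOOD SUM of a site kernel at `(x, x′)`: over `x` and its `d` forward neighbours against `x′` and its `d` forward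
neighbours — the price of attaching differentiated legs to both endpoints of their bond (for a kernel with the decay of (2.10) this
costs the constant factor `(1+d)² e^{2δ₁η(L^jη)^{−1}} ≤ (1+d)²e^{2δ₁}`, the instantiating seat's arithmetic). [cite: Balaban1983Higgs3, (2.10) p.426]
[cite: Balaban1983Higgs3, (2.11) p.426] -/
def nbSum (κ : HiggsLattice.Site P 0 → HiggsLattice.Site P 0 → ℝ) (x x' : HiggsLattice.Site P 0) : ℝ :=
  (κ x x' + ∑ μ : Fin P.d, κ x (x'.shift μ)) + ∑ ν : Fin P.d, (κ (x.shift ν) x' + ∑ μ : Fin P.d, κ (x.shift ν) (x'.shift μ))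

omit [DecidableEq (HiggsLattice.PBond P 0)] in
/-- kernel: an `N × N` block of entries bounded by a site kernel sums to at most `N²` times it. [folklore] -/
private theorem sum2_fin_le {g : Fin N → Fin N → ℝ} {c : ℝ} (h : ∀ a a', g a a' ≤ c) : ∑ a, ∑ a', g a a' ≤ (N : ℝ) ^ 2 * c := by
  calc ∑ a, ∑ a', g a a' ≤ ∑ _a : Fin N, ∑ _a' : Fin N, c := Finset.sum_le_sum fun a _ => Finset.sum_le_sum fun a' _ => h a a'
    _ = (N : ℝ) ^ 2 * c := by simp [Finset.sum_const, Finset.card_univ, Fintype.card_fin]; ring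

omit [DecidableEq (HiggsLattice.PBond P 0)] in
/-- **SCALAR LINES from an entry bound**: if `|K((y,a),(y′,a′))| ≤ κ(y,y′)` with `κ ≥ 0` (the entries of `G_k(Ω,B̃)` or of a (2.6) piece,
bounded by (2.10) — and by (2.10)·(L^jη)^{−1} per differentiation after the difference quotient is taken inside `κ` by the caller),
then for ANY kinds of its two endpoints the contracted line is dominated by `N² · nbSum κ (x, x′)` — a valid `KS` for
`abs_graphAmp_le_positionForm`. [cite: Balaban1983Higgs3, (2.10) p.426] [cite: Balaban1983Higgs3, (2.13) p.426] -/
theorem sum2_attSK_le_of_entry_bound (κ₁ κ₂ : VertexKind) (j₁ : Fin κ₁.scalarLegs) (j₂ : Fin κ₂.scalarLegs)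
    (K : HiggsLattice.Site P 0 × Fin N → HiggsLattice.Site P 0 × Fin N → ℝ) (κ : HiggsLattice.Site P 0 → HiggsLattice.Site P 0 → ℝ)
    (hK : ∀ p p', |K p p'| ≤ κ p.1 p'.1) (x x' : HiggsLattice.Site P 0) :
    ∑ p, ∑ p', attSK κ₁ j₁ x p * attSK κ₂ j₂ x' p' * |K p p'| ≤ (N : ℝ) ^ 2 * nbSum κ x x' := by
  calc ∑ p, ∑ p', attSK κ₁ j₁ x p * attSK κ₂ j₂ x' p' * |K p p'|
      ≤ ∑ p, ∑ p', attD x p * attD x' p' * |K p p'| :=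
        Finset.sum_le_sum fun p _ => Finset.sum_le_sum fun p' _ => mul_le_mul_of_nonneg_right
          (mul_le_mul (attSK_le_attD κ₁ j₁ x p) (attSK_le_attD κ₂ j₂ x' p') (attSK_nonneg _ _ _ _) (attD_nonneg _ _)) (abs_nonneg _)
    _ = ∑ a : Fin N, (∑ a' : Fin N, |K (x, a) (x', a')| + ∑ μ : Fin P.d, ∑ a' : Fin N, |K (x, a) (x'.shift μ, a')|) +
        ∑ ν : Fin P.d, ∑ a : Fin N,
          (∑ a' : Fin N, |K (x.shift ν, a) (x', a')| + ∑ μ : Fin P.d, ∑ a' : Fin N, |K (x.shift ν, a) (x'.shift μ, a')|) :=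
        sum2_attD_attD x x' fun p p' => |K p p'|
    _ ≤ (N : ℝ) ^ 2 * nbSum κ x x' := by
        unfold nbSum
        have h1 : ∑ a : Fin N, ∑ a' : Fin N, |K (x, a) (x', a')| ≤ (N : ℝ) ^ 2 * κ x x' := sum2_fin_le fun a a' => hK _ _
        have h2 : ∑ a : Fin N, ∑ μ : Fin P.d, ∑ a' : Fin N, |K (x, a) (x'.shift μ, a')| ≤ (N : ℝ) ^ 2 * ∑ μ, κ x (x'.shift μ) := by
          rw [Finset.sum_comm, Finset.mul_sum]
          exact Finset.sum_le_sum fun μ _ => sum2_fin_le fun a a' => hK _ _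
        have h3 : ∀ ν : Fin P.d, ∑ a : Fin N, (∑ a' : Fin N, |K (x.shift ν, a) (x', a')| +
            ∑ μ : Fin P.d, ∑ a' : Fin N, |K (x.shift ν, a) (x'.shift μ, a')|) ≤
            (N : ℝ) ^ 2 * (κ (x.shift ν) x' + ∑ μ, κ (x.shift ν) (x'.shift μ)) := by
          intro ν
          rw [Finset.sum_add_distrib, mul_add]
          refine add_le_add (sum2_fin_le fun a a' => hK _ _) ?_
          rw [Finset.sum_comm, Finset.mul_sum]
          exact Finset.sum_le_sum fun μ _ => sum2_fin_le fun a a' => hK _ _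
        have eR : (N : ℝ) ^ 2 * ((κ x x' + ∑ μ, κ x (x'.shift μ)) + ∑ ν, (κ (x.shift ν) x' + ∑ μ, κ (x.shift ν) (x'.shift μ))) =
            (N : ℝ) ^ 2 * κ x x' + (N : ℝ) ^ 2 * ∑ μ, κ x (x'.shift μ) +
              ∑ ν, (N : ℝ) ^ 2 * (κ (x.shift ν) x' + ∑ μ, κ (x.shift ν) (x'.shift μ)) := by
          rw [mul_add, mul_add]
          congr 1
          rw [Finset.mul_sum]
        have eL : ∑ a : Fin N, (∑ a' : Fin N, |K (x, a) (x', a')| + ∑ μ : Fin P.d, ∑ a' : Fin N, |K (x, a) (x'.shift μ, a')|) =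
            (∑ a : Fin N, ∑ a' : Fin N, |K (x, a) (x', a')|) + ∑ a : Fin N, ∑ μ : Fin P.d, ∑ a' : Fin N, |K (x, a) (x'.shift μ, a')| :=
          Finset.sum_add_distrib
        rw [eR, eL]
        exact add_le_add (add_le_add h1 h2) (Finset.sum_le_sum fun ν _ => h3 ν)

omit [DecidableEq (HiggsLattice.PBond P 0)] in
/-- **VECTOR LINES between bond vertices from an entry bound**: if `|K_v(b,b′)| ≤ κ(b₋,b′₋)` (the vector covariance by (2.10)), the
line contracted against `attB` at both ends is dominated by `d² · κ(x,x′)`. [cite: Balaban1983Higgs3, (2.10) p.426]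
[cite: Balaban1983Higgs3, (2.13) p.426] -/
theorem sum2_attB_le_of_entry_bound (K : HiggsLattice.PBond P 0 → HiggsLattice.PBond P 0 → ℝ)
    (κ : HiggsLattice.Site P 0 → HiggsLattice.Site P 0 → ℝ) (hK : ∀ b b', |K b b'| ≤ κ b.src b'.src) (x x' : HiggsLattice.Site P 0) :
    ∑ b, ∑ b', attB x b * attB x' b' * |K b b'| ≤ (P.d : ℝ) ^ 2 * κ x x' := by
  rw [sum2_attB_attB]
  calc ∑ μ : Fin P.d, ∑ μ' : Fin P.d, |K ⟨x, μ⟩ ⟨x', μ'⟩| ≤ ∑ _μ : Fin P.d, ∑ _μ' : Fin P.d, κ x x' :=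
        Finset.sum_le_sum fun μ _ => Finset.sum_le_sum fun μ' _ => hK _ _
    _ = (P.d : ℝ) ^ 2 * κ x x' := by simp [Finset.sum_const, Finset.card_univ, Fintype.card_fin]; ring

omit [DecidableEq (HiggsLattice.PBond P 0)] in
/-- **OUTPUT PAIRS from an entry bound**: if `|K_o(r,r′)| ≤ κ(r₁,r′₁)` on the block points (FILE 2's `pairKernel`: `|κ|[y = y′]`), the
pair contracted against `attO` at both ends is dominated by `N² · κ(x^{(k)}, x′^{(k)})`. [cite: Balaban1983Higgs3, (1.18) p.415]
[cite: Balaban1983Higgs3, (2.13) p.426] -/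
theorem sum2_attO_le_of_entry_bound (K : HiggsLattice.Site P k × Fin N → HiggsLattice.Site P k × Fin N → ℝ)
    (κ : HiggsLattice.Site P k → HiggsLattice.Site P k → ℝ) (hK : ∀ r r', |K r r'| ≤ κ r.1 r'.1) (x x' : HiggsLattice.Site P 0) :
    ∑ r, ∑ r', attO k x r * attO k x' r' * |K r r'| ≤
      (N : ℝ) ^ 2 * κ (HiggsAveraging.blockIter k x) (HiggsAveraging.blockIter k x') := by
  rw [sum2_attO_attO]
  exact sum2_fin_le fun a a' => hK _ _

omit [DecidableEq (HiggsLattice.PBond P 0)] in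
/-- **PRODUCT external scalar fields** (FILE 2's `extS`) contracted against any attachment weights of the external φ′-legs: the
product over the external legs of the contracted absolute components — *"The external fields are estimated further by the Hölder
norms"* (with `attS`: `Π_e Σ_a |φ_e(x_e)_a|`, by `sum_attS_mul`). [cite: Balaban1983Higgs3, p.426] [cite: Balaban1983Higgs3, p.419] -/
theorem sum_att_abs_extS {G : Graph nbar} (ρ : ExtSLeg G → HiggsLattice.Site P 0 × Fin N → ℝ)
    (φ : ExtSLeg G → HiggsLattice.ScalarField P 0 N) :
    ∑ γ : ExtSLeg G → HiggsLattice.Site P 0 × Fin N, (∏ e, ρ e (γ e)) * |extS G φ γ| =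
      ∏ e : ExtSLeg G, ∑ p : HiggsLattice.Site P 0 × Fin N, ρ e p * |φ e p.1 p.2| := by
  classical
  rw [Fintype.prod_sum (fun (e : ExtSLeg G) (p : HiggsLattice.Site P 0 × Fin N) => ρ e p * |φ e p.1 p.2|)]
  refine Finset.sum_congr rfl fun γ _ => ?_
  unfold extS
  rw [Finset.abs_prod, ← Finset.prod_mul_distrib]

omit [DecidableEq (HiggsLattice.PBond P 0)] in
/-- **PRODUCT external vector fields** (FILE 1's `prodExtV`) contracted against any attachment weights of the external A′-legs.
[cite: Balaban1983Higgs3, p.426] [cite: Balaban1983Higgs3, p.419] -/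
theorem sum_att_abs_prodExtV {G : Graph nbar} (ρ : ExtVLeg G → HiggsLattice.PBond P 0 → ℝ)
    (A : ExtVLeg G → HiggsLattice.VecField P 0) :
    ∑ ζ : ExtVLeg G → HiggsLattice.PBond P 0, (∏ e, ρ e (ζ e)) * |prodExtV A ζ| =
      ∏ e : ExtVLeg G, ∑ b : HiggsLattice.PBond P 0, ρ e b * |A e b| := by
  classical
  rw [Fintype.prod_sum (fun (e : ExtVLeg G) (b : HiggsLattice.PBond P 0) => ρ e b * |A e b|)]
  refine Finset.sum_congr rfl fun ζ _ => ?_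
  unfold prodExtV
  rw [Finset.abs_prod, ← Finset.prod_mul_distrib]

end Concrete


/-! ## §6 One line type: the position form in the shape of (2.13)/(2.14) (`Π_v U_v(x_v) · Π_{l} K̄_l(x_{v_l}, x_{v′_l})`) -/

section Lines

variable {nbar : ℕ} {G : Graph nbar} {X : Type*}

/-- ALL INTERNAL LINES of a graph with its (1.18) output pairing, as one finite type: scalar lines, vector lines, output pairs
(p. 426: *"For each line we extract …"* — print's lines `l ∈ G` of (2.14)). [cite: Balaban1983Higgs3, (2.14) p.427] -/
abbrev Lines (G : Graph nbar) (Po : OutPairing G) : Type := SLine G ⊕ (VLine G ⊕ Po.Line oRank)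

variable (Po : OutPairing G)

/-- The vertex of the LOWER endpoint of a line (print's `v_l`). [cite: Balaban1983Higgs3, (2.14) p.427] -/
def lineSrc : Lines G Po → Fin G.nV
  | Sum.inl l => l.1.1
  | Sum.inr (Sum.inl l) => l.1.1
  | Sum.inr (Sum.inr l) => l.1.1

/-- The vertex of the UPPER endpoint of a line (print's `v′_l`). [cite: Balaban1983Higgs3, (2.14) p.427] -/
def lineTgt : Lines G Po → Fin G.nV
  | Sum.inl l => ((sPairing G).mate l.1).1
  | Sum.inr (Sum.inl l) => ((vPairing G).mate l.1).1
  | Sum.inr (Sum.inr l) => (Po.mate l.1).1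

/-- One position kernel per line, assembled from the three species. [cite: Balaban1983Higgs3, (2.14) p.427] -/
def lineKer (KS : SLine G → X → X → ℝ) (KV : VLine G → X → X → ℝ) (KO : Po.Line oRank → X → X → ℝ) : Lines G Po → X → X → ℝ
  | Sum.inl l => KS l
  | Sum.inr (Sum.inl l) => KV l
  | Sum.inr (Sum.inr l) => KO l

/-- The external data AT A VERTEX: the product of the per-leg data of the external φ′-legs, external A′-legs and unpaired outputs
sitting at the vertex `i`, read at its position (p. 426: the external fields *"estimated further by the Hölder norms"* localized at
`v` — p19's `N^Φ_v`, `N^A_v`). [cite: Balaban1983Higgs3, (2.13) p.426] -/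
def extAt (nS : ExtSLeg G → X → ℝ) (nV : ExtVLeg G → X → ℝ) (nO : Po.Ext → X → ℝ) (i : Fin G.nV) (y : X) : ℝ :=
  (∏ e ∈ Finset.univ.filter (fun e : ExtSLeg G => e.1.1 = i), nS e y) *
    ((∏ e ∈ Finset.univ.filter (fun e : ExtVLeg G => e.1.1 = i), nV e y) *
      ∏ e ∈ Finset.univ.filter (fun e : Po.Ext => e.1.1 = i), nO e y)

/-- kernel: a product over external legs read at the position of their vertex, regrouped vertex by vertex. [folklore] -/
private theorem prod_ext_fiber {E : Type*} [Fintype E] (v : E → Fin G.nV) (n : E → X → ℝ) (x : Fin G.nV → X) :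
    ∏ e, n e (x (v e)) = ∏ i, ∏ e ∈ Finset.univ.filter (fun e => v e = i), n e (x i) := by
  rw [← Finset.prod_fiberwise Finset.univ v fun e => n e (x (v e))]
  refine Finset.prod_congr rfl fun i _ => Finset.prod_congr rfl fun e he => ?_
  rw [(Finset.mem_filter.1 he).2]

/-- **THE POSITION FORM IN THE SHAPE OF (2.13)/(2.14)**: the bound of `abs_amp_le_positionForm` ∕ `abs_graphAmp_le_positionForm` at a
position tuple `x`, regrouped as `Π_v U_v(x_v) · Π_{l ∈ Lines} K̄_l(x_{v_l}, x_{v′_l})` with `U_v = ū_v · (external data at v)` — ONE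
vertex function per vertex and ONE kernel per line between the positions of its endpoints, the shape of p19's
`B3Ineq213Amplitude.Amp.E` (there: positions in a box of `ηℤ^d_{≥0}`, here: any position type). [cite: Balaban1983Higgs3, (2.13) p.426]
[cite: Balaban1983Higgs3, (2.14) p.427] -/
theorem positionForm_eq_lines (u : Fin G.nV → X → ℝ) (nS : ExtSLeg G → X → ℝ) (nV : ExtVLeg G → X → ℝ) (nO : Po.Ext → X → ℝ)
    (KS : SLine G → X → X → ℝ) (KV : VLine G → X → X → ℝ) (KO : Po.Line oRank → X → X → ℝ) (x : Fin G.nV → X) :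
    (∏ i, u i (x i)) *
        (((∏ e : ExtSLeg G, nS e (x e.1.1)) * ∏ l : SLine G, KS l (x l.1.1) (x ((sPairing G).mate l.1).1)) *
          ((∏ e : ExtVLeg G, nV e (x e.1.1)) * ∏ l : VLine G, KV l (x l.1.1) (x ((vPairing G).mate l.1).1)) *
          ((∏ e : Po.Ext, nO e (x e.1.1)) * ∏ l : Po.Line oRank, KO l (x l.1.1) (x (Po.mate l.1).1))) =
      (∏ i, u i (x i) * extAt Po nS nV nO i (x i)) *
        ∏ l : Lines G Po, lineKer Po KS KV KO l (x (lineSrc Po l)) (x (lineTgt Po l)) := by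
  rw [Fintype.prod_sum_type, Fintype.prod_sum_type, Finset.prod_mul_distrib,
    prod_ext_fiber (fun e : ExtSLeg G => e.1.1) nS x, prod_ext_fiber (fun e : ExtVLeg G => e.1.1) nV x,
    prod_ext_fiber (fun e : Po.Ext => e.1.1) nO x]
  unfold extAt
  rw [Finset.prod_mul_distrib, Finset.prod_mul_distrib]
  simp only [lineKer, lineSrc, lineTgt]
  ring

end Lines

section LinesConcrete

variable {P : HiggsLattice.Params} {N k nbar : ℕ} [DecidableEq (HiggsLattice.PBond P 0)]

/-- **`|E(G, {□(v)}, Φ_ext, A_ext)| ≤ Σ_{x} Π_v U_v(x_v) · Π_{l ∈ G} K̄_l(x_{v_l}, x_{v′_l})`** — `abs_graphAmp_le_positionForm` in the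
shape of (2.13)/(2.14): one vertex function `U_v = uOfKind_v · extAt_v` per vertex, one position kernel per line of `Lines G Po`.
[cite: Balaban1983Higgs3, (2.13) p.426] [cite: Balaban1983Higgs3, (2.14) p.427] -/
theorem abs_graphAmp_le_lines (G : Graph nbar) (M : Model P N k) (dm2 : Fin G.nV → HiggsLattice.Site P 0 → ℝ)
    (loc : Fin G.nV → Loc P k) (Po : OutPairing G)
    (Ks : SLine G → HiggsLattice.Site P 0 × Fin N → HiggsLattice.Site P 0 × Fin N → ℝ)
    (Kv : VLine G → HiggsLattice.PBond P 0 → HiggsLattice.PBond P 0 → ℝ)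
    (Ko : Po.Line oRank → HiggsLattice.Site P k × Fin N → HiggsLattice.Site P k × Fin N → ℝ)
    (Φ : (ExtSLeg G → HiggsLattice.Site P 0 × Fin N) → ℝ) (A : (ExtVLeg G → HiggsLattice.PBond P 0) → ℝ)
    (Ψ : (Po.Ext → HiggsLattice.Site P k × Fin N) → ℝ)
    (KS : SLine G → HiggsLattice.Site P 0 → HiggsLattice.Site P 0 → ℝ)
    (hKs : ∀ (l : SLine G) (x x' : HiggsLattice.Site P 0),
      ∑ p, ∑ p', attSK (G.kind l.1.1) l.1.2 x p * attSK (G.kind ((sPairing G).mate l.1).1) ((sPairing G).mate l.1).2 x' p' *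
        |Ks l p p'| ≤ KS l x x')
    (KV : VLine G → HiggsLattice.Site P 0 → HiggsLattice.Site P 0 → ℝ)
    (hKv : ∀ (l : VLine G) (x x' : HiggsLattice.Site P 0),
      ∑ b, ∑ b', attVK M.ctr (G.kind l.1.1) x b * attVK M.ctr (G.kind ((vPairing G).mate l.1).1) x' b' * |Kv l b b'| ≤ KV l x x')
    (KO : Po.Line oRank → HiggsLattice.Site P 0 → HiggsLattice.Site P 0 → ℝ)
    (hKo : ∀ (l : Po.Line oRank) (x x' : HiggsLattice.Site P 0),
      ∑ r, ∑ r', attO k x r * attO k x' r' * |Ko l r r'| ≤ KO l x x')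
    (nS : ExtSLeg G → HiggsLattice.Site P 0 → ℝ)
    (hΦ : ∀ ξ : ExtSLeg G → HiggsLattice.Site P 0,
      ∑ γ : ExtSLeg G → HiggsLattice.Site P 0 × Fin N, (∏ e, attSK (G.kind e.1.1) e.1.2 (ξ e) (γ e)) * |Φ γ| ≤ ∏ e, nS e (ξ e))
    (nV : ExtVLeg G → HiggsLattice.Site P 0 → ℝ)
    (hA : ∀ ξ : ExtVLeg G → HiggsLattice.Site P 0,
      ∑ ζ : ExtVLeg G → HiggsLattice.PBond P 0, (∏ e, attVK M.ctr (G.kind e.1.1) (ξ e) (ζ e)) * |A ζ| ≤ ∏ e, nV e (ξ e))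
    (nO : Po.Ext → HiggsLattice.Site P 0 → ℝ)
    (hΨ : ∀ ξ : Po.Ext → HiggsLattice.Site P 0,
      ∑ ο : Po.Ext → HiggsLattice.Site P k × Fin N, (∏ e, attO k (ξ e) (ο e)) * |Ψ ο| ≤ ∏ e, nO e (ξ e)) :
    |graphAmp G M dm2 loc Po Ks Kv Ko Φ A Ψ| ≤
      ∑ x : Fin G.nV → HiggsLattice.Site P 0,
        (∏ i, uOfKind M (dm2 i) (loc i) (G.kind i) (x i) * extAt Po nS nV nO i (x i)) *
          ∏ l : Lines G Po, lineKer Po KS KV KO l (x (lineSrc Po l)) (x (lineTgt Po l)) := by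
  refine (abs_graphAmp_le_positionForm G M dm2 loc Po Ks Kv Ko Φ A Ψ KS hKs KV hKv KO hKo nS hΦ nV hA nO hΨ).trans
    (le_of_eq (Finset.sum_congr rfl fun x _ => ?_))
  exact positionForm_eq_lines Po (fun i => uOfKind M (dm2 i) (loc i) (G.kind i)) nS nV nO KS KV KO x

end LinesConcrete

/-! ## §7 Into p19's `B3Ineq213Amplitude.Amp`: the chart of the unit cubes and the packaging (the analytic inputs as hypotheses) -/

/-! ### §7.1 The chart: a position sum over the torus, supported in charted cubes, is p19's sum over box positions -/

section ToAmp213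

open Literature.MathematicalPhysics.QuantumFieldTheory.Balaban1983to89.B3Ineq213
open Literature.MathematicalPhysics.QuantumFieldTheory.Balaban1983to89.B3Ineq215 (Cube)

section Chart

variable {V : Type} [Fintype V] [DecidableEq V] {S : Type*} [Fintype S] [DecidableEq S] {Λ : Type*} [Fintype Λ] {d : ℕ}

/-- The chart of position TUPLES induced by per-vertex charts `c_v : ηℤ^d_{≥0} → (sites)`: `ξ ↦ (v ↦ c_v(ξ_v))`.
[cite: Balaban1983Higgs3, (2.13) p.426] -/
def chartTuple (c : V → (Fin d → ℕ) → S) (ξ : V → Fin d → ℕ) : V → S := fun v => c v (ξ v)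

omit [Fintype S] [DecidableEq S] in
/-- The tuple chart is injective on the box positions when every vertex chart is injective on its cube.
[cite: Balaban1983Higgs3, (2.13) p.426] -/
theorem chartTuple_injOn (L k : ℕ) (box : V → Fin d → ℕ) (c : V → (Fin d → ℕ) → S)
    (hinj : ∀ v, Set.InjOn (c v) ↑(pts L (⟨k, box v⟩ : Cube d))) :
    Set.InjOn (chartTuple c) ↑(boxPositions L k box) := by
  intro ξ hξ ξ' hξ' h
  funext v
  exact hinj v (mem_boxPositions.1 (Finset.mem_coe.1 hξ) v) (mem_boxPositions.1 (Finset.mem_coe.1 hξ') v) (congrFun h v)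

/-- **THE CHART LEMMA**: if every vertex function `U_v` VANISHES off the image of the lattice points of its unit cube `□(v)` under an
injective chart `c_v` (the vertex is *"localized in □(v)"*, p. 420), then the sum over ALL position tuples of the torus of
`Π_v U_v(x_v) · Π_l K_l(x_{v_l}, x_{v′_l})` is the sum over p19's `boxPositions` of the charted summand — the passage from the torus
positions of FILE 12 to the box positions `x_v ∈ □(v) ∩ T_η` of (2.13)/(1.33). [cite: Balaban1983Higgs3, (2.13) p.426]
[cite: Balaban1983Higgs3, (1.33) p.420] -/
theorem sum_positions_eq_boxSum (L k : ℕ) (box : V → Fin d → ℕ) (c : V → (Fin d → ℕ) → S)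
    (hinj : ∀ v, Set.InjOn (c v) ↑(pts L (⟨k, box v⟩ : Cube d))) (U : V → S → ℝ)
    (hsupp : ∀ v y, U v y ≠ 0 → ∃ ξ ∈ pts L (⟨k, box v⟩ : Cube d), c v ξ = y) (src tgt : Λ → V) (K : Λ → S → S → ℝ) :
    ∑ x : V → S, (∏ v, U v (x v)) * ∏ l, K l (x (src l)) (x (tgt l)) =
      ∑ ξ ∈ boxPositions L k box, (∏ v, U v (c v (ξ v))) * ∏ l, K l (c (src l) (ξ (src l))) (c (tgt l) (ξ (tgt l))) := by
  classical
  have himage : ∑ ξ ∈ boxPositions L k box, (∏ v, U v (c v (ξ v))) * ∏ l, K l (c (src l) (ξ (src l))) (c (tgt l) (ξ (tgt l))) =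
      ∑ x ∈ (boxPositions L k box).image (chartTuple c), (∏ v, U v (x v)) * ∏ l, K l (x (src l)) (x (tgt l)) := by
    rw [Finset.sum_image (chartTuple_injOn L k box c hinj)]
    rfl
  rw [himage]
  symm
  refine Finset.sum_subset (Finset.subset_univ _) fun x _ hx => ?_
  -- off the image some vertex function vanishes
  have hzero : ∃ v, U v (x v) = 0 := by
    by_contra hne
    push Not at hne
    apply hx
    choose ξ hξ hcξ using fun v => hsupp v (x v) (hne v)
    refine Finset.mem_image.2 ⟨ξ, mem_boxPositions.2 hξ, ?_⟩
    funext v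
    exact hcξ v
  obtain ⟨v, hv⟩ := hzero
  rw [Finset.prod_eq_zero (Finset.mem_univ v) hv, zero_mul]

end Chart

/-! ### §7.2 Packaging a position-form amplitude as p19's `Amp` (the analytic bounds `u_le`, `K_le`, connectivity as hypotheses) -/

section Packaging

variable {V : Type} [Fintype V] [DecidableEq V] {m : ℕ} {S : Type*}

/-- **A localized lattice graph amplitude of p19's class from position-form data**: the generalized graph `M` of (2.14), the
number `k` of steps (`η = L^{−k}`), the unit cubes `□(v)` (`box`), per-vertex charts `c_v` of the `ηℤ^d_{≥0}` positions into the
position type `S` of FILE 12 (the sites of `T_η`), the vertex functions `U_v` (normalized: `u_v = η^{−d}U_v∘c_v`, so that p19's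
`η^d u_v(x_v)` IS `U_v(c_v x_v)`), one kernel per line and scale index read through the charts of the line's endpoints AT THE POINTS
OF THEIR CUBES (zero elsewhere: p19's `E_j` only visits `x_v ∈ □(v)`), and the ANALYTIC INPUTS of the first estimate as hypotheses:
the constants `C_l` and line bounds (2.10)–(2.12) on the points of the cubes (`K_le`), the vertex bounds *"external fields by their
norms, |q| ≦ 1, |R_{n̄+1}| ≦ 1"* with the couplings and `η`-powers (`u_le`), and *"Let G be a connected graph"* (`conn`).
[cite: Balaban1983Higgs3, (2.13) p.426] [cite: Balaban1983Higgs3, Prop. 2.1 p.424] -/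
def ampOf (M : B3Ineq215.Model V m) (k : ℕ) (box : V → Fin M.d → ℕ) (c : V → (Fin M.d → ℕ) → S) (U : V → S → ℝ)
    (K : Fin m → ℕ → S → S → ℝ) (C : Fin m → ℝ) (eRun lamRun : ℝ) (dv ds : V → ℕ) (NPhi NA : V → ℝ)
    (C_nonneg : ∀ l, 0 ≤ C l) (eRun_nonneg : 0 ≤ eRun) (lamRun_nonneg : 0 ≤ lamRun) (NPhi_nonneg : ∀ v, 0 ≤ NPhi v)
    (NA_nonneg : ∀ v, 0 ≤ NA v) (e_nonneg : ∀ v, 0 ≤ M.e v) (conn : LinesConnect M.src M.tgt)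
    (u_le : ∀ v ξ, |((M.L : ℝ) ^ k) ^ M.d * U v (c v ξ)| ≤
      eRun ^ dv v * lamRun ^ ds v * NPhi v * NA v * (((M.L : ℝ) ^ k)⁻¹) ^ M.e v)
    (K_le : ∀ l t, t < k → ∀ ξ ∈ pts M.L (⟨k, box (M.src l)⟩ : Cube M.d), ∀ ξ' ∈ pts M.L (⟨k, box (M.tgt l)⟩ : Cube M.d),
      |K l t (c (M.src l) ξ) (c (M.tgt l) ξ')| ≤ C l * M.sc k t ^ M.a l *
        Real.exp (-(2 * M.δ₀ / M.sc k t * (((M.L : ℝ) ^ k)⁻¹ * (supDist ξ ξ' : ℝ))))) : Amp M where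
  k := k
  box := box
  u := fun v ξ => ((M.L : ℝ) ^ k) ^ M.d * U v (c v ξ)
  K := fun l t ξ ξ' =>
    if ξ ∈ pts M.L (⟨k, box (M.src l)⟩ : Cube M.d) ∧ ξ' ∈ pts M.L (⟨k, box (M.tgt l)⟩ : Cube M.d) then
      K l t (c (M.src l) ξ) (c (M.tgt l) ξ') else 0
  C := C
  eRun := eRun
  lamRun := lamRun
  dv := dv
  ds := ds
  NPhi := NPhi
  NA := NA
  C_nonneg := C_nonneg
  eRun_nonneg := eRun_nonneg
  lamRun_nonneg := lamRun_nonneg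
  NPhi_nonneg := NPhi_nonneg
  NA_nonneg := NA_nonneg
  e_nonneg := e_nonneg
  conn := conn
  u_le := u_le
  K_le := fun l t ht ξ ξ' => by
    by_cases h : ξ ∈ pts M.L (⟨k, box (M.src l)⟩ : Cube M.d) ∧ ξ' ∈ pts M.L (⟨k, box (M.tgt l)⟩ : Cube M.d)
    · rw [if_pos h]; exact K_le l t ht ξ h.1 ξ' h.2
    · rw [if_neg h, abs_zero]
      exact mul_nonneg (mul_nonneg (C_nonneg l) (Real.rpow_nonneg (M.sc_pos k t).le _)) (Real.exp_pos _).le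

/-- **`E_j` of the packaged amplitude is the charted position form**: p19's
`E_j = Σ_{x_v ∈ □(v)} Π_v η^d u_v(x_v) · Π_l K_l(j_l; x_{v_l}, x_{v′_l})` equals `Σ_{ξ ∈ boxPositions} Π_v U_v(c_v ξ_v) · Π_l K_l(j_l; c ξ_{v_l}, c ξ_{v′_l})`
(`η^d · η^{−d}U = U`). [cite: Balaban1983Higgs3, (2.13) p.426] -/
theorem E_ampOf (M : B3Ineq215.Model V m) (k : ℕ) (box : V → Fin M.d → ℕ) (c : V → (Fin M.d → ℕ) → S) (U : V → S → ℝ)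
    (K : Fin m → ℕ → S → S → ℝ) (C : Fin m → ℝ) (eRun lamRun : ℝ) (dv ds : V → ℕ) (NPhi NA : V → ℝ)
    (C_nonneg : ∀ l, 0 ≤ C l) (eRun_nonneg : 0 ≤ eRun) (lamRun_nonneg : 0 ≤ lamRun) (NPhi_nonneg : ∀ v, 0 ≤ NPhi v)
    (NA_nonneg : ∀ v, 0 ≤ NA v) (e_nonneg : ∀ v, 0 ≤ M.e v) (conn : LinesConnect M.src M.tgt)
    (u_le : ∀ v ξ, |((M.L : ℝ) ^ k) ^ M.d * U v (c v ξ)| ≤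
      eRun ^ dv v * lamRun ^ ds v * NPhi v * NA v * (((M.L : ℝ) ^ k)⁻¹) ^ M.e v)
    (K_le : ∀ l t, t < k → ∀ ξ ∈ pts M.L (⟨k, box (M.src l)⟩ : Cube M.d), ∀ ξ' ∈ pts M.L (⟨k, box (M.tgt l)⟩ : Cube M.d),
      |K l t (c (M.src l) ξ) (c (M.tgt l) ξ')| ≤ C l * M.sc k t ^ M.a l *
        Real.exp (-(2 * M.δ₀ / M.sc k t * (((M.L : ℝ) ^ k)⁻¹ * (supDist ξ ξ' : ℝ))))) (j : Fin m → ℕ) :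
    (ampOf M k box c U K C eRun lamRun dv ds NPhi NA C_nonneg eRun_nonneg lamRun_nonneg NPhi_nonneg NA_nonneg e_nonneg conn
        u_le K_le).E j =
      ∑ ξ ∈ boxPositions M.L k box,
        (∏ v, U v (c v (ξ v))) * ∏ l, K l (j l) (c (M.src l) (ξ (M.src l))) (c (M.tgt l) (ξ (M.tgt l))) := by
  unfold Amp.E Amp.η
  simp only [ampOf]
  refine Finset.sum_congr rfl fun ξ hξ => ?_
  have hξ' := mem_boxPositions.1 hξ
  congr 1
  · refine Finset.prod_congr rfl fun v _ => ?_
    have hL : ((M.L : ℝ) ^ k) ^ M.d ≠ 0 := pow_ne_zero _ (pow_ne_zero _ M.L_pos_real.ne')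
    rw [← mul_assoc, inv_pow, inv_mul_cancel₀ hL, one_mul]
  · exact Finset.prod_congr rfl fun l _ => if_pos ⟨hξ' (M.src l), hξ' (M.tgt l)⟩

end Packaging

/-! ### §7.3 `|E(G, {□(v)}, Φ_ext, A_ext)| ≤ E_j` of the packaged amplitude: FILE 2's expression enters p19's (2.13) -/

section Assembly

variable {P : HiggsLattice.Params} {N k nbar : ℕ} [DecidableEq (HiggsLattice.PBond P 0)]

/-- The generalized graph of (2.14) OF p18's graph with its output pairing: lines = `Lines G Po` enumerated by `eL`, endpoints =
the vertices of the lower ∕ upper endpoint, with supplied η-powers `e_v`, line dimensions `a_l` and the constants `d`, `L`, `δ₀`.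
[cite: Balaban1983Higgs3, (2.14) p.427] -/
def modelOfGraph (G : Graph nbar) (Po : OutPairing G) {m : ℕ} (eL : Fin m ≃ Lines G Po) (e : Fin G.nV → ℝ) (a : Fin m → ℝ)
    (d L : ℕ) (δ₀ : ℝ) (hd : 0 < d) (hL : 2 ≤ L) (hδ : 0 < δ₀) : B3Ineq215.Model (Fin G.nV) m where
  src := fun i => lineSrc Po (eL i)
  tgt := fun i => lineTgt Po (eL i)
  e := e
  a := a
  d := d
  L := L
  δ₀ := δ₀
  d_pos := hd
  two_le_L := hL
  δ₀_pos := hδ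

/-- **THE EXPRESSION OF A GRAPH ENTERS (2.13)**: for every graph `G` of p18's model with its output pairing, model data, counterterms,
localizations, kernels and external data (FILE 2's `graphAmp`), every enumeration `eL` of its lines, every scale assignment `j`
with kernel families `K_l(t; x, x′)` dominating the line kernels contracted against the endpoint attachments at `t = j_l` (FILE 12's
hypotheses: this is where (2.10)–(2.12) and (1.18) are fed in), per-leg external data, and charts `c_v` of the unit cubes `□(v)`
into `T_η` on whose images the vertex functions `U_v = uOfKind_v · extAt_v` are supported — the first estimate reads
`|E(G, {□(v)}, Φ_ext, A_ext)| ≤ E_j` for the packaged amplitude of p19's class, to which p19's `Amp.abs_E_le` ∕ `Amp.ineq213` ((2.13),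
PROVED there) apply. [cite: Balaban1983Higgs3, (2.13) p.426] [cite: Balaban1983Higgs3, p.420] -/
theorem abs_graphAmp_le_ampE (G : Graph nbar) (Mh : Model P N k) (dm2 : Fin G.nV → HiggsLattice.Site P 0 → ℝ)
    (loc : Fin G.nV → Loc P k) (Po : OutPairing G)
    (Ks : SLine G → HiggsLattice.Site P 0 × Fin N → HiggsLattice.Site P 0 × Fin N → ℝ)
    (Kv : VLine G → HiggsLattice.PBond P 0 → HiggsLattice.PBond P 0 → ℝ)
    (Ko : Po.Line oRank → HiggsLattice.Site P k × Fin N → HiggsLattice.Site P k × Fin N → ℝ)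
    (Φ : (ExtSLeg G → HiggsLattice.Site P 0 × Fin N) → ℝ) (A : (ExtVLeg G → HiggsLattice.PBond P 0) → ℝ)
    (Ψ : (Po.Ext → HiggsLattice.Site P k × Fin N) → ℝ)
    {m : ℕ} (eL : Fin m ≃ Lines G Po) (e : Fin G.nV → ℝ) (a : Fin m → ℝ) (d L : ℕ) (δ₀ : ℝ) (hd : 0 < d) (hL : 2 ≤ L)
    (hδ : 0 < δ₀) (j : Fin m → ℕ) (K : Fin m → ℕ → HiggsLattice.Site P 0 → HiggsLattice.Site P 0 → ℝ)
    (hKs : ∀ (l : SLine G) (x x' : HiggsLattice.Site P 0),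
      ∑ p, ∑ p', attSK (G.kind l.1.1) l.1.2 x p * attSK (G.kind ((sPairing G).mate l.1).1) ((sPairing G).mate l.1).2 x' p' *
        |Ks l p p'| ≤ K (eL.symm (Sum.inl l)) (j (eL.symm (Sum.inl l))) x x')
    (hKv : ∀ (l : VLine G) (x x' : HiggsLattice.Site P 0),
      ∑ b, ∑ b', attVK Mh.ctr (G.kind l.1.1) x b * attVK Mh.ctr (G.kind ((vPairing G).mate l.1).1) x' b' * |Kv l b b'| ≤
        K (eL.symm (Sum.inr (Sum.inl l))) (j (eL.symm (Sum.inr (Sum.inl l)))) x x')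
    (hKo : ∀ (l : Po.Line oRank) (x x' : HiggsLattice.Site P 0),
      ∑ r, ∑ r', attO k x r * attO k x' r' * |Ko l r r'| ≤ K (eL.symm (Sum.inr (Sum.inr l))) (j (eL.symm (Sum.inr (Sum.inr l)))) x x')
    (nS : ExtSLeg G → HiggsLattice.Site P 0 → ℝ)
    (hΦ : ∀ ξ : ExtSLeg G → HiggsLattice.Site P 0,
      ∑ γ : ExtSLeg G → HiggsLattice.Site P 0 × Fin N, (∏ e, attSK (G.kind e.1.1) e.1.2 (ξ e) (γ e)) * |Φ γ| ≤ ∏ e, nS e (ξ e))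
    (nV : ExtVLeg G → HiggsLattice.Site P 0 → ℝ)
    (hA : ∀ ξ : ExtVLeg G → HiggsLattice.Site P 0,
      ∑ ζ : ExtVLeg G → HiggsLattice.PBond P 0, (∏ e, attVK Mh.ctr (G.kind e.1.1) (ξ e) (ζ e)) * |A ζ| ≤ ∏ e, nV e (ξ e))
    (nO : Po.Ext → HiggsLattice.Site P 0 → ℝ)
    (hΨ : ∀ ξ : Po.Ext → HiggsLattice.Site P 0,
      ∑ ο : Po.Ext → HiggsLattice.Site P k × Fin N, (∏ e, attO k (ξ e) (ο e)) * |Ψ ο| ≤ ∏ e, nO e (ξ e))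
    (kk : ℕ) (box : Fin G.nV → Fin d → ℕ) (c : Fin G.nV → (Fin d → ℕ) → HiggsLattice.Site P 0)
    (hinj : ∀ v, Set.InjOn (c v) ↑(pts L (⟨kk, box v⟩ : Cube d)))
    (hsupp : ∀ v y, uOfKind Mh (dm2 v) (loc v) (G.kind v) y * extAt Po nS nV nO v y ≠ 0 →
      ∃ ξ ∈ pts L (⟨kk, box v⟩ : Cube d), c v ξ = y)
    (C : Fin m → ℝ) (eRun lamRun : ℝ) (dv ds : Fin G.nV → ℕ) (NPhi NA : Fin G.nV → ℝ)
    (C_nonneg : ∀ l, 0 ≤ C l) (eRun_nonneg : 0 ≤ eRun) (lamRun_nonneg : 0 ≤ lamRun) (NPhi_nonneg : ∀ v, 0 ≤ NPhi v)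
    (NA_nonneg : ∀ v, 0 ≤ NA v) (e_nonneg : ∀ v, 0 ≤ e v)
    (conn : LinesConnect (fun i => lineSrc Po (eL i)) (fun i => lineTgt Po (eL i)))
    (u_le : ∀ v ξ, |((L : ℝ) ^ kk) ^ d * (uOfKind Mh (dm2 v) (loc v) (G.kind v) (c v ξ) * extAt Po nS nV nO v (c v ξ))| ≤
      eRun ^ dv v * lamRun ^ ds v * NPhi v * NA v * (((L : ℝ) ^ kk)⁻¹) ^ e v)
    (K_le : ∀ l t, t < kk → ∀ ξ ∈ pts L (⟨kk, box (lineSrc Po (eL l))⟩ : Cube d), ∀ ξ' ∈ pts L (⟨kk, box (lineTgt Po (eL l))⟩ : Cube d),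
      |K l t (c (lineSrc Po (eL l)) ξ) (c (lineTgt Po (eL l)) ξ')| ≤
        C l * (modelOfGraph G Po eL e a d L δ₀ hd hL hδ).sc kk t ^ a l *
          Real.exp (-(2 * δ₀ / (modelOfGraph G Po eL e a d L δ₀ hd hL hδ).sc kk t * (((L : ℝ) ^ kk)⁻¹ * (supDist ξ ξ' : ℝ))))) :
    |graphAmp G Mh dm2 loc Po Ks Kv Ko Φ A Ψ| ≤
      (ampOf (modelOfGraph G Po eL e a d L δ₀ hd hL hδ) kk box c
        (fun v y => uOfKind Mh (dm2 v) (loc v) (G.kind v) y * extAt Po nS nV nO v y) K C eRun lamRun dv ds NPhi NA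
        C_nonneg eRun_nonneg lamRun_nonneg NPhi_nonneg NA_nonneg e_nonneg conn u_le K_le).E j := by
  rw [E_ampOf]
  -- FILE 12 in the one-line-type shape, with the kernels of the scale assignment `j`
  have h12 := abs_graphAmp_le_lines G Mh dm2 loc Po Ks Kv Ko Φ A Ψ
    (fun l => K (eL.symm (Sum.inl l)) (j (eL.symm (Sum.inl l)))) hKs
    (fun l => K (eL.symm (Sum.inr (Sum.inl l))) (j (eL.symm (Sum.inr (Sum.inl l))))) hKv
    (fun l => K (eL.symm (Sum.inr (Sum.inr l))) (j (eL.symm (Sum.inr (Sum.inr l))))) hKo nS hΦ nV hA nO hΨ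
  refine h12.trans (le_of_eq ?_)
  -- re-index the product over `Lines G Po` by `eL`, then chart
  have hker : ∀ (x : Fin G.nV → HiggsLattice.Site P 0),
      ∏ l : Lines G Po, lineKer Po (fun l => K (eL.symm (Sum.inl l)) (j (eL.symm (Sum.inl l))))
          (fun l => K (eL.symm (Sum.inr (Sum.inl l))) (j (eL.symm (Sum.inr (Sum.inl l)))))
          (fun l => K (eL.symm (Sum.inr (Sum.inr l))) (j (eL.symm (Sum.inr (Sum.inr l))))) l (x (lineSrc Po l)) (x (lineTgt Po l)) =
        ∏ i : Fin m, K i (j i) (x (lineSrc Po (eL i))) (x (lineTgt Po (eL i))) := by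
    intro x
    refine (Fintype.prod_equiv eL _ _ fun i => ?_).symm
    rcases h : eL i with l | l | l <;> simp only [lineKer, ← h, Equiv.symm_apply_apply]
  simp only [hker]
  exact sum_positions_eq_boxSum L kk box c hinj _ hsupp (fun i => lineSrc Po (eL i)) (fun i => lineTgt Po (eL i))
    (fun i => K i (j i))

end Assembly

end ToAmp213

/-! ## §8 The block chart of `T_η` and the support of the localized vertex functions (the chart hypotheses of §7, concretely) -/

section BlockChart

open Literature.MathematicalPhysics.QuantumFieldTheory.Balaban1983to89.B3Ineq213
open Literature.MathematicalPhysics.QuantumFieldTheory.Balaban1983to89.B3Ineq215 (Cube)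
open Literature.MathematicalPhysics.QuantumFieldTheory.Balaban1983to89.B3Prop1 (VertexKind)
open Literature.MathematicalPhysics.QuantumFieldTheory.Balaban1983to89.HiggsAveraging (blockIter blockK mem_blockK)

variable {P : HiggsLattice.Params} {k : ℕ}

/-- `sitesPerDir 0 μ = sitesPerDir k μ · L^k` for `k ≤ K` (the torus `T_η`, `η = L^{−k}`, has `L^k` fine sites per coarse site
and direction). [cite: Balaban1982Higgs1, (1.16) p.606] -/
theorem sitesPerDir_zero_eq (hk : k ≤ P.K) (μ : Fin P.d) : P.sitesPerDir 0 μ = P.sitesPerDir k μ * P.L ^ k := by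
  have h : P.L ^ P.K = P.L ^ (P.K - k) * P.L ^ k := by rw [← pow_add, Nat.sub_add_cancel hk]
  unfold HiggsLattice.Params.sitesPerDir
  rw [Nat.sub_zero, h]
  ring

/-- Labels of the iterated block map: `(x_k)_μ = ⌊x_μ ∕ L^k⌋` (`k ≤ K`; from p35's `B1Eq214Concrete.val_blockOf`).
[cite: Balaban1982Higgs1, (1.20) p.607] -/
theorem val_blockIter (hk : k ≤ P.K) (x : HiggsLattice.Site P 0) (μ : Fin P.d) :
    ((blockIter k x) μ).val = (x μ).val / P.L ^ k := by
  induction k with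
  | zero =>
    show (x μ).val = (x μ).val / P.L ^ 0
    rw [pow_zero, Nat.div_one]
  | succ k ih =>
    show ((HiggsLattice.blockOf (blockIter k x)) μ).val = (x μ).val / P.L ^ (k + 1)
    rw [B1Eq214Concrete.val_blockOf (by omega), ih (by omega), pow_succ, Nat.div_div_eq_div_mul]

/-- **The coordinate chart** `ℤ^d_{≥0} → T_η`: `ξ ↦ (ξ_μ mod sitesPerDir 0 μ)_μ` (labels of the fine torus).
[cite: Balaban1982Higgs1, (1.16) p.606] -/
def coordChart (P : HiggsLattice.Params) (ξ : Fin P.d → ℕ) : HiggsLattice.Site P 0 :=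
  fun μ => ((ξ μ : ℕ) : ZMod (P.sitesPerDir 0 μ))

/-- The label box of a block point `y ∈ T₁^{(k)}`: p19's unit cube `□ = ⟨k, boxOf y⟩` of `ηℤ^d_{≥0}` charting `B^k(y)`.
[cite: Balaban1983Higgs3, (2.13) p.426] -/
def boxOf (y : HiggsLattice.Site P k) : Fin P.d → ℕ := fun μ => (y μ).val

/-- The lattice points of the cube `⟨k, boxOf y⟩`: `y_μ L^k ≤ ξ_μ < (y_μ + 1) L^k`. [cite: Balaban1983Higgs3, (2.13) p.426] -/
theorem mem_pts_boxOf (y : HiggsLattice.Site P k) (ξ : Fin P.d → ℕ) :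
    ξ ∈ pts P.L (⟨k, boxOf y⟩ : Cube P.d) ↔ ∀ μ, (y μ).val * P.L ^ k ≤ ξ μ ∧ ξ μ < ((y μ).val + 1) * P.L ^ k := by
  rw [B3Ineq213.mem_pts_iff P.hL]
  simp only [B3Ineq215.Cube.desc, B3Ineq213.pt, Nat.sub_zero, Finset.mem_image, Fintype.mem_piFinset, Finset.mem_Ico,
    B3Ineq215.Cube.mk.injEq, true_and, exists_eq_right, boxOf]

/-- Points of the cube of a block point are honest labels of `T_η` (no wrap-around). [cite: Balaban1982Higgs1, (1.16) p.606] -/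
theorem lt_sitesPerDir_of_mem_pts (hk : k ≤ P.K) (y : HiggsLattice.Site P k) {ξ : Fin P.d → ℕ}
    (hξ : ξ ∈ pts P.L (⟨k, boxOf y⟩ : Cube P.d)) (μ : Fin P.d) : ξ μ < P.sitesPerDir 0 μ := by
  have h := ((mem_pts_boxOf y ξ).1 hξ μ).2
  rw [sitesPerDir_zero_eq hk]
  exact lt_of_lt_of_le h (Nat.mul_le_mul_right _ (ZMod.val_lt (y μ)))

/-- Labels of the chart (no wrap-around). [cite: Balaban1982Higgs1, (1.16) p.606] -/
theorem val_coordChart {ξ : Fin P.d → ℕ} {μ : Fin P.d} (h : ξ μ < P.sitesPerDir 0 μ) : ((coordChart P ξ) μ).val = ξ μ := by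
  simp only [coordChart]
  rw [ZMod.val_natCast, Nat.mod_eq_of_lt h]

/-- The chart is injective on the cube of a block point (hypothesis `hinj` of §7). [cite: Balaban1983Higgs3, (2.13) p.426] -/
theorem coordChart_injOn (hk : k ≤ P.K) (y : HiggsLattice.Site P k) :
    Set.InjOn (coordChart P) ↑(pts P.L (⟨k, boxOf y⟩ : Cube P.d)) := by
  intro ξ hξ ξ' hξ' h
  funext μ
  have hμ := congrArg (fun x : HiggsLattice.Site P 0 => (x μ).val) h
  simpa only [val_coordChart (lt_sitesPerDir_of_mem_pts hk y (Finset.mem_coe.1 hξ) μ),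
    val_coordChart (lt_sitesPerDir_of_mem_pts hk y (Finset.mem_coe.1 hξ') μ)] using hμ

/-- **The block `B^k(y)` IS the charted unit cube**: `x ∈ B^k(y)` iff `x = coordChart ξ` for a lattice point `ξ` of the cube
`⟨k, boxOf y⟩` (label arithmetic: `x ∈ B^k(y) ⇔ ⌊x_μ ∕ L^k⌋ = y_μ ⇔ y_μ L^k ≤ x_μ < (y_μ+1) L^k`).
[cite: Balaban1982Higgs1, (1.20) p.607] [cite: Balaban1983Higgs3, (2.13) p.426] -/
theorem mem_blockK_iff_exists_coordChart (hk : k ≤ P.K) (y : HiggsLattice.Site P k) (x : HiggsLattice.Site P 0) :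
    x ∈ blockK k y ↔ ∃ ξ ∈ pts P.L (⟨k, boxOf y⟩ : Cube P.d), coordChart P ξ = x := by
  rw [mem_blockK]
  constructor
  · intro hxy
    refine ⟨fun μ => (x μ).val, (mem_pts_boxOf y _).2 fun μ => ?_, ?_⟩
    · have hv : (x μ).val / P.L ^ k = (y μ).val := by rw [← val_blockIter hk, hxy]
      refine ⟨?_, ?_⟩
      · rw [← hv]; exact Nat.div_mul_le_self _ _
      · rw [← hv, add_mul, one_mul]; exact Nat.lt_div_mul_add (pow_pos P.hL k)
    · funext μ
      simp only [coordChart, ZMod.natCast_val, ZMod.cast_id', id_eq]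
  · rintro ⟨ξ, hξ, rfl⟩
    funext μ
    apply ZMod.val_injective
    rw [val_blockIter hk, val_coordChart (lt_sitesPerDir_of_mem_pts hk y hξ μ)]
    obtain ⟨h1, h2⟩ := (mem_pts_boxOf y ξ).1 hξ μ
    exact Nat.div_eq_of_lt_le h1 h2

/-- Hence `B^k(y)` is the image of the cube's lattice points under the chart. [cite: Balaban1983Higgs3, (2.13) p.426] -/
theorem blockK_eq_image_coordChart (hk : k ≤ P.K) (y : HiggsLattice.Site P k) :
    blockK k y = (pts P.L (⟨k, boxOf y⟩ : Cube P.d)).image (coordChart P) := by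
  ext x
  rw [mem_blockK_iff_exists_coordChart hk, Finset.mem_image]

variable {N : ℕ} [DecidableEq (HiggsLattice.PBond P 0)]

/-- A site-localized vertex function ((1.6), (1.7)) vanishes where the site weight does. [cite: Balaban1983Higgs3, p.420] -/
theorem uOfKind_eq_zero_of_site (M : Model P N k) (dm2 : HiggsLattice.Site P 0 → ℝ) (l : Loc P k) {κ : VertexKind}
    (hκ : speciesOf κ = .site) {x : HiggsLattice.Site P 0} (h : l.wS x = 0) : uOfKind M dm2 l κ x = 0 := by
  cases κ <;> simp_all [speciesOf, uOfKind, u16, u17]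

/-- A bond-localized vertex function ((1.8)–(1.11)) vanishes where the bond weight vanishes on all bonds starting at the site.
[cite: Balaban1983Higgs3, p.420] -/
theorem uOfKind_eq_zero_of_bond (M : Model P N k) (dm2 : HiggsLattice.Site P 0 → ℝ) (l : Loc P k) {κ : VertexKind}
    (hκ : speciesOf κ = .bond) {x : HiggsLattice.Site P 0} (h : ∀ μ, l.wB ⟨x, μ⟩ = 0) : uOfKind M dm2 l κ x = 0 := by
  cases κ <;> simp_all [speciesOf, uOfKind, u18, u19, u110, u111, bondData]

/-- A point-localized vertex function ((1.13)–(1.15)) vanishes where the point weight of the site's block point does.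
[cite: Balaban1983Higgs3, p.420] -/
theorem uOfKind_eq_zero_of_point (M : Model P N k) (dm2 : HiggsLattice.Site P 0 → ℝ) (l : Loc P k) {κ : VertexKind}
    (hκ : speciesOf κ = .point) {x : HiggsLattice.Site P 0} (h : l.wY (blockIter k x) = 0) : uOfKind M dm2 l κ x = 0 := by
  cases κ <;> simp_all [speciesOf, uOfKind, u113, u114, u115]

/-- **Unit-cube localization ⇒ support in the block**: a site-localized vertex with `Loc.cube y` lives in `B^k(y)`.
[cite: Balaban1983Higgs3, p.420] -/
theorem uOfKind_cube_eq_zero (M : Model P N k) (dm2 : HiggsLattice.Site P 0 → ℝ) (y : HiggsLattice.Site P k) {κ : VertexKind}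
    (hκ : speciesOf κ = .site) {x : HiggsLattice.Site P 0} (hx : x ∉ blockK k y) : uOfKind M dm2 (Loc.cube y) κ x = 0 :=
  uOfKind_eq_zero_of_site M dm2 _ hκ (by simp [Loc.cube, mt (mem_blockK k y x).2 hx])

/-- **Point localization ⇒ support in the block**: a point-localized vertex with `Loc.point y` lives in `B^k(y)`.
[cite: Balaban1983Higgs3, p.420] -/
theorem uOfKind_point_eq_zero (M : Model P N k) (dm2 : HiggsLattice.Site P 0 → ℝ) (y : HiggsLattice.Site P k)
    {κ : VertexKind} (hκ : speciesOf κ = .point) {x : HiggsLattice.Site P 0} (hx : x ∉ blockK k y) :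
    uOfKind M dm2 (Loc.point y) κ x = 0 :=
  uOfKind_eq_zero_of_point M dm2 _ hκ (by simp [Loc.point, mt (mem_blockK k y x).2 hx])

/-- **Smooth leg localization ⇒ support in the supports**: a bond-localized vertex with `Loc.legProd χ c` vanishes at a site where
one of the functions `χ_{c_j}` does (p. 420: *"a support of each function is contained in a cube with sides of length 2"*).
[cite: Balaban1983Higgs3, p.420] -/
theorem uOfKind_legProd_eq_zero (M : Model P N k) (dm2 : HiggsLattice.Site P 0 → ℝ) {ι : Type*}
    (χ : ι → HiggsLattice.Site P 0 → ℝ) {n : ℕ} (c : Fin n → ι) {κ : VertexKind} (hκ : speciesOf κ = .bond)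
    {x : HiggsLattice.Site P 0} (hx : ∃ j, χ (c j) x = 0) : uOfKind M dm2 (Loc.legProd χ c) κ x = 0 := by
  obtain ⟨j, hj⟩ := hx
  exact uOfKind_eq_zero_of_bond M dm2 _ hκ fun μ => Finset.prod_eq_zero (Finset.mem_univ j) hj

/-- **(2.13) FOR THE GRAPHS OF THE MODEL, BLOCK-LOCALIZED**: when every vertex function of the graph is supported in a block
`B^k(y_v)` of `T_η` (`hloc`; by `uOfKind_cube_eq_zero` ∕ `uOfKind_point_eq_zero` this is the case for the unit-cube and point
localizations of p. 420), the chart hypotheses of `abs_graphAmp_le_ampE` are met by the coordinate chart and the label boxes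
`boxOf y_v` with p19's `L := L`, `d := d`, unit cubes of scale `k` (`η = L^{−k}`): `|E(G, {□(v)}, Φ_ext, A_ext)| ≤ E_j` of the
packaged amplitude. [cite: Balaban1983Higgs3, (2.13) p.426] [cite: Balaban1983Higgs3, p.420] -/
theorem abs_graphAmp_le_ampE_blocks (hK : k ≤ P.K) (hL2 : 2 ≤ P.L) {nbar : ℕ} (G : Graph nbar) (Mh : Model P N k)
    (dm2 : Fin G.nV → HiggsLattice.Site P 0 → ℝ) (loc : Fin G.nV → Loc P k) (Po : OutPairing G)
    (Ks : SLine G → HiggsLattice.Site P 0 × Fin N → HiggsLattice.Site P 0 × Fin N → ℝ)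
    (Kv : VLine G → HiggsLattice.PBond P 0 → HiggsLattice.PBond P 0 → ℝ)
    (Ko : Po.Line oRank → HiggsLattice.Site P k × Fin N → HiggsLattice.Site P k × Fin N → ℝ)
    (Φ : (ExtSLeg G → HiggsLattice.Site P 0 × Fin N) → ℝ) (A : (ExtVLeg G → HiggsLattice.PBond P 0) → ℝ)
    (Ψ : (Po.Ext → HiggsLattice.Site P k × Fin N) → ℝ)
    {m : ℕ} (eL : Fin m ≃ Lines G Po) (e : Fin G.nV → ℝ) (a : Fin m → ℝ) (δ₀ : ℝ) (hδ : 0 < δ₀) (j : Fin m → ℕ)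
    (K : Fin m → ℕ → HiggsLattice.Site P 0 → HiggsLattice.Site P 0 → ℝ)
    (hKs : ∀ (l : SLine G) (x x' : HiggsLattice.Site P 0),
      ∑ p, ∑ p', attSK (G.kind l.1.1) l.1.2 x p * attSK (G.kind ((sPairing G).mate l.1).1) ((sPairing G).mate l.1).2 x' p' *
        |Ks l p p'| ≤ K (eL.symm (Sum.inl l)) (j (eL.symm (Sum.inl l))) x x')
    (hKv : ∀ (l : VLine G) (x x' : HiggsLattice.Site P 0),
      ∑ b, ∑ b', attVK Mh.ctr (G.kind l.1.1) x b * attVK Mh.ctr (G.kind ((vPairing G).mate l.1).1) x' b' * |Kv l b b'| ≤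
        K (eL.symm (Sum.inr (Sum.inl l))) (j (eL.symm (Sum.inr (Sum.inl l)))) x x')
    (hKo : ∀ (l : Po.Line oRank) (x x' : HiggsLattice.Site P 0),
      ∑ r, ∑ r', attO k x r * attO k x' r' * |Ko l r r'| ≤ K (eL.symm (Sum.inr (Sum.inr l))) (j (eL.symm (Sum.inr (Sum.inr l)))) x x')
    (nS : ExtSLeg G → HiggsLattice.Site P 0 → ℝ)
    (hΦ : ∀ ξ : ExtSLeg G → HiggsLattice.Site P 0,
      ∑ γ : ExtSLeg G → HiggsLattice.Site P 0 × Fin N, (∏ e, attSK (G.kind e.1.1) e.1.2 (ξ e) (γ e)) * |Φ γ| ≤ ∏ e, nS e (ξ e))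
    (nV : ExtVLeg G → HiggsLattice.Site P 0 → ℝ)
    (hA : ∀ ξ : ExtVLeg G → HiggsLattice.Site P 0,
      ∑ ζ : ExtVLeg G → HiggsLattice.PBond P 0, (∏ e, attVK Mh.ctr (G.kind e.1.1) (ξ e) (ζ e)) * |A ζ| ≤ ∏ e, nV e (ξ e))
    (nO : Po.Ext → HiggsLattice.Site P 0 → ℝ)
    (hΨ : ∀ ξ : Po.Ext → HiggsLattice.Site P 0,
      ∑ ο : Po.Ext → HiggsLattice.Site P k × Fin N, (∏ e, attO k (ξ e) (ο e)) * |Ψ ο| ≤ ∏ e, nO e (ξ e))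
    (y : Fin G.nV → HiggsLattice.Site P k)
    (hloc : ∀ v x, x ∉ blockK k (y v) → uOfKind Mh (dm2 v) (loc v) (G.kind v) x = 0)
    (C : Fin m → ℝ) (eRun lamRun : ℝ) (dv ds : Fin G.nV → ℕ) (NPhi NA : Fin G.nV → ℝ)
    (C_nonneg : ∀ l, 0 ≤ C l) (eRun_nonneg : 0 ≤ eRun) (lamRun_nonneg : 0 ≤ lamRun) (NPhi_nonneg : ∀ v, 0 ≤ NPhi v)
    (NA_nonneg : ∀ v, 0 ≤ NA v) (e_nonneg : ∀ v, 0 ≤ e v)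
    (conn : LinesConnect (fun i => lineSrc Po (eL i)) (fun i => lineTgt Po (eL i)))
    (u_le : ∀ v ξ, |((P.L : ℝ) ^ k) ^ P.d *
        (uOfKind Mh (dm2 v) (loc v) (G.kind v) (coordChart P ξ) * extAt Po nS nV nO v (coordChart P ξ))| ≤
      eRun ^ dv v * lamRun ^ ds v * NPhi v * NA v * (((P.L : ℝ) ^ k)⁻¹) ^ e v)
    (K_le : ∀ l t, t < k → ∀ ξ ∈ pts P.L (⟨k, boxOf (y (lineSrc Po (eL l)))⟩ : Cube P.d),
      ∀ ξ' ∈ pts P.L (⟨k, boxOf (y (lineTgt Po (eL l)))⟩ : Cube P.d), |K l t (coordChart P ξ) (coordChart P ξ')| ≤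
        C l * (modelOfGraph G Po eL e a P.d P.L δ₀ P.hd hL2 hδ).sc k t ^ a l *
          Real.exp (-(2 * δ₀ / (modelOfGraph G Po eL e a P.d P.L δ₀ P.hd hL2 hδ).sc k t *
            (((P.L : ℝ) ^ k)⁻¹ * (supDist ξ ξ' : ℝ))))) :
    |graphAmp G Mh dm2 loc Po Ks Kv Ko Φ A Ψ| ≤
      (ampOf (modelOfGraph G Po eL e a P.d P.L δ₀ P.hd hL2 hδ) k (fun v => boxOf (y v)) (fun _ => coordChart P)
        (fun v x => uOfKind Mh (dm2 v) (loc v) (G.kind v) x * extAt Po nS nV nO v x) K C eRun lamRun dv ds NPhi NA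
        C_nonneg eRun_nonneg lamRun_nonneg NPhi_nonneg NA_nonneg e_nonneg conn u_le K_le).E j := by
  refine abs_graphAmp_le_ampE G Mh dm2 loc Po Ks Kv Ko Φ A Ψ eL e a P.d P.L δ₀ P.hd hL2 hδ j K hKs hKv hKo nS hΦ nV hA nO hΨ
    k (fun v => boxOf (y v)) (fun _ => coordChart P) (fun v => coordChart_injOn hK (y v)) (fun v x hx => ?_) C eRun lamRun dv ds
    NPhi NA C_nonneg eRun_nonneg lamRun_nonneg NPhi_nonneg NA_nonneg e_nonneg conn u_le K_le
  -- support: off `B^k(y_v)` the vertex function vanishes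
  refine (mem_blockK_iff_exists_coordChart hK (y v) x).1 ?_
  by_contra hxB
  exact hx (by rw [hloc v x hxB, zero_mul])

end BlockChart

/-! ## §9 Block refinement of an arbitrary localization: every localized expression is a finite sum of block-localized ones -/

section BlockRefinement

open Literature.MathematicalPhysics.QuantumFieldTheory.Balaban1983to89.B3Ineq213
open Literature.MathematicalPhysics.QuantumFieldTheory.Balaban1983to89.B3Ineq215 (Cube)
open Literature.MathematicalPhysics.QuantumFieldTheory.Balaban1983to89.B3Prop1 (VertexKind)
open Literature.MathematicalPhysics.QuantumFieldTheory.Balaban1983to89.HiggsAveraging (blockIter blockK mem_blockK)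

variable {P : HiggsLattice.Params} {N k : ℕ} [DecidableEq (HiggsLattice.PBond P 0)]

/-- **The piece of a localization living in the block `B^k(y)`**: site weight, bond weight (read at the initial point of the bond)
and point weight cut down to the block of `y ∈ T₁^{(k)}` — the further localization of p. 420 (*"a support of each function is
contained in a cube with sides of length 2"*) refined to the unit blocks of `T_η`. [cite: Balaban1983Higgs3, p.420] -/
def locInBlock (l : Loc P k) (y : HiggsLattice.Site P k) : Loc P k :=
  ⟨fun x => l.wS x * (if blockIter k x = y then 1 else 0), fun b => l.wB b * (if blockIter k b.src = y then 1 else 0),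
    fun y' => l.wY y' * (if y' = y then 1 else 0)⟩

omit [DecidableEq (HiggsLattice.PBond P 0)] in
/-- The block pieces of a localization sum back to it (the blocks partition `T_η`, the points partition `T₁^{(k)}`).
[cite: Balaban1983Higgs3, p.420] -/
theorem sum_locInBlock (l : Loc P k) : Loc.sum (fun y : HiggsLattice.Site P k => locInBlock l y) = l := by
  ext x
  · simp [Loc.sum, locInBlock]
  · simp [Loc.sum, locInBlock]
  · simp [Loc.sum, locInBlock]

/-- **E(G, {loc(v)}) = Σ_{y : v ↦ T₁^{(k)}} E(G, {loc(v)|_{B^k(y_v)}})**: every localized expression of FILE 2 is the sum over the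
assignments of blocks to vertices of its block-refined pieces (FILE 2's `graphAmp_loc_sum` with `sum_locInBlock`).
[cite: Balaban1983Higgs3, p.420] -/
theorem graphAmp_eq_sum_inBlock {nbar : ℕ} (G : Graph nbar) (M : Model P N k) (dm2 : Fin G.nV → HiggsLattice.Site P 0 → ℝ)
    (loc : Fin G.nV → Loc P k) (Po : OutPairing G)
    (Ks : SLine G → HiggsLattice.Site P 0 × Fin N → HiggsLattice.Site P 0 × Fin N → ℝ)
    (Kv : VLine G → HiggsLattice.PBond P 0 → HiggsLattice.PBond P 0 → ℝ)
    (Ko : Po.Line oRank → HiggsLattice.Site P k × Fin N → HiggsLattice.Site P k × Fin N → ℝ)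
    (Φ : (ExtSLeg G → HiggsLattice.Site P 0 × Fin N) → ℝ) (A : (ExtVLeg G → HiggsLattice.PBond P 0) → ℝ)
    (Ψ : (Po.Ext → HiggsLattice.Site P k × Fin N) → ℝ) :
    graphAmp G M dm2 loc Po Ks Kv Ko Φ A Ψ =
      ∑ yv : Fin G.nV → HiggsLattice.Site P k, graphAmp G M dm2 (fun i => locInBlock (loc i) (yv i)) Po Ks Kv Ko Φ A Ψ := by
  rw [graphAmp_loc_sum G M dm2 (fun i y => locInBlock (loc i) y) Po Ks Kv Ko Φ A Ψ]
  simp only [sum_locInBlock]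

/-- Hence `|E(G, {loc(v)})| ≤ Σ_y |E(G, {loc(v)|_{B^k(y_v)}})|`. [cite: Balaban1983Higgs3, p.420] -/
theorem abs_graphAmp_le_sum_inBlock {nbar : ℕ} (G : Graph nbar) (M : Model P N k)
    (dm2 : Fin G.nV → HiggsLattice.Site P 0 → ℝ) (loc : Fin G.nV → Loc P k) (Po : OutPairing G)
    (Ks : SLine G → HiggsLattice.Site P 0 × Fin N → HiggsLattice.Site P 0 × Fin N → ℝ)
    (Kv : VLine G → HiggsLattice.PBond P 0 → HiggsLattice.PBond P 0 → ℝ)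
    (Ko : Po.Line oRank → HiggsLattice.Site P k × Fin N → HiggsLattice.Site P k × Fin N → ℝ)
    (Φ : (ExtSLeg G → HiggsLattice.Site P 0 × Fin N) → ℝ) (A : (ExtVLeg G → HiggsLattice.PBond P 0) → ℝ)
    (Ψ : (Po.Ext → HiggsLattice.Site P k × Fin N) → ℝ) :
    |graphAmp G M dm2 loc Po Ks Kv Ko Φ A Ψ| ≤
      ∑ yv : Fin G.nV → HiggsLattice.Site P k, |graphAmp G M dm2 (fun i => locInBlock (loc i) (yv i)) Po Ks Kv Ko Φ A Ψ| := by
  rw [graphAmp_eq_sum_inBlock]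
  exact Finset.abs_sum_le_sum_abs _ _

/-- **A block piece lives in its block** (all three species): the hypothesis `hloc` of `abs_graphAmp_le_ampE_blocks` for the
refined localizations. [cite: Balaban1983Higgs3, p.420] -/
theorem uOfKind_inBlock_eq_zero (M : Model P N k) (dm2 : HiggsLattice.Site P 0 → ℝ) (l : Loc P k) (y : HiggsLattice.Site P k)
    (κ : VertexKind) {x : HiggsLattice.Site P 0} (hx : x ∉ blockK k y) : uOfKind M dm2 (locInBlock l y) κ x = 0 := by
  have hxy : ¬blockIter k x = y := mt (mem_blockK k y x).2 hx
  rcases hκ : speciesOf κ with _ | _ | _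
  · exact uOfKind_eq_zero_of_site M dm2 _ hκ (by simp [locInBlock, hxy])
  · exact uOfKind_eq_zero_of_bond M dm2 _ hκ fun μ => by simp [locInBlock, hxy]
  · exact uOfKind_eq_zero_of_point M dm2 _ hκ (by simp [locInBlock, hxy])

/-- The absolute weights of a block piece are at most those of the localization. [folklore] -/
private theorem abs_mul_indicator_le (a : ℝ) (p : Prop) [Decidable p] : |a * (if p then 1 else 0)| ≤ |a| := by
  split_ifs <;> simp

/-- **A block piece's vertex function is at most the vertex function** (the vertex functions are monotone in the absolute weights),
so the vertex bound `u_le` of the localization serves every piece. [cite: Balaban1983Higgs3, (2.13) p.426] -/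
theorem uOfKind_inBlock_le (M : Model P N k) (dm2 : HiggsLattice.Site P 0 → ℝ) (l : Loc P k) (y : HiggsLattice.Site P k)
    (κ : VertexKind) (x : HiggsLattice.Site P 0) : uOfKind M dm2 (locInBlock l y) κ x ≤ uOfKind M dm2 l κ x := by
  have hS : |(locInBlock l y).wS x| ≤ |l.wS x| := abs_mul_indicator_le _ _
  have hB : ∀ μ, |(locInBlock l y).wB ⟨x, μ⟩| ≤ |l.wB ⟨x, μ⟩| := fun μ => abs_mul_indicator_le _ _
  have hY : |(locInBlock l y).wY (blockIter k x)| ≤ |l.wY (blockIter k x)| := abs_mul_indicator_le _ _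
  have hbond : ∀ (At : HiggsLattice.VecField P 0) (n' : ℕ) (S : Finset (HiggsLattice.PBond P 0)),
      bondData At n' S (locInBlock l y).wB x ≤ bondData At n' S l.wB x := by
    intro At n' S
    unfold bondData
    refine Finset.sum_le_sum fun μ _ => mul_le_mul_of_nonneg_left ?_ (by split_ifs <;> norm_num)
    exact mul_le_mul_of_nonneg_right (hB μ) (by positivity)
  cases κ with
  | v16 =>
    simp only [uOfKind, u16]
    refine mul_le_mul_of_nonneg_right (mul_le_mul_of_nonneg_left ?_ (abs_nonneg _)) (by split_ifs <;> norm_num)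
    exact mul_le_mul_of_nonneg_left hS (by have := P.mesh_pos 0; positivity)
  | v17 =>
    simp only [uOfKind, u17]
    refine mul_le_mul_of_nonneg_right (mul_le_mul_of_nonneg_left ?_ (by norm_num)) (by split_ifs <;> norm_num)
    exact mul_le_mul_of_nonneg_left hS (by have := P.mesh_pos 0; positivity)
  | v18 n n' =>
    simp only [uOfKind, u18]
    refine mul_le_mul_of_nonneg_left (mul_le_mul_of_nonneg_left (hbond _ _ _) ?_) ?_
    · have := P.mesh_pos 0; positivity
    · have := P.mesh_pos 0; positivity
  | v19 n nb =>
    simp only [uOfKind, u19]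
    refine mul_le_mul_of_nonneg_left (mul_le_mul_of_nonneg_left (hbond _ _ _) ?_) ?_
    · have := P.mesh_pos 0; positivity
    · have := P.mesh_pos 0; positivity
  | v110 n n' =>
    simp only [uOfKind, u110]
    refine mul_le_mul_of_nonneg_left (mul_le_mul_of_nonneg_left (hbond _ _ _) ?_) ?_
    · have := P.mesh_pos 0; positivity
    · have := P.mesh_pos 0; positivity
  | v111 n nb =>
    simp only [uOfKind, u111]
    refine mul_le_mul_of_nonneg_left (mul_le_mul_of_nonneg_left (hbond _ _ _) ?_) ?_
    · have := P.mesh_pos 0; positivity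
    · have := P.mesh_pos 0; positivity
  | v113 =>
    simp only [uOfKind, u113]
    exact mul_le_mul_of_nonneg_right (mul_le_mul_of_nonneg_left hY (abs_nonneg _)) (by split_ifs <;> norm_num)
  | v114 n n' =>
    simp only [uOfKind, u114]
    exact mul_le_mul_of_nonneg_right (mul_le_mul_of_nonneg_left hY (by positivity)) (by split_ifs <;> norm_num)
  | v115 n nb =>
    simp only [uOfKind, u115]
    exact mul_le_mul_of_nonneg_right (mul_le_mul_of_nonneg_left hY (by positivity)) (by split_ifs <;> norm_num)

/-- **(2.13)'s input for an ARBITRARILY localized graph, as a sum over block refinements**: with kernel bounds on the points of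
every pair of blocks, the vertex bound for the given localization (no absolute value needed: the vertex functions and the
external components are non-negative), and connectivity, `|E(G, {loc(v)})| ≤ Σ_{y : v ↦ T₁^{(k)}} E_j(piece_y)` where each
`piece_y` is the packaged amplitude (`ampOf`) of the block-refined localization with unit cubes `boxOf (y v)` — every summand is
in p19's class, so p19's `Amp.abs_E_le` applies termwise (for the smooth leg localizations of p. 420 only the boundedly many `y`
meeting the side-2 supports contribute). [cite: Balaban1983Higgs3, (2.13) p.426] [cite: Balaban1983Higgs3, p.420] -/
theorem abs_graphAmp_le_sum_ampE_blocks (hK : k ≤ P.K) (hL2 : 2 ≤ P.L) {nbar : ℕ} (G : Graph nbar) (Mh : Model P N k)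
    (dm2 : Fin G.nV → HiggsLattice.Site P 0 → ℝ) (loc : Fin G.nV → Loc P k) (Po : OutPairing G)
    (Ks : SLine G → HiggsLattice.Site P 0 × Fin N → HiggsLattice.Site P 0 × Fin N → ℝ)
    (Kv : VLine G → HiggsLattice.PBond P 0 → HiggsLattice.PBond P 0 → ℝ)
    (Ko : Po.Line oRank → HiggsLattice.Site P k × Fin N → HiggsLattice.Site P k × Fin N → ℝ)
    (Φ : (ExtSLeg G → HiggsLattice.Site P 0 × Fin N) → ℝ) (A : (ExtVLeg G → HiggsLattice.PBond P 0) → ℝ)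
    (Ψ : (Po.Ext → HiggsLattice.Site P k × Fin N) → ℝ)
    {m : ℕ} (eL : Fin m ≃ Lines G Po) (e : Fin G.nV → ℝ) (a : Fin m → ℝ) (δ₀ : ℝ) (hδ : 0 < δ₀) (j : Fin m → ℕ)
    (K : Fin m → ℕ → HiggsLattice.Site P 0 → HiggsLattice.Site P 0 → ℝ)
    (hKs : ∀ (l : SLine G) (x x' : HiggsLattice.Site P 0),
      ∑ p, ∑ p', attSK (G.kind l.1.1) l.1.2 x p * attSK (G.kind ((sPairing G).mate l.1).1) ((sPairing G).mate l.1).2 x' p' *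
        |Ks l p p'| ≤ K (eL.symm (Sum.inl l)) (j (eL.symm (Sum.inl l))) x x')
    (hKv : ∀ (l : VLine G) (x x' : HiggsLattice.Site P 0),
      ∑ b, ∑ b', attVK Mh.ctr (G.kind l.1.1) x b * attVK Mh.ctr (G.kind ((vPairing G).mate l.1).1) x' b' * |Kv l b b'| ≤
        K (eL.symm (Sum.inr (Sum.inl l))) (j (eL.symm (Sum.inr (Sum.inl l)))) x x')
    (hKo : ∀ (l : Po.Line oRank) (x x' : HiggsLattice.Site P 0),
      ∑ r, ∑ r', attO k x r * attO k x' r' * |Ko l r r'| ≤ K (eL.symm (Sum.inr (Sum.inr l))) (j (eL.symm (Sum.inr (Sum.inr l)))) x x')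
    (nS : ExtSLeg G → HiggsLattice.Site P 0 → ℝ)
    (hΦ : ∀ ξ : ExtSLeg G → HiggsLattice.Site P 0,
      ∑ γ : ExtSLeg G → HiggsLattice.Site P 0 × Fin N, (∏ e, attSK (G.kind e.1.1) e.1.2 (ξ e) (γ e)) * |Φ γ| ≤ ∏ e, nS e (ξ e))
    (nV : ExtVLeg G → HiggsLattice.Site P 0 → ℝ)
    (hA : ∀ ξ : ExtVLeg G → HiggsLattice.Site P 0,
      ∑ ζ : ExtVLeg G → HiggsLattice.PBond P 0, (∏ e, attVK Mh.ctr (G.kind e.1.1) (ξ e) (ζ e)) * |A ζ| ≤ ∏ e, nV e (ξ e))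
    (nO : Po.Ext → HiggsLattice.Site P 0 → ℝ)
    (hΨ : ∀ ξ : Po.Ext → HiggsLattice.Site P 0,
      ∑ ο : Po.Ext → HiggsLattice.Site P k × Fin N, (∏ e, attO k (ξ e) (ο e)) * |Ψ ο| ≤ ∏ e, nO e (ξ e))
    (hext : ∀ v x, 0 ≤ extAt Po nS nV nO v x)
    (C : Fin m → ℝ) (eRun lamRun : ℝ) (dv ds : Fin G.nV → ℕ) (NPhi NA : Fin G.nV → ℝ)
    (C_nonneg : ∀ l, 0 ≤ C l) (eRun_nonneg : 0 ≤ eRun) (lamRun_nonneg : 0 ≤ lamRun) (NPhi_nonneg : ∀ v, 0 ≤ NPhi v)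
    (NA_nonneg : ∀ v, 0 ≤ NA v) (e_nonneg : ∀ v, 0 ≤ e v)
    (conn : LinesConnect (fun i => lineSrc Po (eL i)) (fun i => lineTgt Po (eL i)))
    (u_le : ∀ v ξ, ((P.L : ℝ) ^ k) ^ P.d *
        (uOfKind Mh (dm2 v) (loc v) (G.kind v) (coordChart P ξ) * extAt Po nS nV nO v (coordChart P ξ)) ≤
      eRun ^ dv v * lamRun ^ ds v * NPhi v * NA v * (((P.L : ℝ) ^ k)⁻¹) ^ e v)
    (K_le : ∀ (ys yt : HiggsLattice.Site P k) (l : Fin m) (t : ℕ), t < k → ∀ ξ ∈ pts P.L (⟨k, boxOf ys⟩ : Cube P.d),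
      ∀ ξ' ∈ pts P.L (⟨k, boxOf yt⟩ : Cube P.d), |K l t (coordChart P ξ) (coordChart P ξ')| ≤
        C l * (modelOfGraph G Po eL e a P.d P.L δ₀ P.hd hL2 hδ).sc k t ^ a l *
          Real.exp (-(2 * δ₀ / (modelOfGraph G Po eL e a P.d P.L δ₀ P.hd hL2 hδ).sc k t *
            (((P.L : ℝ) ^ k)⁻¹ * (supDist ξ ξ' : ℝ))))) :
    |graphAmp G Mh dm2 loc Po Ks Kv Ko Φ A Ψ| ≤
      ∑ yv : Fin G.nV → HiggsLattice.Site P k,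
        (ampOf (modelOfGraph G Po eL e a P.d P.L δ₀ P.hd hL2 hδ) k (fun v => boxOf (yv v)) (fun _ => coordChart P)
          (fun v x => uOfKind Mh (dm2 v) (locInBlock (loc v) (yv v)) (G.kind v) x * extAt Po nS nV nO v x) K C eRun lamRun
          dv ds NPhi NA C_nonneg eRun_nonneg lamRun_nonneg NPhi_nonneg NA_nonneg e_nonneg conn
          (fun v ξ => by
            rw [abs_of_nonneg (mul_nonneg (pow_nonneg (pow_nonneg (Nat.cast_nonneg _) _) _)
              (mul_nonneg (uOfKind_nonneg _ _ _ _ _) (hext v _)))]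
            exact (mul_le_mul_of_nonneg_left (mul_le_mul_of_nonneg_right (uOfKind_inBlock_le Mh (dm2 v) (loc v) (yv v)
              (G.kind v) _) (hext v _)) (pow_nonneg (pow_nonneg (Nat.cast_nonneg _) _) _)).trans (u_le v ξ))
          (fun l t ht ξ hξ ξ' hξ' => K_le _ _ l t ht ξ hξ ξ' hξ')).E j := by
  refine (abs_graphAmp_le_sum_inBlock G Mh dm2 loc Po Ks Kv Ko Φ A Ψ).trans (Finset.sum_le_sum fun yv _ => ?_)
  exact abs_graphAmp_le_ampE_blocks hK hL2 G Mh dm2 (fun i => locInBlock (loc i) (yv i)) Po Ks Kv Ko Φ A Ψ eL e a δ₀ hδ j K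
    hKs hKv hKo nS hΦ nV hA nO hΨ yv (fun v x hx => uOfKind_inBlock_eq_zero Mh (dm2 v) (loc v) (yv v) (G.kind v) hx) C eRun
    lamRun dv ds NPhi NA C_nonneg eRun_nonneg lamRun_nonneg NPhi_nonneg NA_nonneg e_nonneg conn _ _

end BlockRefinement

end

end Literature.MathematicalPhysics.QuantumFieldTheory.Balaban1983to89.B3GraphAmplitudePositionForm
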